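import Literature.MathematicalPhysics.QuantumFieldTheory.Balaban1983to89.Beta.GhostTable
import Literature.MathematicalPhysics.QuantumFieldTheory.Balaban1983to89.Beta.ComposedRoad
import Literature.MathematicalPhysics.QuantumFieldTheory.Balaban1983to89.Beta.BlockLegs
import Literature.MathematicalPhysics.QuantumFieldTheory.Balaban1983to89.Beta.ColourTrace
import Literature.MathematicalPhysics.QuantumFieldTheory.Balaban1983to89.Beta.WindowIdentification

/-!
# `Balaban1983to89.Beta.SquareTable` — THE LEG TABLE OF THE SQUARED PROPAGATOR: the mixed second difference
`D_{μν}(g²)` at the unit cell IS a degree-6 `BubbleTransfer` leg table over the tree's unconditional free legs plus one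
cheap new family (SHIFTED forward differences), with continuum bubble `c·c₄²·∂_μ∂_ν|x|⁻⁴ = c·c₄²·T_{μν}` off the diagonal and
(1.22)-moment `leadingIntegrand (c·c₄²)` — the TABLE SHAPE of the `∂_μ∂_ν(G²)`-type terms of the background-field bubble
(β sub-cell, row BETA-an3 gen 6, BETA-SPEC v1.9r §7.20 (T) row «hdeg, hval ((W1)₀)», located residual «covariant table for the
ACTUAL Hessian vertices»; companion of `GhostTable`, whose cell form `g·D_{μν}g − F_μg·F_νg` is the OTHER shape)

HONEST FRAMING (mandatory, page 1).  «discharging `BetaPertH` makes Bałaban's UV stability UNCONDITIONAL — a real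
constructive-QFT result; it is NOT the continuum limit and NOT the Clay problem.»  Gloss 1 (the LEAD's, BETA-SPEC §0):
«unconditional» means the coupling-window HYPOTHESIS of [Balaban1989LargeFieldII] (B16) p. 355's one displayed END STATEMENT is
discharged INSIDE THE LATTICE RENORMALIZATION PROGRAMME; every other input remains a verbatim QUOTATION of Bałaban's printed
theorems — the result is «B16's theorem with one hypothesis fewer», not a first-principles formalisation of B5–B16.  Gloss 2: the
object is the `EventualForm`-unconditional END statement, NOT «Theorem 2 as printed».  Gloss 3″ (v1.9r §7.20 (c), binding): the
interval hypothesis of [Balaban1987RG1] Thm 2 p. 259 is REPLACED by the (R10-1′) carrier of PARTIAL SUMS; what is made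
unconditional is an END STATEMENT under the explicit γ-smallness restrictions of the kernel binders — never «Theorem 2 as printed»,
never the continuum limit / mass gap / Clay.

WHAT THIS MODULE IS.  `GhostTable` §3 proved the unit-cell identity regrouping the ghost current–current bubble into
`g·D_{μν}g − F_μg·F_νg` (continuum `c₄²·S = c₄²·T/3`).  The background-field bubble has a SECOND shape: the terms `∂_μ∂_ν(G²)` of
[DunneRius1992] (14) (`4∂∂(G²)` spin part and `−(d/4)∂∂(G²)` inside `S`; CONTEXT — the SUM (14) only is printed, the split is
textbook bookkeeping transcribed in `BubbleTransfer.gluonBubble`).  On the lattice the corresponding kernel is the mixed second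
difference of the SQUARE of the propagator, and this module proves:
* DERIVED (§1, any additive group). The SQUARE-CELL IDENTITY
  `D_{e,e′}(g²)(v) = D_{e,e′}g(v)·(g(v+e′+e) + g(v+e′)) + F_e g(v)·(F_{e′}g(v+e) + F_{e′}g(v))` (`mixedDiffFun_sq`) — every factor a
  first or second DIFFERENCE except one undifferenced `g`, paired with the second difference: degree bookkeeping `4+2` and `3+3`.
* DERIVED (§2, `ℤ⁴`). The one new leg family it needs: the SHIFTED FORWARD DIFFERENCE `w ↦ g(w+e_μ+e_ν) − g(w+e_μ)` (`μ ≠ ν`) is a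
  `Leg` of degree 3 with continuum part `c₄∂_ν|x|⁻²` — obtained with NO new analysis as `Leg.lincomb 1 (−1)` of the tree's
  `TwoPower.diffLeg` (shift `e_μ+e_ν`, `‖·‖∞ = 1`) and `TwoPower.fwdLeg μ` (`fwdLegAt`, `fwdLegAt_f/ℓ/a`); and the two translates
  `g(w+e_μ+e_ν)`, `g(w+e_ν)` are the tree's `TwoPower.shiftLeg` (degree 2, continuum part `c₄|x|⁻²`).
* DERIVED (§3). THE SQUARE TABLE `sqP/sqQ` over `Fin 4` with coefficient `c`: `lattBubble = c·D_{μν}(gFree²)(v)` (`lattBubble_sq`),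
  `hdeg = 6` (`hdeg_sq`), `contBubble = c·c₄²·∂_μ∂_ν|x|⁻⁴` (`contBubble_sq`, via `BubbleTransfer.hessInvQuartic_eq_legs`), and for
  `μ ≠ ν`, `x ≠ 0`: `∂_μ∂_ν|x|⁻⁴ = T_{μν}` (`hessInvQuartic_eq_transverse_offDiag`, via `transverse_eq_legs`) hence
  `x_μx_ν·contBubble = leadingIntegrand (c·c₄²) μ ν x` (`hval_sq`) — the `hval` shape of `ComposedRoad` with `κ = c·c₄²`.
* DERIVED (§5, v1.1). THE BACKGROUND-FIELD BUBBLE REALISED AS ONE LATTICE TABLE over `Fin 4 ⊕ Bool`: square sector at `c = 8N²`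
  plus ghost-SHAPE sector at `τ = −2N²` (`bfCoeff/bfP/bfQ`; the coefficients are the LABELLED transcription of the off-diagonal content
  of `BubbleTransfer.bfBubble = 4T − S` with colour factor `2N²`): `hdeg_bf` (6 throughout), the explicit lattice kernel
  `lattBubble_bf = 8N²·D_{μν}(g²) − 4N²·(g·D_{μν}g − F_μg·F_νg)` (`g = latticeGreen/2`, corner `v`), `contBubble_bf =
  2N²c₄²(4∂_μ∂_ν|x|⁻⁴ − S/c₄²)` (`= 2N²c₄²·bfBubble` off the diagonal, `contBubble_bf_eq_bfBubble`), and
  `hval_bf : x_μx_ν·contBubble = leadingIntegrand (kappaBal N) μ ν x` — `8N²c₄² − 2N²c₄²/3 = kappaBal N` EXACTLY: the two binders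
  `hdeg`, `hval` of `ComposedRoad.oneLoopDrift_of_composedLegInterfacePow` are met by a CONCRETE table over UNCONDITIONAL free legs
  (`BubbleTransfer.hval_of_bfTable` had the continuum shape over ARBITRARY legs; here the lattice kernel is explicit).  What is NOT
  proved: that Bałaban's `k = 0` one-loop integrand IS the off-contact part of `lattBubble_bf` — the located residual, an2 (I2-b) /
  an5 BETA-DICT.
* DERIVED (§6, v1.1). THE (R11) WALL WITH (W1)₀ DISCHARGED: `oneLoopDrift_of_realisedTable` =
  `ComposedRoad.oneLoopDrift_of_composedLegInterfacePow_identity` applied to the realised table, its binders `hdeg`/`hval` supplied by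
  `hdeg_bf`/`hval_bf`; the REMAINING hypotheses are verbatim the window data of the ACTUAL legs against the table legs ((W2′)₀ `hF`/`hG`),
  the tails ((W3a)₀), the identification of the composed coefficient with the window sum of the actual table ((W3b)₀ `hident`) and
  `IdentityForm` ([H-germ′]) — i.e. exactly the located residual, now typed against a concrete table.
* DERIVED (§7, v1.1). SHIFTED MIXED SECOND-DIFFERENCE LEGS — genuine (elementary) analysis, the one leg shape the tree lacked:
  `quad_polar_affine` (the base point drops out of the polarisation of a quadratic form), `shifted_mixed_diff_invSq`
  (`|D_{μν}(1/|·|²)(w+α) − ∂_μ∂_ν|w|⁻²| ≤ 14848(r+1)³/‖w‖∞⁵` for `‖α‖∞ ≤ r`, `2(r+1) ≤ ‖w‖∞`: four third-order expansions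
  `TwoPowerLegs.taylor3_invSq` about the UNSHIFTED corner), and `shiftMixedLeg T hμν hα hB h : Leg` for any `TwoPower` family with
  (F3) sharp differences: `f(w) = D_{μν}g(w+α)`, `ℓ = c₄∂_μ∂_ν|x|⁻²`, degree 4, `B = 64B₃ + 14848c₄(r+1)³ + 32(4U+10c₄)(r+1)⁵`.
  With `TwoPower.shiftLeg` (degree 2) and `Leg.lincomb`s of `TwoPower.diffLeg` (degree 3, `fwdSh`) the leg toolkit is CLOSED
  UNDER BOUNDED CORNER SHIFTS.
* DERIVED (§8, v1.1). TRANSLATED TABLES: for every lattice shift `‖α‖∞ ≤ r` (`1 ≤ r`) the realised table re-based at the corner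
  `v + α` (`bfPsh/bfQsh`) is again a `Leg` table of degree 6 (`hdeg_bfSh`) whose lattice kernel is the realised kernel at the
  shifted corner (`lattBubble_bfSh`) and whose continuum bubble is UNCHANGED (`contBubble_bfSh`), hence `hval_bfSh` with the same
  `kappaBal N`: (W1)₀ is met in EVERY bounded vertex-labelling convention — whichever corner of the cell the actual Hessian kernel
  (an2 (I2-b)) attaches its label to, the table binders hold verbatim.
* ARITHMETIC (§4, LABELLED bookkeeping, context only). At `c = 4τ`, `τ = 2N²`: `κ = 8N²c₄² = 12·kappaBal N/11` (`kappa_sq_eq`); with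
  `GhostTable`'s sectors, `12/11 − 2/11 + 1/11 = 1` (`kappaBal_three_sectors`: spin `+12`, vector-Laplacian `−2 = 4 copies × (−½)`,
  ghost `+1`, in units of `kappaBal N/11` — the textbook «11/3 = 4 − 2/3 + 1/3»; which lattice vertex produces which coefficient is
  NOT asserted here: an2 (I2-b) / an5 BETA-DICT).
* NOT TOUCHED (located, by name): the spin («paramagnetic») vertex of the Wilson-plaquette Hessian and its exact jets (an2 (I2-b),
  `Beta.BackgroundVertices`); Bałaban's vector propagator in the axial + `R` gauge (an5-g7 `Beta.VectorPropagatorDict`); the `a`-term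
  legs ((W2′)₀); the torus ↔ `ℤ⁴` matching of `g` (AN2 (v1₀)); shifted MIXED legs (a second difference at a shifted point is NOT a
  `lincomb` of tree legs at degree 4 — the leading parts cancel — and would need a Hessian-symbol Lipschitz bound; the square-cell
  identity is arranged so that none is needed); every `k ≥ 1` object.

Sources.  [DunneRius1992] G. Dunne, K. Rius, A comment on the relationship between one-loop β-functions in background-field and
x-space methods, Phys. Lett. B 293 (1992) 367, eq. (14): CONTEXT (which continuum terms have this shape); nothing of it is used.
[Balaban1987RG1] (INDEX B12) p. 264 (1.20)–(1.22): CONTEXT (the moment whose shape `hval` serves).  [Lawler1991]/[LawlerLimic2010]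
enter ONLY through the imported unconditional legs of `TwoPowerLegs`/`BubbleTransfer` (kernel theorems there).
Tags: [folklore] = elementary algebra proved here, or a definition asserting nothing.  No `axiom`, no `sorry`.  v1.1 = v1 + §§5–8
appended (imports `…Beta.ComposedRoad` for §6 and `…Beta.BlockLegs` for `supNorm_add_le_real` added); every v1 declaration byte-identical.
v1.2 = v1.1 + §9 appended (the end-to-end END statement with the realised table; the coefficient labels through the group trace,
`ColourTrace`, import added); every v1.1 declaration byte-identical.  v1.3 = v1.2 + §§10–11 appended (actual-leg stencils, graded window
adapter; the stencil `F′G′` table in closed form, (W3b)₀ scalar form); every v1.2 declaration byte-identical.  v1.4 = v1.3 + §12 appended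
((W3b)₀ for the stencil legs from a full-sum identification, import `WindowIdentification` added); every v1.3 declaration byte-identical.  v1.5 = v1.4 + §13
appended ((W3a)₀ for the stencil legs from graded decay; the scalar wall); every v1.4 declaration byte-identical.  v1.6 = v1.5 + §14 appended (the end
statement `EndpointExistence` from the scalar wall); every v1.5 declaration byte-identical.  v1.7 = v1.6 + §15 appended (RULING (R13-3): the
base-point-averaged scalar wall, plugging `ComposedRoad` §10); every v1.6 declaration byte-identical.
-/

noncomputable section

namespace Literature.MathematicalPhysics.QuantumFieldTheory.Balaban1983to89.Beta.SquareTable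

open Finset
open scoped BigOperators
open Literature.Probability.LatticeModels (latticeGreen)
open Literature.MathematicalPhysics.QuantumFieldTheory.Balaban1983to89
open Literature.MathematicalPhysics.QuantumFieldTheory.Balaban1983to89.Beta
open Literature.MathematicalPhysics.QuantumFieldTheory.Balaban1983to89.Beta.BubbleTransfer
open Literature.MathematicalPhysics.QuantumFieldTheory.Balaban1983to89.Beta.TwoPowerLegs
open Literature.MathematicalPhysics.QuantumFieldTheory.Balaban1983to89.Beta.TransverseStructure
open Literature.MathematicalPhysics.QuantumFieldTheory.Balaban1983to89.Beta.TransverseLink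
open Literature.MathematicalPhysics.QuantumFieldTheory.Balaban1983to89.Beta.LeadingCoefficient
open Literature.MathematicalPhysics.QuantumFieldTheory.Balaban1983to89.Beta.GhostTable
open Literature.MathematicalPhysics.QuantumFieldTheory.Balaban1983to89.Beta.BlockLegs (supNorm_add_le_real)
open Literature.MathematicalPhysics.QuantumFieldTheory.Balaban1983to89.Beta.DyadicShell (Pt toReal supNorm norm_toReal toReal_add
  supNorm_eq_zero_iff toReal_eq_zero_iff)

/-! ## §1 The square-cell identity (any additive group) -/

section Cell

variable {Λ : Type*} [AddCommGroup Λ]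

/-- **THE SQUARE-CELL IDENTITY**: the mixed second difference of `g²` over the cell with corner `v`,
`D_{e,e′}(g²)(v) = D_{e,e′}g(v)·(g(v+e′+e) + g(v+e′)) + F_e g(v)·(F_{e′}g(v+e) + F_{e′}g(v))`. [folklore] -/
theorem mixedDiffFun_sq (g : Λ → ℝ) (e e' v : Λ) :
    mixedDiffFun (fun u => g u ^ 2) e e' v =
      mixedDiffFun g e e' v * (g (v + e' + e) + g (v + e')) +
        fwdDiffFun g e v * (fwdDiffFun g e' (v + e) + fwdDiffFun g e' v) := by
  simp only [mixedDiffFun, fwdDiffFun, add_right_comm v e e']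
  ring

/-- The same with the shifted forward difference written out: `F_{e′}g(v+e) = g(v+e′+e) − g(v+e)`. [folklore] -/
theorem mixedDiffFun_sq' (g : Λ → ℝ) (e e' v : Λ) :
    mixedDiffFun (fun u => g u ^ 2) e e' v =
      mixedDiffFun g e e' v * (g (v + e' + e) + g (v + e')) +
        fwdDiffFun g e v * ((g (v + e' + e) - g (v + e)) + fwdDiffFun g e' v) := by
  rw [mixedDiffFun_sq, fwdDiffFun, fwdDiffFun, fwdDiffFun, add_right_comm v e e']

end Cell

/-! ## §2 The legs on `ℤ⁴`: two translates (tree `shiftLeg`) and the SHIFTED forward difference (a `lincomb` of tree legs) -/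

section Legs

/-- `‖e_μ + e_ν‖∞ ≤ 1` for `μ ≠ ν`. [folklore] -/
theorem supNorm_unitVec_add_le {μ ν : Fin 4} (hμν : μ ≠ ν) : supNorm (unitVec μ + unitVec ν) ≤ 1 :=
  (supNorm_unitVec_add hμν).le

/-- `‖e_ν‖∞ ≤ 1`. [folklore] -/
theorem supNorm_unitVec_le (ν : Fin 4) : supNorm (unitVec ν) ≤ 1 := (supNorm_unitVec ν).le

/-- The DOUBLE TRANSLATE `w ↦ g(w + e_μ + e_ν)` of the free family (tree `TwoPower.shiftLeg`, degree 2). [folklore] -/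
def shiftLeg₂ {μ ν : Fin 4} (hμν : μ ≠ ν) : Leg := free.shiftLeg (supNorm_unitVec_add_le hμν) le_rfl

/-- The SINGLE TRANSLATE `w ↦ g(w + e_ν)` (tree `TwoPower.shiftLeg`, degree 2). [folklore] -/
def shiftLeg₁ (ν : Fin 4) : Leg := free.shiftLeg (supNorm_unitVec_le ν) le_rfl

/-- unfolding. [folklore] -/
@[simp] theorem shiftLeg₂_f {μ ν : Fin 4} (hμν : μ ≠ ν) (L k : ℕ) (w : Pt) :
    (shiftLeg₂ hμν).f L k w = gFree (w + (unitVec μ + unitVec ν)) := rfl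
/-- unfolding. [folklore] -/
@[simp] theorem shiftLeg₂_ℓ {μ ν : Fin 4} (hμν : μ ≠ ν) (x : E4) : (shiftLeg₂ hμν).ℓ x = c4 * invSq x := rfl
/-- unfolding. [folklore] -/
@[simp] theorem shiftLeg₂_a {μ ν : Fin 4} (hμν : μ ≠ ν) : (shiftLeg₂ hμν).a = 2 := rfl
/-- unfolding. [folklore] -/
@[simp] theorem shiftLeg₁_f (ν : Fin 4) (L k : ℕ) (w : Pt) : (shiftLeg₁ ν).f L k w = gFree (w + unitVec ν) := rfl
/-- unfolding. [folklore] -/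
@[simp] theorem shiftLeg₁_ℓ (ν : Fin 4) (x : E4) : (shiftLeg₁ ν).ℓ x = c4 * invSq x := rfl
/-- unfolding. [folklore] -/
@[simp] theorem shiftLeg₁_a (ν : Fin 4) : (shiftLeg₁ ν).a = 2 := rfl

/-- **THE SHIFTED FORWARD DIFFERENCE** `w ↦ g(w+e_μ+e_ν) − g(w+e_μ)` (`μ ≠ ν`): the difference of the tree's `diffLeg` along
`e_μ + e_ν` and `fwdLeg μ` — a `Leg` of degree 3, NO new analysis. [folklore] -/
def fwdLegAt {μ ν : Fin 4} (hμν : μ ≠ ν) : Leg :=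
  Leg.lincomb 1 (-1) (free.diffLeg (supNorm_unitVec_add_le hμν) le_rfl) (free.fwdLeg μ) rfl

/-- Contraction against `e_μ + e_ν` picks two components. [folklore] -/
theorem sum_toReal_unitVec_add_mul (μ ν : Fin 4) (F : Fin 4 → ℝ) :
    ∑ l, toReal (unitVec μ + unitVec ν) l * F l = F μ + F ν := by
  rw [DyadicShell.toReal_add]
  simp only [Pi.add_apply, add_mul, Finset.sum_add_distrib, sum_toReal_unitVec_mul]

/-- unfolding: the lattice function IS the shifted forward difference. [folklore] -/
@[simp] theorem fwdLegAt_f {μ ν : Fin 4} (hμν : μ ≠ ν) (L k : ℕ) (w : Pt) :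
    (fwdLegAt hμν).f L k w = gFree (w + (unitVec μ + unitVec ν)) - gFree (w + unitVec μ) := by
  simp only [fwdLegAt, Leg.lincomb, TwoPower.diffLeg_f, TwoPower.fwdLeg_f, free_g_eq]
  ring

/-- its continuum part is `c₄∂_ν|x|⁻²` (the `e_μ`-components cancel). [folklore] -/
@[simp] theorem fwdLegAt_ℓ {μ ν : Fin 4} (hμν : μ ≠ ν) (x : E4) : (fwdLegAt hμν).ℓ x = c4 * d1InvSq ν x := by
  simp only [fwdLegAt, Leg.lincomb, TwoPower.diffLeg_ℓ, TwoPower.fwdLeg_ℓ, sum_toReal_unitVec_add_mul]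
  ring

/-- its degree. [folklore] -/
@[simp] theorem fwdLegAt_a {μ ν : Fin 4} (hμν : μ ≠ ν) : (fwdLegAt hμν).a = 3 := rfl

end Legs

/-! ## §3 The square table on `ℤ⁴`: `lattBubble = c·D_{μν}(g²)`, `hdeg = 6`, `contBubble = c·c₄²·∂_μ∂_ν|x|⁻⁴`, `hval κ = c·c₄²` -/

section Table

/-- coefficients: `c` on each of the four products. [folklore] -/
def sqCoeff (c : ℝ) : Fin 4 → ℝ := fun _ => c

/-- first legs: `D_{μν}g, D_{μν}g, F_μg, F_μg`. [folklore] -/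
def sqP {μ ν : Fin 4} (hμν : μ ≠ ν) : Fin 4 → Leg := ![freeMixedLeg hμν, freeMixedLeg hμν, free.fwdLeg μ, free.fwdLeg μ]

/-- second legs: `g(·+e_μ+e_ν), g(·+e_ν), F_νg(·+e_μ), F_νg`. [folklore] -/
def sqQ {μ ν : Fin 4} (hμν : μ ≠ ν) : Fin 4 → Leg := ![shiftLeg₂ hμν, shiftLeg₁ ν, fwdLegAt hμν, free.fwdLeg ν]

/-- **DEGREE BOOKKEEPING**: `4+2, 4+2, 3+3, 3+3 = 6` — the `hdeg` hypothesis of `ComposedRoad`. [folklore] -/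
theorem hdeg_sq {μ ν : Fin 4} (hμν : μ ≠ ν) : ∀ i ∈ (Finset.univ : Finset (Fin 4)), (sqP hμν i).a + (sqQ hμν i).a = 6 := by
  intro i _
  fin_cases i <;> simp [sqP, sqQ]

/-- **THE LATTICE TABLE IS `c·D_{μν}(g²)` AT THE CORNER** (every `(L,k)`; the free legs do not depend on `(L,k)`). [folklore] -/
theorem lattBubble_sq {μ ν : Fin 4} (hμν : μ ≠ ν) (c : ℝ) (L k : ℕ) (v : Pt) :
    lattBubble Finset.univ (sqCoeff c) (sqP hμν) (sqQ hμν) L k v =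
      c * mixedDiffFun (fun u => gFree u ^ 2) (unitVec μ) (unitVec ν) v := by
  rw [mixedDiffFun_sq', lattBubble, Fin.sum_univ_four]
  simp only [sqCoeff, sqP, sqQ, Matrix.cons_val_zero, Matrix.cons_val_one, Matrix.cons_val, freeMixedLeg_f, shiftLeg₂_f,
    shiftLeg₁_f, fwdLegAt_f, TwoPower.fwdLeg_f, free_g_eq, mixedDiffFun, fwdDiffFun, add_assoc, add_comm (unitVec ν) (unitVec μ)]
  ring

/-- **THE CONTINUUM BUBBLE IS `c·c₄²·∂_μ∂_ν|x|⁻⁴`** (`= c·c₄²·(2|x|⁻²∂_μ∂_ν|x|⁻² + 2∂_μ|x|⁻²∂_ν|x|⁻²)`,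
`BubbleTransfer.hessInvQuartic_eq_legs`). [folklore] -/
theorem contBubble_sq {μ ν : Fin 4} (hμν : μ ≠ ν) (c : ℝ) (x : E4) :
    contBubble Finset.univ (sqCoeff c) (sqP hμν) (sqQ hμν) x = c * c4 ^ 2 * hessInvQuartic μ ν x := by
  rw [contBubble, Fin.sum_univ_four, hessInvQuartic_eq_legs]
  simp only [sqCoeff, sqP, sqQ, Matrix.cons_val_zero, Matrix.cons_val_one, Matrix.cons_val, freeMixedLeg_ℓ, shiftLeg₂_ℓ,
    shiftLeg₁_ℓ, fwdLegAt_ℓ, TwoPower.fwdLeg_ℓ]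
  ring

/-- Off the diagonal and the origin, `∂_μ∂_ν|x|⁻⁴ = T_{μν}` (`transverse_eq_legs`: the `δ_{μν}` term is absent). [folklore] -/
theorem hessInvQuartic_eq_transverse_offDiag {μ ν : Fin 4} (hμν : μ ≠ ν) {x : E4} (hx : x ≠ 0) :
    hessInvQuartic μ ν x = transverse μ ν x := by
  rw [transverse_eq_legs μ ν hx, if_neg hμν, sub_zero, hessInvQuartic_eq_legs]

/-- **`hval` OF THE SQUARE TABLE**: `x_μx_ν·contBubble = leadingIntegrand (c·c₄²) μ ν x` for `μ ≠ ν`, `x ≠ 0` — the binder shape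
of `ComposedRoad.oneLoopDrift_of_composedLegInterfacePow`. [folklore] -/
theorem hval_sq {μ ν : Fin 4} (hμν : μ ≠ ν) (c : ℝ) :
    ∀ x : E4, x ≠ 0 → x μ * x ν * contBubble Finset.univ (sqCoeff c) (sqP hμν) (sqQ hμν) x = leadingIntegrand (c * c4 ^ 2) μ ν x := by
  intro x hx
  rw [contBubble_sq, hessInvQuartic_eq_transverse_offDiag hμν hx, ← smul_moment_eq_leadingIntegrand hμν, mul_assoc]

/-- **COMBINED WITH THE GHOST TABLE** (`GhostTable.hval_of_sectors`): the disjoint union of a square table with coefficient `c`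
and a ghost table with coefficient `τ` has `hval` constant `c·c₄² + τ·c₄²/3`. [folklore] -/
theorem hval_sq_ghost {μ ν : Fin 4} (hμν : μ ≠ ν) (c τ : ℝ) :
    ∀ x : E4, x ≠ 0 →
      x μ * x ν * (contBubble Finset.univ (sqCoeff c) (sqP hμν) (sqQ hμν) x +
          contBubble Finset.univ (ghostCoeff τ) (ghostP μ) (ghostQ hμν) x) =
        leadingIntegrand (c * c4 ^ 2 + τ * c4 ^ 2 / 3) μ ν x := by
  intro x hx
  rw [mul_add, hval_sq hμν c x hx, hval_ghost hμν τ x, leadingIntegrand_apply, leadingIntegrand_apply, leadingIntegrand_apply]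
  ring

end Table

/-! ## §4 Arithmetic of the sector weights (LABELLED bookkeeping; context only) -/

section Sectors

/-- At `c = 4τ`, `τ = 2N²`: `κ = 8N²c₄² = 12·kappaBal N/11` (`GhostTable.kappa_ghost_eq`: `2N²c₄²/3 = kappaBal N/11`). [folklore] -/
theorem kappa_sq_eq (N : ℝ) : 4 * (2 * N ^ 2) * c4 ^ 2 = 12 * (kappaBal N / 11) := by
  rw [← kappa_ghost_eq N]; ring

/-- The three labelled sectors in units of `kappaBal N/11`: spin `+12`, vector-Laplacian `−2` (`= 4` copies `× (−½)`), ghost `+1`: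
`12 − 2 + 1 = 11` («11/3 = 4 − 2/3 + 1/3»). [folklore] -/
theorem kappaBal_three_sectors (N : ℝ) :
    12 * (kappaBal N / 11) + 4 * (-(1 / 2 : ℝ)) * (kappaBal N / 11) + kappaBal N / 11 = kappaBal N := by ring

/-- and the same as `hval` constants: square table at `c = 4·2N²`, four vector copies of the ghost table at weight `−½`, one ghost
table. [folklore] -/
theorem kappaBal_three_sectors' (N : ℝ) :
    4 * (2 * N ^ 2) * c4 ^ 2 + 4 * (-(1 / 2 : ℝ)) * (2 * N ^ 2 * c4 ^ 2 / 3) + 2 * N ^ 2 * c4 ^ 2 / 3 = kappaBal N := by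
  rw [kappa_sq_eq, kappa_ghost_eq]; ring

end Sectors

/-! ## §5 The background-field bubble REALISED as one lattice table over unconditional legs: `hval κ = kappaBal N` exactly -/

section Realised

/-- Index set of the realised table: four square products and two ghost-shape products. [folklore] -/
abbrev BfIdx : Type := Fin 4 ⊕ Bool

/-- coefficients: square sector `8N²` (`= 4·2N²`), ghost-SHAPE sector `−2N²` — the off-diagonal content of `BubbleTransfer.bfBubble =
4T − S` with the colour dictionary `2N²` (LABELLED: transcribed continuum bookkeeping, AN3 §6.5 (D3)/(D4); which lattice vertex
produces which coefficient is an2 (I2-b) / an5 BETA-DICT, NOT asserted). [folklore] -/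
def bfCoeff (N : ℝ) : BfIdx → ℝ := Sum.elim (sqCoeff (8 * N ^ 2)) (ghostCoeff (-(2 * N ^ 2)))

/-- first legs. [folklore] -/
def bfP {μ ν : Fin 4} (hμν : μ ≠ ν) : BfIdx → Leg := Sum.elim (sqP hμν) (ghostP μ)

/-- second legs. [folklore] -/
def bfQ {μ ν : Fin 4} (hμν : μ ≠ ν) : BfIdx → Leg := Sum.elim (sqQ hμν) (ghostQ hμν)

/-- degree bookkeeping of the realised table: `6` throughout. [folklore] -/
theorem hdeg_bf {μ ν : Fin 4} (hμν : μ ≠ ν) : ∀ i ∈ (Finset.univ : Finset BfIdx), (bfP hμν i).a + (bfQ hμν i).a = 6 := by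
  rintro (i | b) _
  · exact hdeg_sq hμν i (Finset.mem_univ _)
  · exact hdeg_ghost hμν b (Finset.mem_univ _)

/-- the realised table splits as square sector + ghost-shape sector (continuum side). [folklore] -/
theorem contBubble_bf_split {μ ν : Fin 4} (hμν : μ ≠ ν) (N : ℝ) (x : E4) :
    contBubble Finset.univ (bfCoeff N) (bfP hμν) (bfQ hμν) x =
      contBubble Finset.univ (sqCoeff (8 * N ^ 2)) (sqP hμν) (sqQ hμν) x +
        contBubble Finset.univ (ghostCoeff (-(2 * N ^ 2))) (ghostP μ) (ghostQ hμν) x := by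
  simp only [contBubble, Fintype.sum_sum_type, bfCoeff, bfP, bfQ, Sum.elim_inl, Sum.elim_inr]

/-- idem on the lattice side. [folklore] -/
theorem lattBubble_bf_split {μ ν : Fin 4} (hμν : μ ≠ ν) (N : ℝ) (L k : ℕ) (v : Pt) :
    lattBubble Finset.univ (bfCoeff N) (bfP hμν) (bfQ hμν) L k v =
      lattBubble Finset.univ (sqCoeff (8 * N ^ 2)) (sqP hμν) (sqQ hμν) L k v +
        lattBubble Finset.univ (ghostCoeff (-(2 * N ^ 2))) (ghostP μ) (ghostQ hμν) L k v := by
  simp only [lattBubble, Fintype.sum_sum_type, bfCoeff, bfP, bfQ, Sum.elim_inl, Sum.elim_inr]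

/-- **THE EXPLICIT LATTICE KERNEL**: `8N²·D_{μν}(g²)(v) − 4N²·(g·D_{μν}g − F_μg·F_νg)(v)` with `g = latticeGreen/2`. [folklore] -/
theorem lattBubble_bf {μ ν : Fin 4} (hμν : μ ≠ ν) (N : ℝ) (L k : ℕ) (v : Pt) :
    lattBubble Finset.univ (bfCoeff N) (bfP hμν) (bfQ hμν) L k v =
      8 * N ^ 2 * mixedDiffFun (fun u => gFree u ^ 2) (unitVec μ) (unitVec ν) v -
        4 * N ^ 2 * cellForm gFree (unitVec μ) (unitVec ν) v := by
  rw [lattBubble_bf_split, lattBubble_sq, lattBubble_ghost]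
  ring

/-- **THE CONTINUUM BUBBLE IS `2N²c₄²·(4·∂_μ∂_ν|x|⁻⁴ − S/c₄²)`** unconditionally, [folklore] -/
theorem contBubble_bf {μ ν : Fin 4} (hμν : μ ≠ ν) (N : ℝ) (x : E4) :
    contBubble Finset.univ (bfCoeff N) (bfP hμν) (bfQ hμν) x =
      2 * N ^ 2 * c4 ^ 2 * (4 * hessInvQuartic μ ν x - scalarBubble μ ν x) := by
  rw [contBubble_bf_split, contBubble_sq, contBubble_ghost]
  ring

/-- and hence, off the diagonal and the origin, `= 2N²c₄²·bfBubble_{μν}` — `BubbleTransfer.bfBubble = 4T − S`, the transcription of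
[DunneRius1992] (14) at `d = 4` (CONTEXT: the lattice table REALISES that continuum shape; nothing printed is used). [folklore] -/
theorem contBubble_bf_eq_bfBubble {μ ν : Fin 4} (hμν : μ ≠ ν) (N : ℝ) {x : E4} (hx : x ≠ 0) :
    contBubble Finset.univ (bfCoeff N) (bfP hμν) (bfQ hμν) x = 2 * N ^ 2 * c4 ^ 2 * bfBubble μ ν x := by
  rw [contBubble_bf, hessInvQuartic_eq_transverse_offDiag hμν hx, bfBubble, gluonBubble, ghostBubble]
  ring

/-- **`hval` OF THE REALISED TABLE IS BAŁABAN'S NORMALISED CONSTANT EXACTLY**: `x_μx_ν·contBubble = leadingIntegrand (kappaBal N) μ ν x`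
(`μ ≠ ν`, `x ≠ 0`) — `8N²c₄² − 2N²c₄²/3 = 22N²c₄²/3 = kappaBal N`.  With `hdeg_bf` these are the two binders of
`ComposedRoad.oneLoopDrift_of_composedLegInterfacePow` for the table `(univ, bfCoeff N, bfP, bfQ)` over UNCONDITIONAL free legs; what is
NOT proved is that Bałaban's `k = 0` one-loop integrand IS (the off-contact part of) `lattBubble_bf` — the located residual (an2 (I2-b) /
an5 BETA-DICT). [folklore] -/
theorem hval_bf {μ ν : Fin 4} (hμν : μ ≠ ν) (N : ℝ) :
    ∀ x : E4, x ≠ 0 → x μ * x ν * contBubble Finset.univ (bfCoeff N) (bfP hμν) (bfQ hμν) x = leadingIntegrand (kappaBal N) μ ν x := by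
  intro x hx
  rw [contBubble_bf_split, hval_sq_ghost hμν _ _ x hx]
  congr 1
  have h := kappa_ghost_eq N
  linear_combination (11 : ℝ) * h

end Realised

/-! ## §6 The (R11) wall with (W1)₀ DISCHARGED by the realised table: the remaining binders are (W2′)₀/(W3a)₀/(W3b)₀ and `IdentityForm` -/

section Wall

open Literature.Probability.LatticeModels (annulus)
open FlowStep
open Literature.MathematicalPhysics.QuantumFieldTheory.Balaban1983to89.Beta.LargeLWindow.WindowDecomposition (constA)
open Literature.MathematicalPhysics.QuantumFieldTheory.Balaban1983to89.Beta.Drift (OneLoopDrift)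
open Literature.MathematicalPhysics.QuantumFieldTheory.Balaban1983to89.Beta.MarginalTelescoping (composedCoeff IdentityForm)
open Literature.MathematicalPhysics.QuantumFieldTheory.Balaban1983to89.Beta.ComposedRoad

/-- **`ComposedRoad.oneLoopDrift_of_composedLegInterfacePow_identity` WITH ITS TABLE BINDERS `hdeg`, `hval` ((W1)₀) DISCHARGED** by
the realised table `(univ, bfCoeff N, bfP, bfQ)`: what remains hypothesised is, verbatim, the window data for the ACTUAL legs `F′, G′`
against the table legs ((W2′)₀: `hF`, `hG`), the tails ((W3a)₀: `hFtail`, `hGtail`), the identification of the composed coefficient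
with the window sum of the `F′G′` table ((W3b)₀: `hident`) and `IdentityForm` ([H-germ′]).  The statement that Bałaban's legs ARE
within these windows of THESE table legs is exactly the located residual (an2 (I2-b) / an5); nothing of it is asserted. [folklore] -/
theorem oneLoopDrift_of_realisedTable {β : HBeta} (S : B12Beta.OneLoopSplit β) {μ ν : Fin 4} (hμν : μ ≠ ν) {N : ℝ} (hN : N ≠ 0)
    {Lc : ℕ} (hL : 2 ≤ Lc) {μC : ℕ → ℕ → ℝ}
    {F' G' : BfIdx → ℕ → Pt → ℝ} {R S' R' Sg : BfIdx → ℝ} {δ U cc : ℝ} {M : ℕ → ℕ}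
    (hR : ∀ i ∈ (Finset.univ : Finset BfIdx), 0 ≤ R i) (hS : ∀ i ∈ (Finset.univ : Finset BfIdx), 0 ≤ Sg i)
    (hR' : ∀ i ∈ (Finset.univ : Finset BfIdx), 0 ≤ R' i) (hS' : ∀ i ∈ (Finset.univ : Finset BfIdx), 0 ≤ S' i) (hδ : 0 < δ)
    (hc : 1 ≤ cc) (hM : ∀ L : ℕ, 2 ≤ L → 1 ≤ M L ∧ (L : ℝ) ≤ cc * M L) (hML : ∀ L : ℕ, 2 ≤ L → M L ≤ L)
    (hF : ∀ m : ℕ, 1 ≤ m → ∀ w ∈ annulus 4 0 (M (Lc ^ m)), ∀ i ∈ (Finset.univ : Finset BfIdx),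
      |F' i (Lc ^ m) w - (bfP hμν i).f (Lc ^ m) 0 w| ≤ R i / ((supNorm w : ℝ) ^ ((bfP hμν i).a - 2) * ((Lc ^ m : ℕ) : ℝ) ^ 2))
    (hG : ∀ m : ℕ, 1 ≤ m → ∀ w ∈ annulus 4 0 (M (Lc ^ m)), ∀ i ∈ (Finset.univ : Finset BfIdx),
      |G' i (Lc ^ m) w - (bfQ hμν i).f (Lc ^ m) 0 w| ≤ Sg i / ((supNorm w : ℝ) ^ ((bfQ hμν i).a - 2) * ((Lc ^ m : ℕ) : ℝ) ^ 2))
    (hFtail : ∀ m : ℕ, 1 ≤ m → ∀ r : ℕ, M (Lc ^ m) ≤ r → ∀ w ∈ annulus 4 r (r + 1), ∀ i ∈ (Finset.univ : Finset BfIdx),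
      |F' i (Lc ^ m) w| ≤ R' i / ((r : ℝ) + 1) ^ (bfP hμν i).a * Real.exp (-(δ / ((Lc ^ m : ℕ) : ℝ)) * ((r : ℝ) + 1)))
    (hGtail : ∀ m : ℕ, 1 ≤ m → ∀ r : ℕ, M (Lc ^ m) ≤ r → ∀ w ∈ annulus 4 r (r + 1), ∀ i ∈ (Finset.univ : Finset BfIdx),
      |G' i (Lc ^ m) w| ≤ S' i / ((r : ℝ) + 1) ^ (bfQ hμν i).a)
    (hident : ∀ m : ℕ, 1 ≤ m → ∃ R₀ : ℕ, M (Lc ^ m) ≤ R₀ ∧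
      |composedCoeff μC m - ∑ w ∈ annulus 4 0 R₀, toReal w μ * toReal w ν *
        ∑ i ∈ (Finset.univ : Finset BfIdx), bfCoeff N i * (F' i (Lc ^ m) w * G' i (Lc ^ m) w)| ≤ U)
    (hid : IdentityForm μC S.β0) :
    OneLoopDrift (B12Normalization.stepBal N Lc)
      (constA (|kappaBal N| * 24 + |kappaBal N| * 110592) (bubbleConst Finset.univ (bfCoeff N) (bfP hμν) (bfQ hμν))
          ((80 * (∑ i ∈ (Finset.univ : Finset BfIdx), |bfCoeff N i| * (R' i * S' i)) * (1 + cc / δ) + U) +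
            80 * ∑ i ∈ (Finset.univ : Finset BfIdx), |bfCoeff N i| *
              ((((bfP hμν i).A + (bfP hμν i).B) * Sg i + R i * ((bfQ hμν i).A + (bfQ hμν i).B) + R i * Sg i)))
          cc (kappaBal N * transverseValue)) S.β0 :=
  oneLoopDrift_of_composedLegInterfacePow_identity S (hdeg_bf hμν) hμν hN (hval_bf hμν N) hL hR hS hR' hS' hδ hc hM hML hF hG
    hFtail hGtail hident hid

end Wall

/-! ## §7 SHIFTED mixed second-difference legs: the leg toolkit is closed under bounded corner shifts -/

section ShiftMixed

/-- a linear form is additive in its vector argument. [folklore] -/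
theorem linForm_add (F : Fin 4 → ℝ) (β γ : E4) : ∑ a, (β + γ) a * F a = ∑ a, β a * F a + ∑ a, γ a * F a := by
  rw [← Finset.sum_add_distrib]
  exact Finset.sum_congr rfl fun a _ => by rw [Pi.add_apply]; ring

/-- **AFFINE POLARISATION**: for a symmetric form, `Q(A+u+v) − Q(A+u) − Q(A+v) + Q(A) = 2B(u,v)` — the base point drops out.
[folklore] -/
theorem quad_polar_affine (H : Fin 4 → Fin 4 → ℝ) (hs : ∀ a b, H a b = H b a) (A u v : E4) :
    ∑ a, ∑ b, (A + u + v) a * (A + u + v) b * H a b - ∑ a, ∑ b, (A + u) a * (A + u) b * H a b -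
        ∑ a, ∑ b, (A + v) a * (A + v) b * H a b + ∑ a, ∑ b, A a * A b * H a b =
      2 * ∑ a, ∑ b, u a * v b * H a b := by
  have h1 := quad_polar H hs (A + u) v
  have h2 := quad_polar H hs A v
  have h3 := quad_polar H hs A u
  have h4 : ∑ a, ∑ b, (A + u) a * v b * H a b = ∑ a, ∑ b, A a * v b * H a b + ∑ a, ∑ b, u a * v b * H a b := by
    rw [← Finset.sum_add_distrib]
    refine Finset.sum_congr rfl fun a _ => ?_
    rw [← Finset.sum_add_distrib]
    exact Finset.sum_congr rfl fun b _ => by rw [Pi.add_apply]; ring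
  linear_combination h1 - h2 + 2 * h4

/-- **THE SHIFTED CONTINUUM MIXED SECOND DIFFERENCE vs THE HESSIAN ENTRY AT THE UNSHIFTED CORNER** (`μ ≠ ν`, `‖α‖∞ ≤ r`,
`2(r+1) ≤ ‖w‖∞`): `|D_{μν}(1/|·|²)(w+α) − ∂_μ∂_ν|w|⁻²| ≤ 14848(r+1)³/‖w‖∞⁵` — four third-order expansions about `w`; constant and
linear terms cancel, the quadratic terms polarise AFFINELY to the entry (the base shift `α` drops out at this order; the discrepancy
`∂_μ∂_ν|w+α|⁻² − ∂_μ∂_ν|w|⁻² = O(r/‖w‖⁵)` is inside the remainder). [folklore] -/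
theorem shifted_mixed_diff_invSq {μ ν : Fin 4} (hμν : μ ≠ ν) {α : Pt} {r : ℕ} (hα : supNorm α ≤ r) {w : Pt}
    (hw : 2 * (r + 1) ≤ supNorm w) :
    |invSq (toReal (w + α + unitVec ν + unitVec μ)) - invSq (toReal (w + α + unitVec ν)) -
        invSq (toReal (w + α + unitVec μ)) + invSq (toReal (w + α)) - hessInvSq μ ν (toReal w)| ≤
      14848 * ((r : ℝ) + 1) ^ 3 / (supNorm w : ℝ) ^ 5 := by
  have hr1 : (2 : ℝ) * (r + 1) ≤ supNorm w := by exact_mod_cast hw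
  have hw0 : w ≠ 0 := by intro h; have h0 := supNorm_eq_zero_iff.mpr h; omega
  have hX0 : toReal w ≠ 0 := fun h => hw0 (toReal_eq_zero_iff.mp h)
  set X := toReal w with hXdef
  have hXn : ‖X‖ = supNorm w := norm_toReal w
  have hαr : (supNorm α : ℝ) ≤ r := by exact_mod_cast hα
  -- the four shifts and their norms
  have hn1 : ‖toReal (α + unitVec ν + unitVec μ)‖ ≤ r + 1 := by
    rw [norm_toReal, add_assoc]
    have := supNorm_add_le_real α (unitVec ν + unitVec μ)
    rw [supNorm_unitVec_add hμν.symm] at this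
    push_cast at this; linarith
  have hn2 : ‖toReal (α + unitVec ν)‖ ≤ r + 1 := by
    rw [norm_toReal]; have := supNorm_add_le_real α (unitVec ν); rw [supNorm_unitVec] at this; push_cast at this; linarith
  have hn3 : ‖toReal (α + unitVec μ)‖ ≤ r + 1 := by
    rw [norm_toReal]; have := supNorm_add_le_real α (unitVec μ); rw [supNorm_unitVec] at this; push_cast at this; linarith
  have hn4 : ‖toReal α‖ ≤ r + 1 := by rw [norm_toReal]; linarith
  have t1 := taylor3_invSq (X := X) (ζ := toReal (α + unitVec ν + unitVec μ)) hX0 (by rw [hXn]; linarith)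
  have t2 := taylor3_invSq (X := X) (ζ := toReal (α + unitVec ν)) hX0 (by rw [hXn]; linarith)
  have t3 := taylor3_invSq (X := X) (ζ := toReal (α + unitVec μ)) hX0 (by rw [hXn]; linarith)
  have t4 := taylor3_invSq (X := X) (ζ := toReal α) hX0 (by rw [hXn]; linarith)
  rw [hXn] at t1 t2 t3 t4
  -- weaken the four remainders to the common `3712(r+1)³/‖w‖⁵`
  have hspos : (0 : ℝ) < supNorm w := by linarith
  have hrem : ∀ {ζ : E4}, ‖ζ‖ ≤ r + 1 → 3712 * ‖ζ‖ ^ 3 / (supNorm w : ℝ) ^ 5 ≤ 3712 * ((r : ℝ) + 1) ^ 3 / (supNorm w : ℝ) ^ 5 := by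
    intro ζ hζ; gcongr
  replace t1 := t1.trans (hrem hn1)
  replace t2 := t2.trans (hrem hn2)
  replace t3 := t3.trans (hrem hn3)
  replace t4 := t4.trans (hrem hn4)
  -- linear and quadratic bookkeeping
  have eA1 : toReal (α + unitVec ν + unitVec μ) = toReal α + toReal (unitVec ν) + toReal (unitVec μ) := by
    rw [toReal_add, toReal_add]
  have eA2 : toReal (α + unitVec ν) = toReal α + toReal (unitVec ν) := toReal_add _ _
  have eA3 : toReal (α + unitVec μ) = toReal α + toReal (unitVec μ) := toReal_add _ _
  have hlin : ∑ a, toReal (α + unitVec ν + unitVec μ) a * d1InvSq a X - ∑ a, toReal (α + unitVec ν) a * d1InvSq a X -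
      ∑ a, toReal (α + unitVec μ) a * d1InvSq a X + ∑ a, toReal α a * d1InvSq a X = 0 := by
    simp only [eA1, eA2, eA3, linForm_add]; ring
  have hquad : ∑ a, ∑ b, toReal (α + unitVec ν + unitVec μ) a * toReal (α + unitVec ν + unitVec μ) b * hessInvSq a b X -
      ∑ a, ∑ b, toReal (α + unitVec ν) a * toReal (α + unitVec ν) b * hessInvSq a b X -
      ∑ a, ∑ b, toReal (α + unitVec μ) a * toReal (α + unitVec μ) b * hessInvSq a b X +
      ∑ a, ∑ b, toReal α a * toReal α b * hessInvSq a b X = 2 * hessInvSq μ ν X := by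
    rw [eA1, eA2, eA3, quad_polar_affine _ (fun a b => hessInvSq_symm a b X), sum_sum_toReal_unitVec_mul, hessInvSq_symm]
  have e1 : toReal (w + α + unitVec ν + unitVec μ) = X + toReal (α + unitVec ν + unitVec μ) := by
    rw [add_assoc, add_assoc, toReal_add, ← add_assoc]
  have e2 : toReal (w + α + unitVec ν) = X + toReal (α + unitVec ν) := by rw [add_assoc, toReal_add]
  have e3 : toReal (w + α + unitVec μ) = X + toReal (α + unitVec μ) := by rw [add_assoc, toReal_add]
  have e4 : toReal (w + α) = X + toReal α := toReal_add _ _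
  rw [e1, e2, e3, e4]
  set R1 := invSq (X + toReal (α + unitVec ν + unitVec μ)) - invSq X -
      ∑ a, toReal (α + unitVec ν + unitVec μ) a * d1InvSq a X -
      1 / 2 * ∑ a, ∑ b, toReal (α + unitVec ν + unitVec μ) a * toReal (α + unitVec ν + unitVec μ) b * hessInvSq a b X
    with hR1
  set R2 := invSq (X + toReal (α + unitVec ν)) - invSq X - ∑ a, toReal (α + unitVec ν) a * d1InvSq a X -
      1 / 2 * ∑ a, ∑ b, toReal (α + unitVec ν) a * toReal (α + unitVec ν) b * hessInvSq a b X with hR2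
  set R3 := invSq (X + toReal (α + unitVec μ)) - invSq X - ∑ a, toReal (α + unitVec μ) a * d1InvSq a X -
      1 / 2 * ∑ a, ∑ b, toReal (α + unitVec μ) a * toReal (α + unitVec μ) b * hessInvSq a b X with hR3
  set R4 := invSq (X + toReal α) - invSq X - ∑ a, toReal α a * d1InvSq a X -
      1 / 2 * ∑ a, ∑ b, toReal α a * toReal α b * hessInvSq a b X with hR4
  have e : invSq (X + toReal (α + unitVec ν + unitVec μ)) - invSq (X + toReal (α + unitVec ν)) -
      invSq (X + toReal (α + unitVec μ)) + invSq (X + toReal α) - hessInvSq μ ν X = R1 - R2 - R3 + R4 := by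
    rw [hR1, hR2, hR3, hR4]
    linear_combination hlin + ((1 : ℝ) / 2) * hquad
  rw [e]
  calc |R1 - R2 - R3 + R4| ≤ |R1 - R2 - R3| + |R4| := abs_add_le _ _
    _ ≤ (|R1 - R2| + |R3|) + |R4| := by gcongr; exact abs_sub _ _
    _ ≤ ((|R1| + |R2|) + |R3|) + |R4| := by gcongr; exact abs_sub _ _
    _ ≤ ((3712 * ((r : ℝ) + 1) ^ 3 / (supNorm w : ℝ) ^ 5 + 3712 * ((r : ℝ) + 1) ^ 3 / (supNorm w : ℝ) ^ 5) +
          3712 * ((r : ℝ) + 1) ^ 3 / (supNorm w : ℝ) ^ 5) + 3712 * ((r : ℝ) + 1) ^ 3 / (supNorm w : ℝ) ^ 5 := by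
        gcongr
    _ = 14848 * ((r : ℝ) + 1) ^ 3 / (supNorm w : ℝ) ^ 5 := by ring

/-- The shifted mixed leg's error constant. [folklore] -/
def BshiftMix (T : TwoPower) (B₃ : ℝ) (r : ℕ) : ℝ :=
  64 * B₃ + 14848 * c4 * ((r : ℝ) + 1) ^ 3 + 32 * (4 * T.U + 10 * c4) * ((r : ℝ) + 1) ^ 5

/-- it is non-negative. [folklore] -/
theorem BshiftMix_nonneg (T : TwoPower) {B₃ : ℝ} (hB : 0 ≤ B₃) (r : ℕ) : 0 ≤ BshiftMix T B₃ r := by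
  have := T.nonneg_U; have := c4_pos.le; unfold BshiftMix; positivity

/-- **THE SHIFTED MIXED SECOND-DIFFERENCE LEG from (F1)+(F2)+(F3)** (`μ ≠ ν`, lattice shift `‖α‖∞ ≤ r`):
`f(w) = D_{μν}g(w + α)` (mixed forward difference at the SHIFTED corner `w + α`), continuum part `c₄∂_μ∂_ν|x|⁻²` at the UNSHIFTED
label, degree `4`, `A = 10c₄`, `B = 64B₃ + 14848c₄(r+1)³ + 32(4U+10c₄)(r+1)⁵`.  With `TwoPower.shiftLeg` (degree 2) and the shifted
forward-difference legs (`Leg.lincomb` of `TwoPower.diffLeg`s, degree 3, §2) this CLOSES the leg toolkit under bounded corner shifts: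
every product of boundedly-shifted `g, ∇g, ∇∇g` of total degree 6 is a `Leg` table entry, whatever vertex-labelling convention the
actual Hessian kernel uses. [folklore] -/
def shiftMixedLeg (T : TwoPower) {μ ν : Fin 4} (hμν : μ ≠ ν) {α : Pt} {r : ℕ} (hα : supNorm α ≤ r) {B₃ : ℝ} (hB : 0 ≤ B₃)
    (h : SharpDiff T B₃) : Leg where
  f L k w := T.g L k (w + α + unitVec ν + unitVec μ) - T.g L k (w + α + unitVec ν) - T.g L k (w + α + unitVec μ) +
    T.g L k (w + α)
  ℓ x := c4 * hessInvSq μ ν x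
  a := 4
  A := 10 * c4
  B := BshiftMix T B₃ r
  nonneg_A := mul_nonneg (by norm_num) c4_pos.le
  nonneg_B := BshiftMix_nonneg T hB r
  lead w hw := by
    rw [abs_mul, abs_of_pos c4_pos]
    calc c4 * |hessInvSq μ ν (toReal w)| ≤ c4 * (10 / (supNorm w : ℝ) ^ 4) :=
        mul_le_mul_of_nonneg_left (abs_hessInvSq_le μ ν hw) c4_pos.le
      _ = 10 * c4 / (supNorm w : ℝ) ^ 4 := by ring
  err L k w hw := by
    have hs : (1 : ℝ) ≤ supNorm w := Leg.one_le_supNorm hw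
    have hspos : (0 : ℝ) < supNorm w := by linarith
    have hU := T.nonneg_U
    have hc := c4_pos
    have hαr : (supNorm α : ℝ) ≤ r := by exact_mod_cast hα
    have hr0 : (0 : ℝ) ≤ r := Nat.cast_nonneg r
    rcases le_or_gt (2 * (r + 1)) (supNorm w) with hfar | hnear
    · -- far field
      have hfar' : (2 : ℝ) * (r + 1) ≤ supNorm w := by exact_mod_cast hfar
      -- the two (F3) points
      have hv1 : (supNorm w : ℝ) - (r + 1) ≤ supNorm (w + α + unitVec ν) := by
        have h1 := supNorm_sub_le_supNorm_add w (α + unitVec ν)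
        have h2 := supNorm_add_le_real α (unitVec ν)
        rw [supNorm_unitVec] at h2; push_cast at h2
        rw [add_assoc]; linarith
      have hv2 : (supNorm w : ℝ) - r ≤ supNorm (w + α) := by
        have h1 := supNorm_sub_le_supNorm_add w α; linarith
      have hv1h : (supNorm w : ℝ) / 2 ≤ supNorm (w + α + unitVec ν) := by linarith
      have hv2h : (supNorm w : ℝ) / 2 ≤ supNorm (w + α) := by linarith
      have hv10 : w + α + unitVec ν ≠ 0 := by
        intro h0; have h00 := supNorm_eq_zero_iff.mpr h0; rw [h00] at hv1h; push_cast at hv1h; linarith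
      have hv20 : w + α ≠ 0 := by
        intro h0; have h00 := supNorm_eq_zero_iff.mpr h0; rw [h00] at hv2h; push_cast at hv2h; linarith
      have hD1 := h L k (w + α + unitVec ν) hv10 μ
      have hD2 := h L k (w + α) hv20 μ
      have hpow : ∀ {v : Pt}, (supNorm w : ℝ) / 2 ≤ supNorm v → B₃ / (supNorm v : ℝ) ^ 5 ≤ 32 * B₃ / (supNorm w : ℝ) ^ 5 := by
        intro v hv
        have hvpos : (0 : ℝ) < supNorm v := by linarith
        rw [div_le_div_iff₀ (by positivity) (by positivity)]
        have := pow_le_pow_left₀ (by positivity) hv 5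
        nlinarith
      have hD1' := hD1.trans (hpow hv1h)
      have hD2' := hD2.trans (hpow hv2h)
      have hcont := shifted_mixed_diff_invSq hμν hα hfar
      have e : T.g L k (w + α + unitVec ν + unitVec μ) - T.g L k (w + α + unitVec ν) - T.g L k (w + α + unitVec μ) +
          T.g L k (w + α) - c4 * hessInvSq μ ν (toReal w) =
          (T.g L k (w + α + unitVec ν + unitVec μ) - T.g L k (w + α + unitVec ν) -
              c4 * (invSq (toReal (w + α + unitVec ν + unitVec μ)) - invSq (toReal (w + α + unitVec ν)))) -
            (T.g L k (w + α + unitVec μ) - T.g L k (w + α) -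
              c4 * (invSq (toReal (w + α + unitVec μ)) - invSq (toReal (w + α)))) +
            c4 * (invSq (toReal (w + α + unitVec ν + unitVec μ)) - invSq (toReal (w + α + unitVec ν)) -
              invSq (toReal (w + α + unitVec μ)) + invSq (toReal (w + α)) - hessInvSq μ ν (toReal w)) := by ring
      rw [e]
      calc |(T.g L k (w + α + unitVec ν + unitVec μ) - T.g L k (w + α + unitVec ν) -
              c4 * (invSq (toReal (w + α + unitVec ν + unitVec μ)) - invSq (toReal (w + α + unitVec ν)))) -
            (T.g L k (w + α + unitVec μ) - T.g L k (w + α) -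
              c4 * (invSq (toReal (w + α + unitVec μ)) - invSq (toReal (w + α)))) +
            c4 * (invSq (toReal (w + α + unitVec ν + unitVec μ)) - invSq (toReal (w + α + unitVec ν)) -
              invSq (toReal (w + α + unitVec μ)) + invSq (toReal (w + α)) - hessInvSq μ ν (toReal w))|
          ≤ |(T.g L k (w + α + unitVec ν + unitVec μ) - T.g L k (w + α + unitVec ν) -
              c4 * (invSq (toReal (w + α + unitVec ν + unitVec μ)) - invSq (toReal (w + α + unitVec ν)))) -
            (T.g L k (w + α + unitVec μ) - T.g L k (w + α) -
              c4 * (invSq (toReal (w + α + unitVec μ)) - invSq (toReal (w + α))))| +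
            |c4 * (invSq (toReal (w + α + unitVec ν + unitVec μ)) - invSq (toReal (w + α + unitVec ν)) -
              invSq (toReal (w + α + unitVec μ)) + invSq (toReal (w + α)) - hessInvSq μ ν (toReal w))| :=
            abs_add_le _ _
        _ ≤ (|T.g L k (w + α + unitVec ν + unitVec μ) - T.g L k (w + α + unitVec ν) -
              c4 * (invSq (toReal (w + α + unitVec ν + unitVec μ)) - invSq (toReal (w + α + unitVec ν)))| +
            |T.g L k (w + α + unitVec μ) - T.g L k (w + α) -
              c4 * (invSq (toReal (w + α + unitVec μ)) - invSq (toReal (w + α)))|) +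
            c4 * |invSq (toReal (w + α + unitVec ν + unitVec μ)) - invSq (toReal (w + α + unitVec ν)) -
              invSq (toReal (w + α + unitVec μ)) + invSq (toReal (w + α)) - hessInvSq μ ν (toReal w)| := by
            rw [abs_mul, abs_of_pos c4_pos]
            gcongr
            exact abs_sub _ _
        _ ≤ (32 * B₃ / (supNorm w : ℝ) ^ 5 + 32 * B₃ / (supNorm w : ℝ) ^ 5) +
            c4 * (14848 * ((r : ℝ) + 1) ^ 3 / (supNorm w : ℝ) ^ 5) := by gcongr
        _ = (64 * B₃ + 14848 * c4 * ((r : ℝ) + 1) ^ 3) / (supNorm w : ℝ) ^ 5 := by ring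
        _ ≤ BshiftMix T B₃ r / (supNorm w : ℝ) ^ (4 + 1) := by
            rw [show (4 + 1 : ℕ) = 5 by norm_num]
            gcongr
            unfold BshiftMix; nlinarith [pow_nonneg (show (0:ℝ) ≤ r + 1 by linarith) 5]
    · -- near field: ‖w‖∞ ≤ 2r + 1
      have hnear' : (supNorm w : ℝ) ≤ 2 * (r + 1) := by exact_mod_cast hnear.le
      have hb1 := T.bdd L k (w + α + unitVec ν + unitVec μ)
      have hb2 := T.bdd L k (w + α + unitVec ν)
      have hb3 := T.bdd L k (w + α + unitVec μ)
      have hb4 := T.bdd L k (w + α)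
      have hl : |c4 * hessInvSq μ ν (toReal w)| ≤ 10 * c4 := by
        rw [abs_mul, abs_of_pos c4_pos]
        calc c4 * |hessInvSq μ ν (toReal w)| ≤ c4 * (10 / (supNorm w : ℝ) ^ 4) :=
            mul_le_mul_of_nonneg_left (abs_hessInvSq_le μ ν hw) c4_pos.le
          _ ≤ c4 * (10 / 1) := by gcongr; exact one_le_pow₀ hs
          _ = 10 * c4 := by ring
      have hsum : |T.g L k (w + α + unitVec ν + unitVec μ) - T.g L k (w + α + unitVec ν) - T.g L k (w + α + unitVec μ) +
          T.g L k (w + α) - c4 * hessInvSq μ ν (toReal w)| ≤ 4 * T.U + 10 * c4 := by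
        have a1 := abs_sub (T.g L k (w + α + unitVec ν + unitVec μ) - T.g L k (w + α + unitVec ν) -
          T.g L k (w + α + unitVec μ) + T.g L k (w + α)) (c4 * hessInvSq μ ν (toReal w))
        have a2 := abs_add_le (T.g L k (w + α + unitVec ν + unitVec μ) - T.g L k (w + α + unitVec ν) -
          T.g L k (w + α + unitVec μ)) (T.g L k (w + α))
        have a3 := abs_sub (T.g L k (w + α + unitVec ν + unitVec μ) - T.g L k (w + α + unitVec ν))
          (T.g L k (w + α + unitVec μ))
        have a4 := abs_sub (T.g L k (w + α + unitVec ν + unitVec μ)) (T.g L k (w + α + unitVec ν))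
        linarith
      have hpow : (supNorm w : ℝ) ^ 5 ≤ (2 * ((r : ℝ) + 1)) ^ 5 := pow_le_pow_left₀ hspos.le hnear' 5
      have hK : 0 ≤ 4 * T.U + 10 * c4 := by positivity
      calc |T.g L k (w + α + unitVec ν + unitVec μ) - T.g L k (w + α + unitVec ν) - T.g L k (w + α + unitVec μ) +
            T.g L k (w + α) - c4 * hessInvSq μ ν (toReal w)| ≤ 4 * T.U + 10 * c4 := hsum
        _ = (32 * (4 * T.U + 10 * c4) * ((r : ℝ) + 1) ^ 5) / (2 * ((r : ℝ) + 1)) ^ 5 := by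
            field_simp
            ring
        _ ≤ (32 * (4 * T.U + 10 * c4) * ((r : ℝ) + 1) ^ 5) / (supNorm w : ℝ) ^ 5 := by
            apply div_le_div_of_nonneg_left (by positivity) (by positivity) hpow
        _ ≤ BshiftMix T B₃ r / (supNorm w : ℝ) ^ (4 + 1) := by
            rw [show (4 + 1 : ℕ) = 5 by norm_num]
            gcongr
            unfold BshiftMix; nlinarith [pow_nonneg (show (0:ℝ) ≤ r + 1 by linarith) 3]

/-- continuum part of the shifted mixed leg. [folklore] -/
@[simp] theorem shiftMixedLeg_ℓ (T : TwoPower) {μ ν : Fin 4} (hμν : μ ≠ ν) {α : Pt} {r : ℕ} (hα : supNorm α ≤ r) {B₃ : ℝ}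
    (hB : 0 ≤ B₃) (h : SharpDiff T B₃) (x : E4) : (shiftMixedLeg T hμν hα hB h).ℓ x = c4 * hessInvSq μ ν x := rfl

/-- degree of the shifted mixed leg. [folklore] -/
@[simp] theorem shiftMixedLeg_a (T : TwoPower) {μ ν : Fin 4} (hμν : μ ≠ ν) {α : Pt} {r : ℕ} (hα : supNorm α ≤ r) {B₃ : ℝ}
    (hB : 0 ≤ B₃) (h : SharpDiff T B₃) : (shiftMixedLeg T hμν hα hB h).a = 4 := rfl

/-- values of the shifted mixed leg. [folklore] -/
theorem shiftMixedLeg_f (T : TwoPower) {μ ν : Fin 4} (hμν : μ ≠ ν) {α : Pt} {r : ℕ} (hα : supNorm α ≤ r) {B₃ : ℝ}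
    (hB : 0 ≤ B₃) (h : SharpDiff T B₃) (L k : ℕ) (w : Pt) :
    (shiftMixedLeg T hμν hα hB h).f L k w = mixedDiffFun (T.g L k) (unitVec μ) (unitVec ν) (w + α) := rfl


end ShiftMixed

/-! ## §8 TRANSLATED TABLES: the realised table at ANY boundedly shifted corner `v + α` is a `Leg` table with the SAME `hval` -/

section Translated

variable {α : Pt} {r : ℕ}

/-- `‖β + e_ν‖∞ ≤ r + 1` for `‖β‖∞ ≤ r`. [folklore] -/
theorem supNorm_add_unitVec_le (β : Pt) (ν : Fin 4) (hβ : supNorm β ≤ r) : supNorm (β + unitVec ν) ≤ r + 1 := by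
  have h := supNorm_add_le_real β (unitVec ν)
  rw [supNorm_unitVec] at h
  have hβ' : (supNorm β : ℝ) ≤ r := by exact_mod_cast hβ
  have h' : (supNorm (β + unitVec ν) : ℝ) ≤ r + 1 := by push_cast at h; linarith
  exact_mod_cast h'

/-- `‖β + (e_μ + e_ν)‖∞ ≤ r + 1` for `‖β‖∞ ≤ r`, `μ ≠ ν`. [folklore] -/
theorem supNorm_add_unitVec_add_le (β : Pt) {μ ν : Fin 4} (hμν : μ ≠ ν) (hβ : supNorm β ≤ r) :
    supNorm (β + (unitVec μ + unitVec ν)) ≤ r + 1 := by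
  have h := supNorm_add_le_real β (unitVec μ + unitVec ν)
  rw [supNorm_unitVec_add hμν] at h
  have hβ' : (supNorm β : ℝ) ≤ r := by exact_mod_cast hβ
  have h' : (supNorm (β + (unitVec μ + unitVec ν)) : ℝ) ≤ r + 1 := by push_cast at h; linarith
  exact_mod_cast h'

/-- **THE TRANSLATED FORWARD DIFFERENCE** `w ↦ g(w+β+e_ν) − g(w+β)`: a `Leg.lincomb` of two tree `diffLeg`s, degree 3, continuum part
`c₄∂_ν|x|⁻²`. [folklore] -/
def fwdSh (ν : Fin 4) {β : Pt} (hβ : supNorm β ≤ r) (hr : 1 ≤ r) : Leg :=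
  Leg.lincomb 1 (-1) (free.diffLeg (supNorm_add_unitVec_le β ν hβ) (by omega)) (free.diffLeg hβ hr) rfl

/-- unfolding: the lattice function is the translated forward difference. [folklore] -/
@[simp] theorem fwdSh_f (ν : Fin 4) {β : Pt} (hβ : supNorm β ≤ r) (hr : 1 ≤ r) (L k : ℕ) (w : Pt) :
    (fwdSh ν hβ hr).f L k w = gFree (w + (β + unitVec ν)) - gFree (w + β) := by
  simp only [fwdSh, Leg.lincomb, TwoPower.diffLeg_f, free_g_eq]
  ring

/-- its continuum part is `c₄∂_ν|x|⁻²` (the `β`-components cancel). [folklore] -/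
@[simp] theorem fwdSh_ℓ (ν : Fin 4) {β : Pt} (hβ : supNorm β ≤ r) (hr : 1 ≤ r) (x : E4) : (fwdSh ν hβ hr).ℓ x = c4 * d1InvSq ν x := by
  simp only [fwdSh, Leg.lincomb, TwoPower.diffLeg_ℓ, DyadicShell.toReal_add, Pi.add_apply, add_mul, Finset.sum_add_distrib,
    sum_toReal_unitVec_mul]
  ring

/-- its degree. [folklore] -/
@[simp] theorem fwdSh_a (ν : Fin 4) {β : Pt} (hβ : supNorm β ≤ r) (hr : 1 ≤ r) : (fwdSh ν hβ hr).a = 3 := rfl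

/-- **THE TRANSLATED MIXED DIFFERENCE of the free family** (§7 with `free_sharp`). [folklore] -/
def mixSh {μ ν : Fin 4} (hμν : μ ≠ ν) {β : Pt} (hβ : supNorm β ≤ r) : Leg :=
  shiftMixedLeg free hμν hβ (Classical.choose_spec free_sharp).1 (Classical.choose_spec free_sharp).2

/-- unfolding: the lattice function is the mixed difference at the translated corner. [folklore] -/
@[simp] theorem mixSh_f {μ ν : Fin 4} (hμν : μ ≠ ν) {β : Pt} (hβ : supNorm β ≤ r) (L k : ℕ) (w : Pt) :
    (mixSh hμν hβ).f L k w = mixedDiffFun gFree (unitVec μ) (unitVec ν) (w + β) := rfl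

/-- its continuum part. [folklore] -/
@[simp] theorem mixSh_ℓ {μ ν : Fin 4} (hμν : μ ≠ ν) {β : Pt} (hβ : supNorm β ≤ r) (x : E4) :
    (mixSh hμν hβ).ℓ x = c4 * hessInvSq μ ν x := rfl

/-- its degree. [folklore] -/
@[simp] theorem mixSh_a {μ ν : Fin 4} (hμν : μ ≠ ν) {β : Pt} (hβ : supNorm β ≤ r) : (mixSh hμν hβ).a = 4 := rfl

/-- translated square sector, first legs. [folklore] -/
def sqPsh {μ ν : Fin 4} (hμν : μ ≠ ν) (hα : supNorm α ≤ r) (hr : 1 ≤ r) : Fin 4 → Leg :=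
  ![mixSh hμν hα, mixSh hμν hα, fwdSh μ hα hr, fwdSh μ hα hr]

/-- translated square sector, second legs. [folklore] -/
def sqQsh {μ ν : Fin 4} (hμν : μ ≠ ν) (hα : supNorm α ≤ r) (hr : 1 ≤ r) : Fin 4 → Leg :=
  ![free.shiftLeg (supNorm_add_unitVec_add_le α hμν hα) (by omega), free.shiftLeg (supNorm_add_unitVec_le α ν hα) (by omega),
    fwdSh ν (supNorm_add_unitVec_le α μ hα) (by omega), fwdSh ν hα hr]

/-- translated ghost-shape sector, first legs. [folklore] -/
def ghostPsh (μ : Fin 4) (hα : supNorm α ≤ r) (hr : 1 ≤ r) : Bool → Leg :=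
  fun b => if b then free.shiftLeg hα hr else fwdSh μ hα hr

/-- translated ghost-shape sector, second legs. [folklore] -/
def ghostQsh {μ ν : Fin 4} (hμν : μ ≠ ν) (hα : supNorm α ≤ r) (hr : 1 ≤ r) : Bool → Leg :=
  fun b => if b then mixSh hμν hα else fwdSh ν hα hr

/-- degree bookkeeping of the translated square sector. [folklore] -/
theorem hdeg_sqSh {μ ν : Fin 4} (hμν : μ ≠ ν) (hα : supNorm α ≤ r) (hr : 1 ≤ r) :
    ∀ i ∈ (Finset.univ : Finset (Fin 4)), (sqPsh hμν hα hr i).a + (sqQsh hμν hα hr i).a = 6 := by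
  intro i _
  fin_cases i <;> simp [sqPsh, sqQsh]

/-- degree bookkeeping of the translated ghost-shape sector. [folklore] -/
theorem hdeg_ghostSh {μ ν : Fin 4} (hμν : μ ≠ ν) (hα : supNorm α ≤ r) (hr : 1 ≤ r) :
    ∀ i ∈ (Finset.univ : Finset Bool), (ghostPsh μ hα hr i).a + (ghostQsh hμν hα hr i).a = 6 := by
  intro i _
  cases i <;> simp [ghostPsh, ghostQsh]

/-- the translated square sector is `c·D_{μν}(g²)` at the SHIFTED corner `v + α`. [folklore] -/
theorem lattBubble_sqSh {μ ν : Fin 4} (hμν : μ ≠ ν) (hα : supNorm α ≤ r) (hr : 1 ≤ r) (c : ℝ) (L k : ℕ) (v : Pt) :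
    lattBubble Finset.univ (sqCoeff c) (sqPsh hμν hα hr) (sqQsh hμν hα hr) L k v =
      c * mixedDiffFun (fun u => gFree u ^ 2) (unitVec μ) (unitVec ν) (v + α) := by
  rw [mixedDiffFun_sq', lattBubble, Fin.sum_univ_four]
  simp only [sqCoeff, sqPsh, sqQsh, Matrix.cons_val_zero, Matrix.cons_val_one, Matrix.cons_val, mixSh_f, TwoPower.shiftLeg_f,
    fwdSh_f, free_g_eq, mixedDiffFun, fwdDiffFun, add_assoc, add_comm (unitVec ν) (unitVec μ)]
  ring

/-- its continuum bubble is that of the untranslated sector. [folklore] -/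
theorem contBubble_sqSh {μ ν : Fin 4} (hμν : μ ≠ ν) (hα : supNorm α ≤ r) (hr : 1 ≤ r) (c : ℝ) (x : E4) :
    contBubble Finset.univ (sqCoeff c) (sqPsh hμν hα hr) (sqQsh hμν hα hr) x = c * c4 ^ 2 * hessInvQuartic μ ν x := by
  rw [contBubble, Fin.sum_univ_four, hessInvQuartic_eq_legs]
  simp only [sqCoeff, sqPsh, sqQsh, Matrix.cons_val_zero, Matrix.cons_val_one, Matrix.cons_val, mixSh_ℓ, TwoPower.shiftLeg_ℓ,
    fwdSh_ℓ]
  ring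

/-- the translated ghost-shape sector is `2τ·(g·D_{μν}g − F_μg·F_νg)` at the shifted corner. [folklore] -/
theorem lattBubble_ghostSh {μ ν : Fin 4} (hμν : μ ≠ ν) (hα : supNorm α ≤ r) (hr : 1 ≤ r) (τ : ℝ) (L k : ℕ) (v : Pt) :
    lattBubble Finset.univ (ghostCoeff τ) (ghostPsh μ hα hr) (ghostQsh hμν hα hr) L k v =
      2 * τ * cellForm gFree (unitVec μ) (unitVec ν) (v + α) := by
  rw [lattBubble, Fintype.sum_bool]
  simp only [ghostCoeff, ghostPsh, ghostQsh, if_true, Bool.false_eq_true, if_false, TwoPower.shiftLeg_f, fwdSh_f, mixSh_f,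
    free_g_eq, cellForm, mixedDiffFun, fwdDiffFun, add_assoc]
  ring

/-- its continuum bubble is that of the untranslated sector. [folklore] -/
theorem contBubble_ghostSh {μ ν : Fin 4} (hμν : μ ≠ ν) (hα : supNorm α ≤ r) (hr : 1 ≤ r) (τ : ℝ) (x : E4) :
    contBubble Finset.univ (ghostCoeff τ) (ghostPsh μ hα hr) (ghostQsh hμν hα hr) x = τ * c4 ^ 2 * scalarBubble μ ν x := by
  rw [contBubble, Fintype.sum_bool]
  simp only [ghostCoeff, ghostPsh, ghostQsh, if_true, Bool.false_eq_true, if_false, TwoPower.shiftLeg_ℓ, fwdSh_ℓ, mixSh_ℓ,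
    scalarBubble, hessInvQuartic_eq_legs]
  ring

/-- the TRANSLATED realised table: first legs. [folklore] -/
def bfPsh {μ ν : Fin 4} (hμν : μ ≠ ν) (hα : supNorm α ≤ r) (hr : 1 ≤ r) : BfIdx → Leg := Sum.elim (sqPsh hμν hα hr) (ghostPsh μ hα hr)

/-- second legs. [folklore] -/
def bfQsh {μ ν : Fin 4} (hμν : μ ≠ ν) (hα : supNorm α ≤ r) (hr : 1 ≤ r) : BfIdx → Leg := Sum.elim (sqQsh hμν hα hr) (ghostQsh hμν hα hr)

/-- degree bookkeeping of the translated realised table. [folklore] -/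
theorem hdeg_bfSh {μ ν : Fin 4} (hμν : μ ≠ ν) (hα : supNorm α ≤ r) (hr : 1 ≤ r) :
    ∀ i ∈ (Finset.univ : Finset BfIdx), (bfPsh hμν hα hr i).a + (bfQsh hμν hα hr i).a = 6 := by
  rintro (i | b) _
  · exact hdeg_sqSh hμν hα hr i (Finset.mem_univ _)
  · exact hdeg_ghostSh hμν hα hr b (Finset.mem_univ _)

/-- **THE TRANSLATED TABLE'S LATTICE KERNEL IS THE REALISED KERNEL AT THE SHIFTED CORNER**. [folklore] -/
theorem lattBubble_bfSh {μ ν : Fin 4} (hμν : μ ≠ ν) (hα : supNorm α ≤ r) (hr : 1 ≤ r) (N : ℝ) (L k : ℕ) (v : Pt) :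
    lattBubble Finset.univ (bfCoeff N) (bfPsh hμν hα hr) (bfQsh hμν hα hr) L k v =
      lattBubble Finset.univ (bfCoeff N) (bfP hμν) (bfQ hμν) L k (v + α) := by
  rw [lattBubble_bf]
  simp only [lattBubble, Fintype.sum_sum_type, bfCoeff, bfPsh, bfQsh, Sum.elim_inl, Sum.elim_inr]
  rw [← lattBubble, ← lattBubble, lattBubble_sqSh, lattBubble_ghostSh]
  ring

/-- **… AND ITS CONTINUUM BUBBLE IS UNCHANGED**. [folklore] -/
theorem contBubble_bfSh {μ ν : Fin 4} (hμν : μ ≠ ν) (hα : supNorm α ≤ r) (hr : 1 ≤ r) (N : ℝ) (x : E4) :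
    contBubble Finset.univ (bfCoeff N) (bfPsh hμν hα hr) (bfQsh hμν hα hr) x =
      contBubble Finset.univ (bfCoeff N) (bfP hμν) (bfQ hμν) x := by
  rw [contBubble_bf]
  simp only [contBubble, Fintype.sum_sum_type, bfCoeff, bfPsh, bfQsh, Sum.elim_inl, Sum.elim_inr]
  rw [← contBubble, ← contBubble, contBubble_sqSh, contBubble_ghostSh]
  ring

/-- **LABEL-CONVENTION ROBUSTNESS OF (W1)₀**: for every bounded relabelling `w ↦ w + α` of the corner, the translated realised table
meets the binders `hdeg`/`hval` of `ComposedRoad.oneLoopDrift_of_composedLegInterfacePow` with the SAME constant `kappaBal N`.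
[folklore] -/
theorem hval_bfSh {μ ν : Fin 4} (hμν : μ ≠ ν) (hα : supNorm α ≤ r) (hr : 1 ≤ r) (N : ℝ) :
    ∀ x : E4, x ≠ 0 →
      x μ * x ν * contBubble Finset.univ (bfCoeff N) (bfPsh hμν hα hr) (bfQsh hμν hα hr) x = leadingIntegrand (kappaBal N) μ ν x := by
  intro x hx
  rw [contBubble_bfSh]
  exact hval_bf hμν N x hx

end Translated

/-! ## §9 (v1.2) The END statement with the realised table: `EndpointExistence` with (W1)₀ discharged -/

section EndToEnd

open Literature.Probability.LatticeModels (annulus)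
open FlowStep DagBinding
open Literature.MathematicalPhysics.QuantumFieldTheory.Balaban1983to89.Beta.LargeLWindow.WindowDecomposition (constA)
open Literature.MathematicalPhysics.QuantumFieldTheory.Balaban1983to89.Beta.Drift (OneLoopDrift)
open Literature.MathematicalPhysics.QuantumFieldTheory.Balaban1983to89.Beta.MarginalTelescoping (composedCoeff IdentityForm)
open Literature.MathematicalPhysics.QuantumFieldTheory.Balaban1983to89.Beta.RemainderChain (RemainderConst)
open Literature.MathematicalPhysics.QuantumFieldTheory.Balaban1983to89.Beta.DriftRemainder
  (endpointExistence_of_drift_remainderConst)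
open Literature.MathematicalPhysics.QuantumFieldTheory.Balaban1983to89.Beta.ComposedRoad

/-- **`ComposedRoad.endpointExistence_of_composedLegInterfacePow_identity_remainderConst` WITH (W1)₀ DISCHARGED** — the (R11)/(R10-1′)
wall END TO END for the realised table `(univ, bfCoeff N, bfP, bfQ)`: window data (W2′)₀/(W3a)₀ for the ACTUAL legs against THESE table
legs, identification (W3b)₀, `IdentityForm` ([H-germ′]), the constant-form remainder `RemainderConst S γ₀ r` with `r ≤ stepBal N Lc`
(row an4), continuity (C) and the printed-type upper bound ⟹ `EndpointExistence Cn`.  Every remaining hypothesis is verbatim a binder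
of the tree theorem; nothing of the series is asserted (HONEST FRAMING: NOT the continuum limit, NOT Clay; Gloss 3″). [folklore] -/
theorem endpointExistence_of_realisedTable {β : HBeta} {Cn : B12.Construction} (hgen : ForwardGenerated Cn β)
    (S : B12Beta.OneLoopSplit β) {μ ν : Fin 4} (hμν : μ ≠ ν) {N : ℝ} (hN : N ≠ 0)
    {Lc : ℕ} (hL : 2 ≤ Lc) {μC : ℕ → ℕ → ℝ}
    {F' G' : BfIdx → ℕ → Pt → ℝ} {R S' R' Sg : BfIdx → ℝ} {δ U cc : ℝ} {M : ℕ → ℕ}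
    (hR : ∀ i ∈ (Finset.univ : Finset BfIdx), 0 ≤ R i) (hS : ∀ i ∈ (Finset.univ : Finset BfIdx), 0 ≤ Sg i)
    (hR' : ∀ i ∈ (Finset.univ : Finset BfIdx), 0 ≤ R' i) (hS' : ∀ i ∈ (Finset.univ : Finset BfIdx), 0 ≤ S' i) (hδ : 0 < δ)
    (hc : 1 ≤ cc) (hM : ∀ L : ℕ, 2 ≤ L → 1 ≤ M L ∧ (L : ℝ) ≤ cc * M L) (hML : ∀ L : ℕ, 2 ≤ L → M L ≤ L)
    (hF : ∀ m : ℕ, 1 ≤ m → ∀ w ∈ annulus 4 0 (M (Lc ^ m)), ∀ i ∈ (Finset.univ : Finset BfIdx),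
      |F' i (Lc ^ m) w - (bfP hμν i).f (Lc ^ m) 0 w| ≤ R i / ((supNorm w : ℝ) ^ ((bfP hμν i).a - 2) * ((Lc ^ m : ℕ) : ℝ) ^ 2))
    (hG : ∀ m : ℕ, 1 ≤ m → ∀ w ∈ annulus 4 0 (M (Lc ^ m)), ∀ i ∈ (Finset.univ : Finset BfIdx),
      |G' i (Lc ^ m) w - (bfQ hμν i).f (Lc ^ m) 0 w| ≤ Sg i / ((supNorm w : ℝ) ^ ((bfQ hμν i).a - 2) * ((Lc ^ m : ℕ) : ℝ) ^ 2))
    (hFtail : ∀ m : ℕ, 1 ≤ m → ∀ r : ℕ, M (Lc ^ m) ≤ r → ∀ w ∈ annulus 4 r (r + 1), ∀ i ∈ (Finset.univ : Finset BfIdx),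
      |F' i (Lc ^ m) w| ≤ R' i / ((r : ℝ) + 1) ^ (bfP hμν i).a * Real.exp (-(δ / ((Lc ^ m : ℕ) : ℝ)) * ((r : ℝ) + 1)))
    (hGtail : ∀ m : ℕ, 1 ≤ m → ∀ r : ℕ, M (Lc ^ m) ≤ r → ∀ w ∈ annulus 4 r (r + 1), ∀ i ∈ (Finset.univ : Finset BfIdx),
      |G' i (Lc ^ m) w| ≤ S' i / ((r : ℝ) + 1) ^ (bfQ hμν i).a)
    (hident : ∀ m : ℕ, 1 ≤ m → ∃ R₀ : ℕ, M (Lc ^ m) ≤ R₀ ∧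
      |composedCoeff μC m - ∑ w ∈ annulus 4 0 R₀, toReal w μ * toReal w ν *
        ∑ i ∈ (Finset.univ : Finset BfIdx), bfCoeff N i * (F' i (Lc ^ m) w * G' i (Lc ^ m) w)| ≤ U)
    (hid : IdentityForm μC S.β0)
    {rr γ₀ β' : ℝ} (hγ₀ : 0 < γ₀) (hrem : RemainderConst S γ₀ rr) (hr : rr ≤ B12Normalization.stepBal N Lc)
    (hβ' : 0 ≤ β') (hcont : BetaContH γ₀ β) (hup : BetaUpperH β' γ₀ β) : EndpointExistence Cn :=
  endpointExistence_of_drift_remainderConst hgen S hγ₀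
    (oneLoopDrift_of_realisedTable S hμν hN hL hR hS hR' hS' hδ hc hM hML hF hG hFtail hGtail hident hid) hrem hr hβ' hcont hup

end EndToEnd

/-! ### (v1.2) The realised table's coefficient labels through the group trace (`GhostTable` §9 / `ColourTrace`) -/

section Colour

open Literature.MathematicalPhysics.QuantumFieldTheory.Balaban1983to89.Beta.ColourTrace (adMat Complete TrOrthonormal trace_adMat_gen)

variable {n : ℕ} {C : Type*} [Fintype C] [DecidableEq C] {τ : C → Matrix (Fin n) (Fin n) ℂ}

/-- **THE LABELS `8N²`, `−2N²` THROUGH THE GROUP**: for any complete tr-orthonormal Hermitian generator family (Bałaban's conventions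
(C1)–(C2) as formalised in `ColourTrace`) and `t := trace(A_aA_a) = −2N²` (`ColourTrace.trace_adMat_gen`),
`bfCoeff N = (sqCoeff (−4t) ⊕ ghostCoeff t)`: the colour magnitude is COMPUTED; what stays LABELLED is only the pair of shape weights
`(−4, +1)` — the `4T − S` split of `bfBubble`, i.e. WHICH lattice vertices produce the square shape (an2 (I2-b)). [folklore] -/
theorem bfCoeff_eq_colour (hτ : Complete τ) (ho : TrOrthonormal τ) (hH : ∀ c, (τ c).IsHermitian) (hn : n ≠ 0) (a : C) :
    bfCoeff (n : ℝ) = Sum.elim (sqCoeff (-4 * Matrix.trace (adMat τ (τ a) * adMat τ (τ a))))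
      (ghostCoeff (Matrix.trace (adMat τ (τ a) * adMat τ (τ a)))) := by
  rw [trace_adMat_gen hτ ho hH hn, if_pos rfl, bfCoeff]
  congr 2
  ring

/-- **`hval` OF THE REALISED TABLE WITH THE COLOUR FACTOR READ OFF THE GROUP**: κ = `kappaBal N` for every such family and every
`N ≠ 0`. [folklore] -/
theorem hval_bf_gen {μ ν : Fin 4} (hμν : μ ≠ ν) (hτ : Complete τ) (ho : TrOrthonormal τ) (hH : ∀ c, (τ c).IsHermitian)
    (hn : n ≠ 0) (a : C) :
    ∀ x : E4, x ≠ 0 → x μ * x ν *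
        contBubble Finset.univ (Sum.elim (sqCoeff (-4 * Matrix.trace (adMat τ (τ a) * adMat τ (τ a))))
          (ghostCoeff (Matrix.trace (adMat τ (τ a) * adMat τ (τ a))))) (bfP hμν) (bfQ hμν) x =
      leadingIntegrand (kappaBal n) μ ν x := by
  rw [← bfCoeff_eq_colour hτ ho hH hn a]
  exact hval_bf hμν n

end Colour

/-! ## §10 (v1.3) ACTUAL-LEG STENCILS AND THE GRADED WINDOW ADAPTER: (W2′)₀ for the realised table reduced to three scalar bounds

The table legs are fixed difference STENCILS evaluated at `gFree`; evaluated at an arbitrary kernel `G` they are the candidate ACTUAL legs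
`F′ = stP G`, `G′ = stQ G` of `ComposedRoad`.  By linearity `stP G − stP gFree = stP (G − gFree)`, so graded whole-lattice bounds on
`E_n := G_n − gFree` and its first/second differences (`D₀/n²`, `D₁/n³`, `D₂/n⁴`) give the `hF`/`hG` binders through
`ComposedRoad.window_of_scaleFamily` (`‖w‖_∞ ≤ M n ≤ n`).  The three graded bounds are HYPOTHESES (the vector-legs rows' certificates,
`WoodburyFibre`/`WoodburyCovariant`/`LongitudinalWindow`, are of this flat-in-`w`, graded-in-`n` shape: e.g. `LongitudinalWindow.window_bounds`
(K0)/(K1)/(K2) = `C₀/n^d`, `C₁/n^{d+1}`, `C₂/n^{d+2}` in the `n`-scaled units, i.e. `D₀/n²`, `D₁/n³`, `D₂/n⁴` at `d = 4` after the `×n²`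
conversion to lattice units stated there; (K2)'s one difference on each variable is, for a kernel read as a function of the difference,
`−D_{ρ,ρ′}` at a shifted base point); nothing about Bałaban's propagators is asserted here, and the reading of a block-structured kernel
as a function of the difference `w` (or cell-wise) is the caller's. -/

open Literature.Probability.LatticeModels (annulus)
open Literature.MathematicalPhysics.QuantumFieldTheory.Balaban1983to89.Beta.ComposedRoad (window_of_scaleFamily)

section Stencils

variable (μ ν : Fin 4)

/-- **THE FIRST-LEG STENCILS OF THE REALISED TABLE applied to an arbitrary kernel `G : Pt → ℝ`** (the table legs are these stencils
at `G = gFree`, `stP_free`): `D_{μν}G, D_{μν}G, F_μG, F_μG ∣ G, F_μG`. [folklore] -/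
def stP (G : Pt → ℝ) : BfIdx → Pt → ℝ :=
  Sum.elim
    ![fun w => G (w + unitVec ν + unitVec μ) - G (w + unitVec ν) - G (w + unitVec μ) + G w,
      fun w => G (w + unitVec ν + unitVec μ) - G (w + unitVec ν) - G (w + unitVec μ) + G w,
      fun w => G (w + unitVec μ) - G w, fun w => G (w + unitVec μ) - G w]
    (fun b => if b then G else fun w => G (w + unitVec μ) - G w)

/-- **THE SECOND-LEG STENCILS**: `G(·+e_μ+e_ν), G(·+e_ν), F_νG(·+e_μ), F_νG ∣ D_{μν}G, F_νG`. [folklore] -/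
def stQ (G : Pt → ℝ) : BfIdx → Pt → ℝ :=
  Sum.elim
    ![fun w => G (w + (unitVec μ + unitVec ν)), fun w => G (w + unitVec ν),
      fun w => G (w + (unitVec μ + unitVec ν)) - G (w + unitVec μ), fun w => G (w + unitVec ν) - G w]
    (fun b => if b then fun w => G (w + unitVec ν + unitVec μ) - G (w + unitVec ν) - G (w + unitVec μ) + G w
      else fun w => G (w + unitVec ν) - G w)

variable {μ ν}

/-- **AT `G = gFree` THE STENCILS ARE THE TABLE LEGS** (first legs; the free legs do not depend on `(L,k)`). [folklore] -/
theorem stP_free (hμν : μ ≠ ν) (i : BfIdx) (L k : ℕ) (w : Pt) : stP μ ν gFree i w = (bfP hμν i).f L k w := by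
  rcases i with i | b
  · fin_cases i <;> simp [stP, bfP, sqP, freeMixedLeg_f, TwoPower.fwdLeg_f, gFree]
  · cases b <;> simp [stP, bfP, ghostP, TwoPower.fwdLeg_f, TwoPower.baseLeg_f, gFree]

/-- (second legs). [folklore] -/
theorem stQ_free (hμν : μ ≠ ν) (i : BfIdx) (L k : ℕ) (w : Pt) : stQ μ ν gFree i w = (bfQ hμν i).f L k w := by
  rcases i with i | b
  · fin_cases i <;> simp [stQ, bfQ, sqQ, shiftLeg₂_f, shiftLeg₁_f, fwdLegAt_f, TwoPower.fwdLeg_f, gFree]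
  · cases b <;> simp [stQ, bfQ, ghostQ, freeMixedLeg_f, TwoPower.fwdLeg_f, gFree]

/-- the stencils are linear: difference of kernels. [folklore] -/
theorem stP_sub (G G' : Pt → ℝ) (i : BfIdx) (w : Pt) : stP μ ν G i w - stP μ ν G' i w = stP μ ν (G - G') i w := by
  rcases i with i | b
  · fin_cases i <;> (simp only [stP, Sum.elim_inl, Pi.sub_apply]; simp; ring)
  · cases b
    · simp only [stP, Sum.elim_inr, Pi.sub_apply]; simp; ring
    · simp [stP]

/-- (second legs). [folklore] -/
theorem stQ_sub (G G' : Pt → ℝ) (i : BfIdx) (w : Pt) : stQ μ ν G i w - stQ μ ν G' i w = stQ μ ν (G - G') i w := by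
  rcases i with i | b
  · fin_cases i <;> (simp only [stQ, Sum.elim_inl, Pi.sub_apply]; simp) <;> ring
  · cases b <;> (simp only [stQ, Sum.elim_inr, Pi.sub_apply]; simp) <;> ring

/-- **GRADED BOUNDS ⟹ STENCIL BOUNDS, first legs**: if `|E| ≤ e₀`, every unit forward difference of `E` is `≤ e₁` and the mixed
`(μ,ν)` second difference is `≤ e₂`, then `|stP E i w| ≤ e_{a_i − 2}` with `a_i` the degree of the `i`-th first table leg. [folklore] -/
theorem abs_stP_le (hμν : μ ≠ ν) {E : Pt → ℝ} {e : ℕ → ℝ} (h0 : ∀ v, |E v| ≤ e 0)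
    (h1 : ∀ v (ρ : Fin 4), |E (v + unitVec ρ) - E v| ≤ e 1)
    (h2 : ∀ v, |E (v + unitVec ν + unitVec μ) - E (v + unitVec ν) - E (v + unitVec μ) + E v| ≤ e 2) (i : BfIdx) (w : Pt) :
    |stP μ ν E i w| ≤ e ((bfP hμν i).a - 2) := by
  rcases i with i | b
  · fin_cases i
    · simpa [stP, bfP, sqP] using h2 w
    · simpa [stP, bfP, sqP] using h2 w
    · simpa [stP, bfP, sqP] using h1 w μ
    · simpa [stP, bfP, sqP] using h1 w μ
  · cases b
    · simpa [stP, bfP, ghostP] using h1 w μ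
    · simpa [stP, bfP, ghostP] using h0 w

/-- (second legs; `a_i` the degree of the `i`-th second table leg). [folklore] -/
theorem abs_stQ_le (hμν : μ ≠ ν) {E : Pt → ℝ} {e : ℕ → ℝ} (h0 : ∀ v, |E v| ≤ e 0)
    (h1 : ∀ v (ρ : Fin 4), |E (v + unitVec ρ) - E v| ≤ e 1)
    (h2 : ∀ v, |E (v + unitVec ν + unitVec μ) - E (v + unitVec ν) - E (v + unitVec μ) + E v| ≤ e 2) (i : BfIdx) (w : Pt) :
    |stQ μ ν E i w| ≤ e ((bfQ hμν i).a - 2) := by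
  rcases i with i | b
  · fin_cases i
    · simpa [stQ, bfQ, sqQ] using h0 (w + (unitVec μ + unitVec ν))
    · simpa [stQ, bfQ, sqQ] using h0 (w + unitVec ν)
    · have := h1 (w + unitVec μ) ν
      simpa [stQ, bfQ, sqQ, add_assoc] using this
    · simpa [stQ, bfQ, sqQ] using h1 w ν
  · cases b
    · simpa [stQ, bfQ, ghostQ] using h1 w ν
    · simpa [stQ, bfQ, ghostQ, freeMixedLeg_a] using h2 w

/-- LOCAL form (hypotheses only at the cell of `w`; for the TAIL binders, where the bounds depend on the shell of `w`): first legs.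
[folklore] -/
theorem abs_stP_le_local (hμν : μ ≠ ν) (E : Pt → ℝ) (w : Pt) {e : ℕ → ℝ} (h0 : |E w| ≤ e 0)
    (h1 : |E (w + unitVec μ) - E w| ≤ e 1)
    (h2 : |E (w + unitVec ν + unitVec μ) - E (w + unitVec ν) - E (w + unitVec μ) + E w| ≤ e 2) (i : BfIdx) :
    |stP μ ν E i w| ≤ e ((bfP hμν i).a - 2) := by
  rcases i with i | b
  · fin_cases i
    · simpa [stP, bfP, sqP] using h2
    · simpa [stP, bfP, sqP] using h2
    · simpa [stP, bfP, sqP] using h1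
    · simpa [stP, bfP, sqP] using h1
  · cases b
    · simpa [stP, bfP, ghostP] using h1
    · simpa [stP, bfP, ghostP] using h0

/-- LOCAL form, second legs (hypotheses at the four corners `w, w+e_μ, w+e_ν, w+e_μ+e_ν`). [folklore] -/
theorem abs_stQ_le_local (hμν : μ ≠ ν) (E : Pt → ℝ) (w : Pt) {e : ℕ → ℝ}
    (h0a : |E (w + (unitVec μ + unitVec ν))| ≤ e 0) (h0b : |E (w + unitVec ν)| ≤ e 0)
    (h1a : |E (w + (unitVec μ + unitVec ν)) - E (w + unitVec μ)| ≤ e 1) (h1b : |E (w + unitVec ν) - E w| ≤ e 1)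
    (h2 : |E (w + unitVec ν + unitVec μ) - E (w + unitVec ν) - E (w + unitVec μ) + E w| ≤ e 2) (i : BfIdx) :
    |stQ μ ν E i w| ≤ e ((bfQ hμν i).a - 2) := by
  rcases i with i | b
  · fin_cases i
    · simpa [stQ, bfQ, sqQ] using h0a
    · simpa [stQ, bfQ, sqQ] using h0b
    · simpa [stQ, bfQ, sqQ] using h1a
    · simpa [stQ, bfQ, sqQ] using h1b
  · cases b
    · simpa [stQ, bfQ, ghostQ] using h1b
    · simpa [stQ, bfQ, ghostQ, freeMixedLeg_a] using h2

end Stencils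

section Adapter

variable {μ ν : Fin 4}

/-- the first table legs have degree `≥ 2`. [folklore] -/
theorem two_le_bfP_a (hμν : μ ≠ ν) (i : BfIdx) : 2 ≤ (bfP hμν i).a := by
  rcases i with i | b
  · fin_cases i <;> simp [bfP, sqP, freeMixedLeg_a]
  · cases b <;> simp [bfP, ghostP]

/-- the second table legs have degree `≥ 2`. [folklore] -/
theorem two_le_bfQ_a (hμν : μ ≠ ν) (i : BfIdx) : 2 ≤ (bfQ hμν i).a := by
  rcases i with i | b
  · fin_cases i <;> simp [bfQ, sqQ]
  · cases b <;> simp [bfQ, ghostQ, freeMixedLeg_a]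


/-- **THE GRADED WINDOW ADAPTER, FIRST LEGS.**  Let `Gf n : Pt → ℝ` be the actual kernel at scale `n` (read as a function of the
difference) and `E_n := Gf n − gFree`.  If on the whole lattice `|E_n| ≤ D₀/n²`, every unit forward difference of `E_n` is `≤ D₁/n³`
and the mixed `(μ,ν)` second difference of `E_n` is `≤ D₂/n⁴` (`n ≥ 2`), then the stencil legs `F′ i n := stP (Gf n) i` satisfy the
`hF` binder of `oneLoopDrift_of_realisedTable` along `n = Lc^m` with `R i := D_{a_i−2}` (via `ComposedRoad.window_of_scaleFamily` and
`‖w‖_∞ ≤ M n ≤ n`).  Nothing about Bałaban's propagators is asserted: the three graded bounds are the hypotheses. [folklore] -/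
theorem hF_of_graded (hμν : μ ≠ ν) {Lc : ℕ} (hL : 2 ≤ Lc) {M : ℕ → ℕ} (hML : ∀ n : ℕ, 2 ≤ n → M n ≤ n)
    {Gf : ℕ → Pt → ℝ} {D : ℕ → ℝ} (hD : ∀ j, 0 ≤ D j)
    (h0 : ∀ n : ℕ, 2 ≤ n → ∀ v, |Gf n v - gFree v| ≤ D 0 / (n : ℝ) ^ 2)
    (h1 : ∀ n : ℕ, 2 ≤ n → ∀ v (ρ : Fin 4),
      |(Gf n (v + unitVec ρ) - gFree (v + unitVec ρ)) - (Gf n v - gFree v)| ≤ D 1 / (n : ℝ) ^ 3)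
    (h2 : ∀ n : ℕ, 2 ≤ n → ∀ v,
      |(Gf n (v + unitVec ν + unitVec μ) - gFree (v + unitVec ν + unitVec μ)) - (Gf n (v + unitVec ν) - gFree (v + unitVec ν)) -
          (Gf n (v + unitVec μ) - gFree (v + unitVec μ)) + (Gf n v - gFree v)| ≤ D 2 / (n : ℝ) ^ 4) :
    ∀ m : ℕ, 1 ≤ m → ∀ w ∈ annulus 4 0 (M (Lc ^ m)), ∀ i ∈ (Finset.univ : Finset BfIdx),
      |stP μ ν (Gf (Lc ^ m)) i w - (bfP hμν i).f (Lc ^ m) 0 w| ≤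
        D ((bfP hμν i).a - 2) / ((supNorm w : ℝ) ^ ((bfP hμν i).a - 2) * ((Lc ^ m : ℕ) : ℝ) ^ 2) := by
  intro m hm w hw i _
  have ha := two_le_bfP_a hμν i
  have key : ∀ n : ℕ, 2 ≤ n → ∀ w : Pt, w ≠ 0 →
      |stP μ ν (Gf n) i w - (bfP hμν i).f n 0 w| ≤ D ((bfP hμν i).a - 2) / (n : ℝ) ^ (bfP hμν i).a := by
    intro n hn w _
    rw [← stP_free hμν i n 0 w, stP_sub]
    have hb := abs_stP_le hμν (E := Gf n - gFree) (e := fun j => D j / (n : ℝ) ^ (j + 2))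
      (fun v => by simpa using h0 n hn v) (fun v ρ => by simpa using h1 n hn v ρ) (fun v => by simpa using h2 n hn v) i w
    have hx : (bfP hμν i).a - 2 + 2 = (bfP hμν i).a := Nat.sub_add_cancel ha
    simp only [hx] at hb
    exact hb
  have hwin := window_of_scaleFamily (F := fun n w => stP μ ν (Gf n) i w) (f := fun n w => (bfP hμν i).f n 0 w) (hD _) ha hML key
  exact hwin (Lc ^ m) (hL.trans (Nat.le_self_pow (by omega) Lc)) w hw

/-- **THE GRADED WINDOW ADAPTER, SECOND LEGS** (`G′ i n := stQ (Gf n) i`, `S i := D_{a_i−2}`; the `hG` binder). [folklore] -/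
theorem hG_of_graded (hμν : μ ≠ ν) {Lc : ℕ} (hL : 2 ≤ Lc) {M : ℕ → ℕ} (hML : ∀ n : ℕ, 2 ≤ n → M n ≤ n)
    {Gf : ℕ → Pt → ℝ} {D : ℕ → ℝ} (hD : ∀ j, 0 ≤ D j)
    (h0 : ∀ n : ℕ, 2 ≤ n → ∀ v, |Gf n v - gFree v| ≤ D 0 / (n : ℝ) ^ 2)
    (h1 : ∀ n : ℕ, 2 ≤ n → ∀ v (ρ : Fin 4),
      |(Gf n (v + unitVec ρ) - gFree (v + unitVec ρ)) - (Gf n v - gFree v)| ≤ D 1 / (n : ℝ) ^ 3)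
    (h2 : ∀ n : ℕ, 2 ≤ n → ∀ v,
      |(Gf n (v + unitVec ν + unitVec μ) - gFree (v + unitVec ν + unitVec μ)) - (Gf n (v + unitVec ν) - gFree (v + unitVec ν)) -
          (Gf n (v + unitVec μ) - gFree (v + unitVec μ)) + (Gf n v - gFree v)| ≤ D 2 / (n : ℝ) ^ 4) :
    ∀ m : ℕ, 1 ≤ m → ∀ w ∈ annulus 4 0 (M (Lc ^ m)), ∀ i ∈ (Finset.univ : Finset BfIdx),
      |stQ μ ν (Gf (Lc ^ m)) i w - (bfQ hμν i).f (Lc ^ m) 0 w| ≤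
        D ((bfQ hμν i).a - 2) / ((supNorm w : ℝ) ^ ((bfQ hμν i).a - 2) * ((Lc ^ m : ℕ) : ℝ) ^ 2) := by
  intro m hm w hw i _
  have ha := two_le_bfQ_a hμν i
  have key : ∀ n : ℕ, 2 ≤ n → ∀ w : Pt, w ≠ 0 →
      |stQ μ ν (Gf n) i w - (bfQ hμν i).f n 0 w| ≤ D ((bfQ hμν i).a - 2) / (n : ℝ) ^ (bfQ hμν i).a := by
    intro n hn w _
    rw [← stQ_free hμν i n 0 w, stQ_sub]
    have hb := abs_stQ_le hμν (E := Gf n - gFree) (e := fun j => D j / (n : ℝ) ^ (j + 2))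
      (fun v => by simpa using h0 n hn v) (fun v ρ => by simpa using h1 n hn v ρ) (fun v => by simpa using h2 n hn v) i w
    have hx : (bfQ hμν i).a - 2 + 2 = (bfQ hμν i).a := Nat.sub_add_cancel ha
    simp only [hx] at hb
    exact hb
  have hwin := window_of_scaleFamily (F := fun n w => stQ μ ν (Gf n) i w) (f := fun n w => (bfQ hμν i).f n 0 w) (hD _) ha hML key
  exact hwin (Lc ^ m) (hL.trans (Nat.le_self_pow (by omega) Lc)) w hw

end Adapter

section GradedWall

variable {μ ν : Fin 4}

open FlowStep
open Literature.MathematicalPhysics.QuantumFieldTheory.Balaban1983to89.Beta.LargeLWindow.WindowDecomposition (constA)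
open Literature.MathematicalPhysics.QuantumFieldTheory.Balaban1983to89.Beta.Drift (OneLoopDrift)
open Literature.MathematicalPhysics.QuantumFieldTheory.Balaban1983to89.Beta.MarginalTelescoping (composedCoeff IdentityForm)
open Literature.MathematicalPhysics.QuantumFieldTheory.Balaban1983to89.Beta.LeadingCoefficient (kappaBal transverseValue)

/-- **THE (R11) WALL WITH (W1)₀ DISCHARGED AND (W2′)₀ REDUCED TO THREE GRADED SCALAR BOUNDS.**  For an actual kernel family
`Gf n : Pt → ℝ` with `E_n := Gf n − gFree` obeying `|E_n| ≤ D₀/n²`, `|∇E_n| ≤ D₁/n³` (unit forward differences), `|D_{μν}E_n| ≤ D₂/n⁴`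
on the whole lattice (`n ≥ 2`), the stencil legs `F′ = stP (Gf n)`, `G′ = stQ (Gf n)` of the realised table meet `hF`/`hG`; what remains
hypothesised is the window data `M, cc`, the TAILS of the stencil legs ((W3a)₀), the identification `hident` of the composed coefficient
with the window sum of the `F′G′` table ((W3b)₀) and `IdentityForm`.  [folklore] -/
theorem oneLoopDrift_of_gradedWindow {β : HBeta} (S : B12Beta.OneLoopSplit β) (hμν : μ ≠ ν) {N : ℝ} (hN : N ≠ 0)
    {Lc : ℕ} (hL : 2 ≤ Lc) {μC : ℕ → ℕ → ℝ} {Gf : ℕ → Pt → ℝ} {D : ℕ → ℝ} (hD : ∀ j, 0 ≤ D j)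
    {R' S' : BfIdx → ℝ} {δ U cc : ℝ} {M : ℕ → ℕ}
    (hR' : ∀ i ∈ (Finset.univ : Finset BfIdx), 0 ≤ R' i) (hS' : ∀ i ∈ (Finset.univ : Finset BfIdx), 0 ≤ S' i) (hδ : 0 < δ)
    (hc : 1 ≤ cc) (hM : ∀ L : ℕ, 2 ≤ L → 1 ≤ M L ∧ (L : ℝ) ≤ cc * M L) (hML : ∀ L : ℕ, 2 ≤ L → M L ≤ L)
    (h0 : ∀ n : ℕ, 2 ≤ n → ∀ v, |Gf n v - gFree v| ≤ D 0 / (n : ℝ) ^ 2)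
    (h1 : ∀ n : ℕ, 2 ≤ n → ∀ v (ρ : Fin 4),
      |(Gf n (v + unitVec ρ) - gFree (v + unitVec ρ)) - (Gf n v - gFree v)| ≤ D 1 / (n : ℝ) ^ 3)
    (h2 : ∀ n : ℕ, 2 ≤ n → ∀ v,
      |(Gf n (v + unitVec ν + unitVec μ) - gFree (v + unitVec ν + unitVec μ)) - (Gf n (v + unitVec ν) - gFree (v + unitVec ν)) -
          (Gf n (v + unitVec μ) - gFree (v + unitVec μ)) + (Gf n v - gFree v)| ≤ D 2 / (n : ℝ) ^ 4)
    (hFtail : ∀ m : ℕ, 1 ≤ m → ∀ r : ℕ, M (Lc ^ m) ≤ r → ∀ w ∈ annulus 4 r (r + 1), ∀ i ∈ (Finset.univ : Finset BfIdx),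
      |stP μ ν (Gf (Lc ^ m)) i w| ≤ R' i / ((r : ℝ) + 1) ^ (bfP hμν i).a * Real.exp (-(δ / ((Lc ^ m : ℕ) : ℝ)) * ((r : ℝ) + 1)))
    (hGtail : ∀ m : ℕ, 1 ≤ m → ∀ r : ℕ, M (Lc ^ m) ≤ r → ∀ w ∈ annulus 4 r (r + 1), ∀ i ∈ (Finset.univ : Finset BfIdx),
      |stQ μ ν (Gf (Lc ^ m)) i w| ≤ S' i / ((r : ℝ) + 1) ^ (bfQ hμν i).a)
    (hident : ∀ m : ℕ, 1 ≤ m → ∃ R₀ : ℕ, M (Lc ^ m) ≤ R₀ ∧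
      |composedCoeff μC m - ∑ w ∈ annulus 4 0 R₀, toReal w μ * toReal w ν *
        ∑ i ∈ (Finset.univ : Finset BfIdx), bfCoeff N i * (stP μ ν (Gf (Lc ^ m)) i w * stQ μ ν (Gf (Lc ^ m)) i w)| ≤ U)
    (hid : IdentityForm μC S.β0) :
    OneLoopDrift (B12Normalization.stepBal N Lc)
      (constA (|kappaBal N| * 24 + |kappaBal N| * 110592) (bubbleConst Finset.univ (bfCoeff N) (bfP hμν) (bfQ hμν))
          ((80 * (∑ i ∈ (Finset.univ : Finset BfIdx), |bfCoeff N i| * (R' i * S' i)) * (1 + cc / δ) + U) +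
            80 * ∑ i ∈ (Finset.univ : Finset BfIdx), |bfCoeff N i| *
              ((((bfP hμν i).A + (bfP hμν i).B) * D ((bfQ hμν i).a - 2) + D ((bfP hμν i).a - 2) * ((bfQ hμν i).A + (bfQ hμν i).B) +
                D ((bfP hμν i).a - 2) * D ((bfQ hμν i).a - 2))))
          cc (kappaBal N * transverseValue)) S.β0 :=
  oneLoopDrift_of_realisedTable S hμν hN hL (F' := fun i n w => stP μ ν (Gf n) i w) (G' := fun i n w => stQ μ ν (Gf n) i w)
    (fun _ _ => hD _) (fun _ _ => hD _) hR' hS' hδ hc hM hML (hF_of_graded hμν hL hML hD h0 h1 h2)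
    (hG_of_graded hμν hL hML hD h0 h1 h2) hFtail hGtail hident hid

end GradedWall

/-! ## §11 (v1.3) THE `F′G′` TABLE OF THE STENCIL LEGS IS THE SAME CLOSED-FORM KERNEL AT `G`: (W3b)₀'s comparison target made scalar -/

section TableSum

variable {μ ν : Fin 4}

/-- **THE SQUARE SECTOR OF THE STENCIL TABLE**: `Σ_{i<4} c·stP_i G·stQ_i G (w) = c·D_{μν}(G²)(w)` for EVERY kernel `G` (the square-cell
identity `mixedDiffFun_sq` is pure algebra). [folklore] -/
theorem stencilSum_sq (c : ℝ) (G : Pt → ℝ) (w : Pt) :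
    ∑ i : Fin 4, sqCoeff c i * (stP μ ν G (Sum.inl i) w * stQ μ ν G (Sum.inl i) w) =
      c * mixedDiffFun (fun u => G u ^ 2) (unitVec μ) (unitVec ν) w := by
  rw [mixedDiffFun_sq', Fin.sum_univ_four]
  simp only [sqCoeff, stP, stQ, Sum.elim_inl, Matrix.cons_val_zero, Matrix.cons_val_one, Matrix.cons_val, mixedDiffFun, fwdDiffFun,
    add_assoc, add_comm (unitVec ν) (unitVec μ)]
  ring

/-- **THE GHOST-SHAPE SECTOR OF THE STENCIL TABLE**: `Σ_b ghostCoeff τ b·stP_b G·stQ_b G (w) = 2τ·cellForm G e_μ e_ν w`. [folklore] -/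
theorem stencilSum_ghost (τ : ℝ) (G : Pt → ℝ) (w : Pt) :
    ∑ b : Bool, ghostCoeff τ b * (stP μ ν G (Sum.inr b) w * stQ μ ν G (Sum.inr b) w) = 2 * τ * cellForm G (unitVec μ) (unitVec ν) w := by
  rw [Fintype.sum_bool]
  simp only [ghostCoeff, stP, stQ, Sum.elim_inr, if_true, Bool.false_eq_true, if_false, cellForm, mixedDiffFun, fwdDiffFun]
  ring

/-- **THE `F′G′` TABLE OF THE STENCIL LEGS IS `8N²·D_{μν}(G²) − 4N²·cellForm G`** — the closed-form lattice kernel of `lattBubble_bf` with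
`gFree` replaced by the actual kernel `G`.  Hence the identification (W3b)₀ (`hident`) for the stencil legs compares Bałaban's composed
coefficient with the window moment of ONE explicit scalar function of `G_n`. [folklore] -/
theorem stencilSum_bf (N : ℝ) (G : Pt → ℝ) (w : Pt) :
    ∑ i ∈ (Finset.univ : Finset BfIdx), bfCoeff N i * (stP μ ν G i w * stQ μ ν G i w) =
      8 * N ^ 2 * mixedDiffFun (fun u => G u ^ 2) (unitVec μ) (unitVec ν) w - 4 * N ^ 2 * cellForm G (unitVec μ) (unitVec ν) w := by
  rw [Fintype.sum_sum_type]
  simp only [bfCoeff, Sum.elim_inl, Sum.elim_inr]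
  rw [stencilSum_sq, stencilSum_ghost]
  ring

/-- consistency: at `G = gFree` the stencil table sum is `lattBubble_bf`. [folklore] -/
theorem stencilSum_bf_free (hμν : μ ≠ ν) (N : ℝ) (L k : ℕ) (w : Pt) :
    ∑ i ∈ (Finset.univ : Finset BfIdx), bfCoeff N i * (stP μ ν gFree i w * stQ μ ν gFree i w) =
      lattBubble Finset.univ (bfCoeff N) (bfP hμν) (bfQ hμν) L k w := by
  rw [stencilSum_bf, lattBubble_bf]

open Literature.MathematicalPhysics.QuantumFieldTheory.Balaban1983to89.Beta.MarginalTelescoping (composedCoeff)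

/-- **(W3b)₀ FOR THE STENCIL LEGS, SCALAR FORM**: the `hident` binder of `oneLoopDrift_of_gradedWindow` is implied by (indeed equivalent to)
the comparison of the composed coefficient with the window `x_μx_ν`-moment of the closed-form kernel `8N²·D_{μν}(G_n²) − 4N²·cellForm G_n`.
[folklore] -/
theorem hident_of_closedForm {N : ℝ} {Lc : ℕ} {μC : ℕ → ℕ → ℝ} {Gf : ℕ → Pt → ℝ} {U : ℝ} {M : ℕ → ℕ}
    (h : ∀ m : ℕ, 1 ≤ m → ∃ R₀ : ℕ, M (Lc ^ m) ≤ R₀ ∧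
      |composedCoeff μC m - ∑ w ∈ annulus 4 0 R₀, toReal w μ * toReal w ν *
        (8 * N ^ 2 * mixedDiffFun (fun u => Gf (Lc ^ m) u ^ 2) (unitVec μ) (unitVec ν) w -
          4 * N ^ 2 * cellForm (Gf (Lc ^ m)) (unitVec μ) (unitVec ν) w)| ≤ U) :
    ∀ m : ℕ, 1 ≤ m → ∃ R₀ : ℕ, M (Lc ^ m) ≤ R₀ ∧
      |composedCoeff μC m - ∑ w ∈ annulus 4 0 R₀, toReal w μ * toReal w ν *
        ∑ i ∈ (Finset.univ : Finset BfIdx), bfCoeff N i * (stP μ ν (Gf (Lc ^ m)) i w * stQ μ ν (Gf (Lc ^ m)) i w)| ≤ U := by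
  intro m hm
  obtain ⟨R₀, hR₀, hb⟩ := h m hm
  refine ⟨R₀, hR₀, ?_⟩
  simpa only [stencilSum_bf] using hb

end TableSum

/-! ## §12 (v1.4) (W3b)₀ FOR THE STENCIL LEGS FROM A FULL-SUM IDENTIFICATION: the window truncation costs only the wall's own tails

`Beta.WindowIdentification` (row an2) types the honest analytic form (W3b′) «`β⁰` minus the FULL punctured lattice sum of the leg-product
integrand is bounded» and its algebra for kernels assembled from pieces, in the `(L,k)`-indexed shape of `WindowInterface`.  Here the
same bookkeeping in the `m`-indexed shape of the composed road (`n = Lc^m`), specialised to the stencil legs: the weighted stencil kernel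
`stK G (w) = w_μw_ν·Σ_i c_i·stP_i G·stQ_i G (w)` (`= w_μw_ν·(8N²·D_{μν}(G²) − 4N²·cellForm G)(w)`, §11); its shellwise decay beyond the
window is implied by the wall's OWN tail binders `hFtail`/`hGtail` (`WindowInterface.shellBound_of_legDecay`, total degree `6`); hence
the `hident` binder of `oneLoopDrift_of_gradedWindow` follows — with `U + ε`, any `ε > 0` — from
(W3b′)ₛₜ `∀ m ≥ 1, |composedCoeff μC m − fullSum (stK (G_{Lc^m}))| ≤ U`, and (W3b′)ₛₜ itself is the triangle inequality over a
REPRESENTATION `composedCoeff μC m = fullSum (stK G_{Lc^m}) + fullSum (C_m) + ρ_m` whose pieces are LABELLED inputs of other rows: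
the representation of the composed marginal coefficient as a `(1.22)` second moment and the identification of its leg-product part with
the stencil table ((N1)/(I2-b): lead / an2), the finitely supported contact and unit-sector pieces `C_m` (an2, `Beta.BubbleTable`), the
dressing cross terms `ρ_m` ((β-st-J), with the printed-with-proof decay inputs).  Nothing of that is asserted here. -/

section Identification

variable {μ ν : Fin 4}

open Literature.MathematicalPhysics.QuantumFieldTheory.Balaban1983to89.Beta.MarginalTelescoping (composedCoeff)
open Literature.MathematicalPhysics.QuantumFieldTheory.Balaban1983to89.Beta.WindowIdentification (psum fullSum
  abs_fullSum_sub_psum_le)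
open Literature.MathematicalPhysics.QuantumFieldTheory.Balaban1983to89.Beta.WindowInterface (shellBound_of_legDecay)

/-- The WEIGHTED STENCIL KERNEL `w_μw_ν·Σ_i bfCoeff_i·stP_i G·stQ_i G (w)` — the `(1.22)` integrand of the stencil table at the kernel `G`.
[folklore] -/
def stK (μ ν : Fin 4) (N : ℝ) (G : Pt → ℝ) (w : Pt) : ℝ :=
  toReal w μ * toReal w ν * ∑ i ∈ (Finset.univ : Finset BfIdx), bfCoeff N i * (stP μ ν G i w * stQ μ ν G i w)

/-- `stK` in closed form (§11). [folklore] -/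
theorem stK_eq_closedForm (N : ℝ) (G : Pt → ℝ) (w : Pt) :
    stK μ ν N G w = toReal w μ * toReal w ν *
      (8 * N ^ 2 * mixedDiffFun (fun u => G u ^ 2) (unitVec μ) (unitVec ν) w - 4 * N ^ 2 * cellForm G (unitVec μ) (unitVec ν) w) := by
  rw [stK, stencilSum_bf]

/-- **SHELLWISE DECAY OF THE WEIGHTED STENCIL KERNEL FROM LEG TAILS** (total degree `6`, `WindowInterface.shellBound_of_legDecay`):
on the shell `‖w‖∞ = r+1`, `|stP_i G| ≤ R′_i(r+1)^{−a_i}·ε`, `|stQ_i G| ≤ S′_i(r+1)^{−b_i}` give `|stK G (w)| ≤ (Σ_i|c_i|R′_iS′_i)(r+1)⁻⁴·ε`.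
[folklore] -/
theorem abs_stK_le_of_legTails (hμν : μ ≠ ν) {N : ℝ} {G : Pt → ℝ} {R' S' : BfIdx → ℝ} {ε : ℝ} (hε : 0 ≤ ε)
    (hR' : ∀ i ∈ (Finset.univ : Finset BfIdx), 0 ≤ R' i) {r : ℕ} {w : Pt} (hw : w ∈ annulus 4 r (r + 1))
    (hF : ∀ i ∈ (Finset.univ : Finset BfIdx), |stP μ ν G i w| ≤ R' i / ((r : ℝ) + 1) ^ (bfP hμν i).a * ε)
    (hG : ∀ i ∈ (Finset.univ : Finset BfIdx), |stQ μ ν G i w| ≤ S' i / ((r : ℝ) + 1) ^ (bfQ hμν i).a) :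
    |stK μ ν N G w| ≤ (∑ i ∈ (Finset.univ : Finset BfIdx), |bfCoeff N i| * (R' i * S' i)) / ((r : ℝ) + 1) ^ 4 * ε :=
  shellBound_of_legDecay (hdeg_bf hμν) μ ν hw hε hR' hF hG

/-- **WINDOW TRUNCATION OF A FULL-SUM IDENTIFICATION, `m`-indexed** (the composed-road form of `WindowIdentification.hident_of_fullSum`):
a scale-`Lc^m` shellwise exponential tail of `K_m` beyond `M(Lc^m)` and `|composedCoeff μC m − fullSum K_m| ≤ U` give, for every `ε > 0`,
a window radius `R₀ ≥ M(Lc^m)` with `|composedCoeff μC m − Σ_{0<‖w‖∞≤R₀} K_m| ≤ U + ε`. [folklore] -/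
theorem hident_of_fullSum_graded {μC : ℕ → ℕ → ℝ} {K : ℕ → Pt → ℝ} {Lc : ℕ} (hLc : 1 ≤ Lc) {M : ℕ → ℕ} {E δ U : ℝ}
    (hE : 0 ≤ E) (hδ : 0 < δ)
    (htail : ∀ m : ℕ, 1 ≤ m → ∀ r : ℕ, M (Lc ^ m) ≤ r → ∀ w ∈ annulus 4 r (r + 1),
      |K m w| ≤ E / ((r : ℝ) + 1) ^ 4 * Real.exp (-(δ / ((Lc ^ m : ℕ) : ℝ)) * ((r : ℝ) + 1)))
    (hU : ∀ m : ℕ, 1 ≤ m → |composedCoeff μC m - fullSum (K m)| ≤ U) {ε : ℝ} (hε : 0 < ε) :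
    ∀ m : ℕ, 1 ≤ m → ∃ R₀ : ℕ, M (Lc ^ m) ≤ R₀ ∧ |composedCoeff μC m - ∑ w ∈ annulus 4 0 R₀, K m w| ≤ U + ε := by
  intro m hm
  have hn : (0 : ℝ) < ((Lc ^ m : ℕ) : ℝ) := by
    have : 0 < Lc ^ m := pow_pos (by omega) m
    exact_mod_cast this
  set T : ℝ := 80 * E * (1 + ((Lc ^ m : ℕ) : ℝ) / δ) with hT
  have hT0 : 0 ≤ T := by rw [hT]; positivity
  obtain ⟨N₀, hN₀⟩ := exists_nat_gt (T / ε)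
  refine ⟨max (M (Lc ^ m)) N₀, le_max_left _ _, ?_⟩
  have hNpos : (0 : ℝ) < ((max (M (Lc ^ m)) N₀ : ℕ) : ℝ) + 1 := by positivity
  have hN₀' : T / ε < ((max (M (Lc ^ m)) N₀ : ℕ) : ℝ) + 1 :=
    hN₀.trans_le (by exact_mod_cast (le_max_right (M (Lc ^ m)) N₀).trans (Nat.le_succ _))
  have hrate : |fullSum (K m) - psum (K m) (max (M (Lc ^ m)) N₀)| ≤ T / (((max (M (Lc ^ m)) N₀ : ℕ) : ℝ) + 1) :=
    abs_fullSum_sub_psum_le hE hδ hn (htail m hm) (le_max_left _ _)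
  have hsmall : T / (((max (M (Lc ^ m)) N₀ : ℕ) : ℝ) + 1) ≤ ε := by
    rw [div_le_iff₀ hNpos]
    have := (div_lt_iff₀ hε).1 hN₀'
    nlinarith
  have hpsum : psum (K m) (max (M (Lc ^ m)) N₀) = ∑ w ∈ annulus 4 0 (max (M (Lc ^ m)) N₀), K m w := rfl
  calc |composedCoeff μC m - ∑ w ∈ annulus 4 0 (max (M (Lc ^ m)) N₀), K m w|
      = |(composedCoeff μC m - fullSum (K m)) + (fullSum (K m) - psum (K m) (max (M (Lc ^ m)) N₀))| := by
        rw [hpsum]; ring_nf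
    _ ≤ |composedCoeff μC m - fullSum (K m)| + |fullSum (K m) - psum (K m) (max (M (Lc ^ m)) N₀)| := abs_add_le _ _
    _ ≤ U + ε := add_le_add (hU m hm) (hrate.trans hsmall)

/-- **(W3b′) FROM A REPRESENTATION IN PIECES** (the composed-road form of `WindowIdentification.ident_of_pieces`): if
`composedCoeff μC m = fullSum K_m + fullSum C_m + ρ_m` with `|fullSum C_m| ≤ U_C` and `|ρ_m| ≤ U_ρ`, then
`|composedCoeff μC m − fullSum K_m| ≤ U_C + U_ρ`.  LABELS (inputs of other rows, asserted nowhere in this file): the representation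
itself = the `(1.22)` second-moment form of the composed marginal coefficient with its leg-product part identified with the stencil
table ((N1)/(I2-b)); `C_m` = contact table and unit-sector pieces; `ρ_m` = dressing cross terms. [folklore] -/
theorem fullSumIdent_of_pieces {μC : ℕ → ℕ → ℝ} {K C : ℕ → Pt → ℝ} {ρ : ℕ → ℝ} {UC Uρ : ℝ}
    (hrep : ∀ m : ℕ, 1 ≤ m → composedCoeff μC m = fullSum (K m) + fullSum (C m) + ρ m)
    (hC : ∀ m : ℕ, 1 ≤ m → |fullSum (C m)| ≤ UC) (hρ : ∀ m : ℕ, 1 ≤ m → |ρ m| ≤ Uρ) :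
    ∀ m : ℕ, 1 ≤ m → |composedCoeff μC m - fullSum (K m)| ≤ UC + Uρ := by
  intro m hm
  rw [hrep m hm]
  calc |fullSum (K m) + fullSum (C m) + ρ m - fullSum (K m)| = |fullSum (C m) + ρ m| := by ring_nf
    _ ≤ |fullSum (C m)| + |ρ m| := abs_add_le _ _
    _ ≤ UC + Uρ := add_le_add (hC m hm) (hρ m hm)

/-- **`hident` FOR THE STENCIL LEGS FROM (W3b′)ₛₜ AND THE WALL'S OWN TAILS.**  The tail binders `hFtail`/`hGtail` of
`oneLoopDrift_of_gradedWindow` already give the shellwise decay of `stK`, so the window truncation of a full-sum identification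
`|composedCoeff μC m − fullSum (stK G_{Lc^m})| ≤ U` costs only `ε`. [folklore] -/
theorem hident_of_stencilFullSum (hμν : μ ≠ ν) {N : ℝ} {Lc : ℕ} (hL : 2 ≤ Lc) {μC : ℕ → ℕ → ℝ} {Gf : ℕ → Pt → ℝ}
    {R' S' : BfIdx → ℝ} {δ U : ℝ} {M : ℕ → ℕ}
    (hR' : ∀ i ∈ (Finset.univ : Finset BfIdx), 0 ≤ R' i) (hS' : ∀ i ∈ (Finset.univ : Finset BfIdx), 0 ≤ S' i) (hδ : 0 < δ)
    (hFtail : ∀ m : ℕ, 1 ≤ m → ∀ r : ℕ, M (Lc ^ m) ≤ r → ∀ w ∈ annulus 4 r (r + 1), ∀ i ∈ (Finset.univ : Finset BfIdx),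
      |stP μ ν (Gf (Lc ^ m)) i w| ≤ R' i / ((r : ℝ) + 1) ^ (bfP hμν i).a * Real.exp (-(δ / ((Lc ^ m : ℕ) : ℝ)) * ((r : ℝ) + 1)))
    (hGtail : ∀ m : ℕ, 1 ≤ m → ∀ r : ℕ, M (Lc ^ m) ≤ r → ∀ w ∈ annulus 4 r (r + 1), ∀ i ∈ (Finset.univ : Finset BfIdx),
      |stQ μ ν (Gf (Lc ^ m)) i w| ≤ S' i / ((r : ℝ) + 1) ^ (bfQ hμν i).a)
    (hU : ∀ m : ℕ, 1 ≤ m → |composedCoeff μC m - fullSum (stK μ ν N (Gf (Lc ^ m)))| ≤ U) {ε : ℝ} (hε : 0 < ε) :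
    ∀ m : ℕ, 1 ≤ m → ∃ R₀ : ℕ, M (Lc ^ m) ≤ R₀ ∧
      |composedCoeff μC m - ∑ w ∈ annulus 4 0 R₀, toReal w μ * toReal w ν *
        ∑ i ∈ (Finset.univ : Finset BfIdx), bfCoeff N i * (stP μ ν (Gf (Lc ^ m)) i w * stQ μ ν (Gf (Lc ^ m)) i w)| ≤ U + ε := by
  have hE : 0 ≤ ∑ i ∈ (Finset.univ : Finset BfIdx), |bfCoeff N i| * (R' i * S' i) :=
    Finset.sum_nonneg fun i hi => mul_nonneg (abs_nonneg _) (mul_nonneg (hR' i hi) (hS' i hi))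
  have htail : ∀ m : ℕ, 1 ≤ m → ∀ r : ℕ, M (Lc ^ m) ≤ r → ∀ w ∈ annulus 4 r (r + 1),
      |stK μ ν N (Gf (Lc ^ m)) w| ≤ (∑ i ∈ (Finset.univ : Finset BfIdx), |bfCoeff N i| * (R' i * S' i)) / ((r : ℝ) + 1) ^ 4 *
        Real.exp (-(δ / ((Lc ^ m : ℕ) : ℝ)) * ((r : ℝ) + 1)) :=
    fun m hm r hr w hw =>
      abs_stK_le_of_legTails hμν (Real.exp_nonneg _) hR' hw (hFtail m hm r hr w hw) (hGtail m hm r hr w hw)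
  exact hident_of_fullSum_graded (by omega) hE hδ htail hU hε

end Identification

section GradedWallFullSum

variable {μ ν : Fin 4}

open Literature.MathematicalPhysics.QuantumFieldTheory.Balaban1983to89.FlowStep (HBeta)
open Literature.MathematicalPhysics.QuantumFieldTheory.Balaban1983to89.Beta.Drift (OneLoopDrift)
open Literature.MathematicalPhysics.QuantumFieldTheory.Balaban1983to89.Beta.LargeLWindow.WindowDecomposition (constA)
open Literature.MathematicalPhysics.QuantumFieldTheory.Balaban1983to89.Beta.MarginalTelescoping (composedCoeff IdentityForm)
open Literature.MathematicalPhysics.QuantumFieldTheory.Balaban1983to89.Beta.LeadingCoefficient (kappaBal transverseValue)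
open Literature.MathematicalPhysics.QuantumFieldTheory.Balaban1983to89.Beta.WindowIdentification (fullSum)

/-- **THE GRADED WALL WITH A FULL-SUM IDENTIFICATION** = `oneLoopDrift_of_gradedWindow` with its `hident` binder replaced by
(W3b′)ₛₜ `∀ m ≥ 1, |composedCoeff μC m − fullSum (stK G_{Lc^m})| ≤ U` (`hident_of_stencilFullSum` with `ε = 1`; the constant `A` gets
`U + 1`).  Remaining hypotheses, all explicit: window data, the three graded bounds `h0/h1/h2`, the tails `hFtail/hGtail`, (W3b′)ₛₜ, and
`IdentityForm`. [folklore] -/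
theorem oneLoopDrift_of_gradedWindow_fullSum {β : HBeta} (S : B12Beta.OneLoopSplit β) (hμν : μ ≠ ν) {N : ℝ} (hN : N ≠ 0)
    {Lc : ℕ} (hL : 2 ≤ Lc) {μC : ℕ → ℕ → ℝ} {Gf : ℕ → Pt → ℝ} {D : ℕ → ℝ} (hD : ∀ j, 0 ≤ D j)
    {R' S' : BfIdx → ℝ} {δ U cc : ℝ} {M : ℕ → ℕ}
    (hR' : ∀ i ∈ (Finset.univ : Finset BfIdx), 0 ≤ R' i) (hS' : ∀ i ∈ (Finset.univ : Finset BfIdx), 0 ≤ S' i) (hδ : 0 < δ)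
    (hc : 1 ≤ cc) (hM : ∀ L : ℕ, 2 ≤ L → 1 ≤ M L ∧ (L : ℝ) ≤ cc * M L) (hML : ∀ L : ℕ, 2 ≤ L → M L ≤ L)
    (h0 : ∀ n : ℕ, 2 ≤ n → ∀ v, |Gf n v - gFree v| ≤ D 0 / (n : ℝ) ^ 2)
    (h1 : ∀ n : ℕ, 2 ≤ n → ∀ v (ρ : Fin 4),
      |(Gf n (v + unitVec ρ) - gFree (v + unitVec ρ)) - (Gf n v - gFree v)| ≤ D 1 / (n : ℝ) ^ 3)
    (h2 : ∀ n : ℕ, 2 ≤ n → ∀ v,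
      |(Gf n (v + unitVec ν + unitVec μ) - gFree (v + unitVec ν + unitVec μ)) - (Gf n (v + unitVec ν) - gFree (v + unitVec ν)) -
          (Gf n (v + unitVec μ) - gFree (v + unitVec μ)) + (Gf n v - gFree v)| ≤ D 2 / (n : ℝ) ^ 4)
    (hFtail : ∀ m : ℕ, 1 ≤ m → ∀ r : ℕ, M (Lc ^ m) ≤ r → ∀ w ∈ annulus 4 r (r + 1), ∀ i ∈ (Finset.univ : Finset BfIdx),
      |stP μ ν (Gf (Lc ^ m)) i w| ≤ R' i / ((r : ℝ) + 1) ^ (bfP hμν i).a * Real.exp (-(δ / ((Lc ^ m : ℕ) : ℝ)) * ((r : ℝ) + 1)))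
    (hGtail : ∀ m : ℕ, 1 ≤ m → ∀ r : ℕ, M (Lc ^ m) ≤ r → ∀ w ∈ annulus 4 r (r + 1), ∀ i ∈ (Finset.univ : Finset BfIdx),
      |stQ μ ν (Gf (Lc ^ m)) i w| ≤ S' i / ((r : ℝ) + 1) ^ (bfQ hμν i).a)
    (hU : ∀ m : ℕ, 1 ≤ m → |composedCoeff μC m - fullSum (stK μ ν N (Gf (Lc ^ m)))| ≤ U)
    (hid : IdentityForm μC S.β0) :
    OneLoopDrift (B12Normalization.stepBal N Lc)
      (constA (|kappaBal N| * 24 + |kappaBal N| * 110592) (bubbleConst Finset.univ (bfCoeff N) (bfP hμν) (bfQ hμν))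
          ((80 * (∑ i ∈ (Finset.univ : Finset BfIdx), |bfCoeff N i| * (R' i * S' i)) * (1 + cc / δ) + (U + 1)) +
            80 * ∑ i ∈ (Finset.univ : Finset BfIdx), |bfCoeff N i| *
              ((((bfP hμν i).A + (bfP hμν i).B) * D ((bfQ hμν i).a - 2) + D ((bfP hμν i).a - 2) * ((bfQ hμν i).A + (bfQ hμν i).B) +
                D ((bfP hμν i).a - 2) * D ((bfQ hμν i).a - 2))))
          cc (kappaBal N * transverseValue)) S.β0 :=
  oneLoopDrift_of_gradedWindow S hμν hN hL hD hR' hS' hδ hc hM hML h0 h1 h2 hFtail hGtail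
    (hident_of_stencilFullSum hμν hL hR' hS' hδ hFtail hGtail hU one_pos) hid

end GradedWallFullSum

/-! ## §13 (v1.5) (W3a)₀ FOR THE STENCIL LEGS FROM GRADED DECAY OF THE KERNEL: the tail binders made scalar

The tail binders `hFtail`/`hGtail` of the graded wall are statements about the six-plus-six stencil legs.  They follow from THREE graded
decay bounds on the kernel itself off the origin — `|G_n(v)| ≤ A₀e^{−(δ/n)‖v‖}‖v‖⁻²`, `|∇G_n(v)| ≤ A₁e^{−(δ/n)‖v‖}‖v‖⁻³`,
`|D_{μν}G_n(v)| ≤ A₂e^{−(δ/n)‖v‖}‖v‖⁻⁴` (`‖·‖ = ‖·‖∞`, `v ≠ 0`, `n ≥ 2`) — by the local stencil bounds of §10: the first legs use the bounds AT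
the shell point (`R′_i = A_{a_i−2}`, no loss), the second legs at points shifted by at most one unit (`‖w + s‖∞ ≥ r ≥ 1`; `S′_i = 2^{b_i}A_{b_i−2}`,
the exponential dropped as the wall's `hGtail` carries none).  The decay bounds are HYPOTHESES (the shape of the printed-with-proof propagator
decay, to be supplied by the vector-legs rows under the (R13-1) reading); nothing about Bałaban's propagators is asserted here. -/

section DecayTails

variable {μ ν : Fin 4}

/-- Monotonicity of the graded decay profile: for `0 < r ≤ y`, `A·e^{−cy}/y^a ≤ A/r^a` (`A, c ≥ 0`). [folklore] -/
theorem decay_le_pow {A c y r : ℝ} (a : ℕ) (hA : 0 ≤ A) (hc : 0 ≤ c) (hr : 0 < r) (hy : r ≤ y) :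
    A * Real.exp (-c * y) / y ^ a ≤ A / r ^ a := by
  have hy0 : 0 < y := hr.trans_le hy
  have hexp : Real.exp (-c * y) ≤ 1 := Real.exp_le_one_iff.mpr (by nlinarith)
  calc A * Real.exp (-c * y) / y ^ a ≤ A / y ^ a := by
        apply div_le_div_of_nonneg_right _ (by positivity)
        exact mul_le_of_le_one_right hA hexp
    _ ≤ A / r ^ a := by
        apply div_le_div_of_nonneg_left hA (by positivity)
        exact pow_le_pow_left₀ hr.le hy a

/-- `A/r^a ≤ 2^aA/(r+1)^a` for `r ≥ 1`. [folklore] -/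
theorem pow_shift_le {A r : ℝ} (a : ℕ) (hA : 0 ≤ A) (hr : 1 ≤ r) : A / r ^ a ≤ A * 2 ^ a / (r + 1) ^ a := by
  have hr0 : 0 < r := by linarith
  rw [div_le_div_iff₀ (by positivity) (by positivity)]
  have h : (r + 1) ^ a ≤ (2 * r) ^ a := pow_le_pow_left₀ (by positivity) (by linarith) a
  calc A * (r + 1) ^ a ≤ A * (2 * r) ^ a := mul_le_mul_of_nonneg_left h hA
    _ = A * 2 ^ a * r ^ a := by rw [mul_pow]; ring

/-- **FIRST-LEG TAILS FROM GRADED DECAY, one shell point** (the bounds are used AT `w`, `‖w‖∞ = r+1`; no loss). [folklore] -/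
theorem abs_stP_le_of_decay (hμν : μ ≠ ν) {G : Pt → ℝ} {A : ℕ → ℝ} {c : ℝ}
    (d0 : ∀ v : Pt, v ≠ 0 → |G v| ≤ A 0 * Real.exp (-c * supNorm v) / (supNorm v : ℝ) ^ 2)
    (d1 : ∀ v : Pt, v ≠ 0 → ∀ ρ : Fin 4, |G (v + unitVec ρ) - G v| ≤ A 1 * Real.exp (-c * supNorm v) / (supNorm v : ℝ) ^ 3)
    (d2 : ∀ v : Pt, v ≠ 0 →
      |G (v + unitVec ν + unitVec μ) - G (v + unitVec ν) - G (v + unitVec μ) + G v| ≤ A 2 * Real.exp (-c * supNorm v) / (supNorm v : ℝ) ^ 4)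
    {r : ℕ} {w : Pt} (hw : w ∈ annulus 4 r (r + 1)) (i : BfIdx) :
    |stP μ ν G i w| ≤ A ((bfP hμν i).a - 2) / ((r : ℝ) + 1) ^ (bfP hμν i).a * Real.exp (-c * ((r : ℝ) + 1)) := by
  have hw0 : w ≠ 0 := DyadicShell.ne_zero_of_mem_annulus hw
  have hsup : (supNorm w : ℝ) = (r : ℝ) + 1 := by rw [DyadicShell.supNorm_eq_of_mem_sphere hw]; push_cast; ring
  have key := abs_stP_le_local hμν G w (e := fun j => A j * Real.exp (-c * ((r : ℝ) + 1)) / ((r : ℝ) + 1) ^ (j + 2))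
    (by simpa [hsup] using d0 w hw0) (by simpa [hsup] using d1 w hw0 μ) (by simpa [hsup] using d2 w hw0) i
  have ha : (bfP hμν i).a - 2 + 2 = (bfP hμν i).a := Nat.sub_add_cancel (two_le_bfP_a hμν i)
  simp only [ha] at key
  calc |stP μ ν G i w| ≤ A ((bfP hμν i).a - 2) * Real.exp (-c * ((r : ℝ) + 1)) / ((r : ℝ) + 1) ^ (bfP hμν i).a := key
    _ = A ((bfP hμν i).a - 2) / ((r : ℝ) + 1) ^ (bfP hμν i).a * Real.exp (-c * ((r : ℝ) + 1)) := by ring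

/-- **SECOND-LEG TAILS FROM GRADED DECAY, one shell point** (the bounds are used at `w + s`, `‖s‖∞ ≤ 1`, so `‖w + s‖∞ ≥ r ≥ 1`; constant
`2^{b_i}A_{b_i−2}`, exponential dropped). [folklore] -/
theorem abs_stQ_le_of_decay (hμν : μ ≠ ν) {G : Pt → ℝ} {A : ℕ → ℝ} {c : ℝ} (hA : ∀ j, 0 ≤ A j) (hc : 0 ≤ c)
    (d0 : ∀ v : Pt, v ≠ 0 → |G v| ≤ A 0 * Real.exp (-c * supNorm v) / (supNorm v : ℝ) ^ 2)
    (d1 : ∀ v : Pt, v ≠ 0 → ∀ ρ : Fin 4, |G (v + unitVec ρ) - G v| ≤ A 1 * Real.exp (-c * supNorm v) / (supNorm v : ℝ) ^ 3)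
    (d2 : ∀ v : Pt, v ≠ 0 →
      |G (v + unitVec ν + unitVec μ) - G (v + unitVec ν) - G (v + unitVec μ) + G v| ≤ A 2 * Real.exp (-c * supNorm v) / (supNorm v : ℝ) ^ 4)
    {r : ℕ} (hr : 1 ≤ r) {w : Pt} (hw : w ∈ annulus 4 r (r + 1)) (i : BfIdx) :
    |stQ μ ν G i w| ≤ A ((bfQ hμν i).a - 2) * 2 ^ (bfQ hμν i).a / ((r : ℝ) + 1) ^ (bfQ hμν i).a := by
  have hsup : (supNorm w : ℝ) = (r : ℝ) + 1 := by rw [DyadicShell.supNorm_eq_of_mem_sphere hw]; push_cast; ring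
  have hr0 : (0 : ℝ) < (r : ℝ) := by exact_mod_cast hr
  have hr1 : (1 : ℝ) ≤ (r : ℝ) := by exact_mod_cast hr
  -- every evaluation point `v = w + s` with `‖s‖∞ ≤ 1` has `‖v‖∞ ≥ r`, hence `v ≠ 0`
  have hge : ∀ s : Pt, (supNorm s : ℝ) ≤ 1 → (r : ℝ) ≤ supNorm (w + s) ∧ w + s ≠ 0 := by
    intro s hs
    have h := supNorm_sub_le_supNorm_add w s
    have hge : (r : ℝ) ≤ supNorm (w + s) := by linarith
    refine ⟨hge, fun h0 => ?_⟩
    rw [h0] at hge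
    simp at hge
    linarith
  -- the graded profile at such points is bounded by `A_j / r^{j+2}`
  have bnd : ∀ (j : ℕ) (s : Pt), (supNorm s : ℝ) ≤ 1 →
      A j * Real.exp (-c * supNorm (w + s)) / (supNorm (w + s) : ℝ) ^ (j + 2) ≤ A j / (r : ℝ) ^ (j + 2) :=
    fun j s hs => decay_le_pow (j + 2) (hA j) hc hr0 (hge s hs).1
  have hs0 : (supNorm (0 : Pt) : ℝ) ≤ 1 := by simp [supNorm_eq_zero_iff.mpr rfl]
  have hsμ : (supNorm (unitVec μ : Pt) : ℝ) ≤ 1 := by rw [supNorm_unitVec]; simp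
  have hsν : (supNorm (unitVec ν : Pt) : ℝ) ≤ 1 := by rw [supNorm_unitVec]; simp
  have hsμν : (supNorm (unitVec μ + unitVec ν : Pt) : ℝ) ≤ 1 := by rw [supNorm_unitVec_add hμν]; simp
  have e0a : |G (w + (unitVec μ + unitVec ν))| ≤ A 0 / (r : ℝ) ^ (0 + 2) :=
    (d0 _ (hge _ hsμν).2).trans (bnd 0 _ hsμν)
  have e0b : |G (w + unitVec ν)| ≤ A 0 / (r : ℝ) ^ (0 + 2) := (d0 _ (hge _ hsν).2).trans (bnd 0 _ hsν)
  have e1a : |G (w + (unitVec μ + unitVec ν)) - G (w + unitVec μ)| ≤ A 1 / (r : ℝ) ^ (1 + 2) := by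
    have h := (d1 _ (hge _ hsμ).2 ν).trans (bnd 1 _ hsμ)
    simpa [add_assoc] using h
  have e1b : |G (w + unitVec ν) - G w| ≤ A 1 / (r : ℝ) ^ (1 + 2) := by
    have h := (d1 _ (hge _ hs0).2 ν).trans (bnd 1 _ hs0)
    simpa using h
  have e2 : |G (w + unitVec ν + unitVec μ) - G (w + unitVec ν) - G (w + unitVec μ) + G w| ≤ A 2 / (r : ℝ) ^ (2 + 2) := by
    have h := (d2 _ (hge _ hs0).2).trans (bnd 2 _ hs0)
    simpa using h
  have key := abs_stQ_le_local hμν G w (e := fun j => A j / (r : ℝ) ^ (j + 2)) e0a e0b e1a e1b e2 i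
  have ha : (bfQ hμν i).a - 2 + 2 = (bfQ hμν i).a := Nat.sub_add_cancel (two_le_bfQ_a hμν i)
  simp only [ha] at key
  exact key.trans (pow_shift_le _ (hA _) hr1)

/-- **`hFtail` OF THE GRADED WALL FROM GRADED DECAY** (`R′_i = A_{a_i−2}`, rate `δ/n`, `n = Lc^m`). [folklore] -/
theorem hFtail_of_decay (hμν : μ ≠ ν) {Lc : ℕ} {Gf : ℕ → Pt → ℝ} {A : ℕ → ℝ} {δ : ℝ} {M : ℕ → ℕ}
    (d0 : ∀ n : ℕ, 2 ≤ n → ∀ v : Pt, v ≠ 0 → |Gf n v| ≤ A 0 * Real.exp (-(δ / n) * supNorm v) / (supNorm v : ℝ) ^ 2)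
    (d1 : ∀ n : ℕ, 2 ≤ n → ∀ v : Pt, v ≠ 0 → ∀ ρ : Fin 4,
      |Gf n (v + unitVec ρ) - Gf n v| ≤ A 1 * Real.exp (-(δ / n) * supNorm v) / (supNorm v : ℝ) ^ 3)
    (d2 : ∀ n : ℕ, 2 ≤ n → ∀ v : Pt, v ≠ 0 →
      |Gf n (v + unitVec ν + unitVec μ) - Gf n (v + unitVec ν) - Gf n (v + unitVec μ) + Gf n v| ≤
        A 2 * Real.exp (-(δ / n) * supNorm v) / (supNorm v : ℝ) ^ 4)
    (hL : 2 ≤ Lc) :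
    ∀ m : ℕ, 1 ≤ m → ∀ r : ℕ, M (Lc ^ m) ≤ r → ∀ w ∈ annulus 4 r (r + 1), ∀ i ∈ (Finset.univ : Finset BfIdx),
      |stP μ ν (Gf (Lc ^ m)) i w| ≤ A ((bfP hμν i).a - 2) / ((r : ℝ) + 1) ^ (bfP hμν i).a *
        Real.exp (-(δ / ((Lc ^ m : ℕ) : ℝ)) * ((r : ℝ) + 1)) := by
  intro m hm r _ w hw i _
  have hn : 2 ≤ Lc ^ m := hL.trans (Nat.le_self_pow (by omega) Lc)
  exact abs_stP_le_of_decay hμν (d0 _ hn) (d1 _ hn) (d2 _ hn) hw i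

/-- **`hGtail` OF THE GRADED WALL FROM GRADED DECAY** (`S′_i = 2^{b_i}A_{b_i−2}`; needs the window floor `M ≥ 1`). [folklore] -/
theorem hGtail_of_decay (hμν : μ ≠ ν) {Lc : ℕ} {Gf : ℕ → Pt → ℝ} {A : ℕ → ℝ} {δ : ℝ} {M : ℕ → ℕ} (hA : ∀ j, 0 ≤ A j)
    (hδ : 0 < δ) (hM1 : ∀ L : ℕ, 2 ≤ L → 1 ≤ M L)
    (d0 : ∀ n : ℕ, 2 ≤ n → ∀ v : Pt, v ≠ 0 → |Gf n v| ≤ A 0 * Real.exp (-(δ / n) * supNorm v) / (supNorm v : ℝ) ^ 2)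
    (d1 : ∀ n : ℕ, 2 ≤ n → ∀ v : Pt, v ≠ 0 → ∀ ρ : Fin 4,
      |Gf n (v + unitVec ρ) - Gf n v| ≤ A 1 * Real.exp (-(δ / n) * supNorm v) / (supNorm v : ℝ) ^ 3)
    (d2 : ∀ n : ℕ, 2 ≤ n → ∀ v : Pt, v ≠ 0 →
      |Gf n (v + unitVec ν + unitVec μ) - Gf n (v + unitVec ν) - Gf n (v + unitVec μ) + Gf n v| ≤
        A 2 * Real.exp (-(δ / n) * supNorm v) / (supNorm v : ℝ) ^ 4)
    (hL : 2 ≤ Lc) :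
    ∀ m : ℕ, 1 ≤ m → ∀ r : ℕ, M (Lc ^ m) ≤ r → ∀ w ∈ annulus 4 r (r + 1), ∀ i ∈ (Finset.univ : Finset BfIdx),
      |stQ μ ν (Gf (Lc ^ m)) i w| ≤ A ((bfQ hμν i).a - 2) * 2 ^ (bfQ hμν i).a / ((r : ℝ) + 1) ^ (bfQ hμν i).a := by
  intro m hm r hr w hw i _
  have hn : 2 ≤ Lc ^ m := hL.trans (Nat.le_self_pow (by omega) Lc)
  have hc : (0 : ℝ) ≤ δ / ((Lc ^ m : ℕ) : ℝ) := by positivity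
  exact abs_stQ_le_of_decay hμν hA hc (d0 _ hn) (d1 _ hn) (d2 _ hn) ((hM1 _ hn).trans hr) hw i

end DecayTails

section DecayWall

variable {μ ν : Fin 4}

open Literature.MathematicalPhysics.QuantumFieldTheory.Balaban1983to89.FlowStep (HBeta)
open Literature.MathematicalPhysics.QuantumFieldTheory.Balaban1983to89.Beta.Drift (OneLoopDrift)
open Literature.MathematicalPhysics.QuantumFieldTheory.Balaban1983to89.Beta.LargeLWindow.WindowDecomposition (constA)
open Literature.MathematicalPhysics.QuantumFieldTheory.Balaban1983to89.Beta.MarginalTelescoping (composedCoeff IdentityForm)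
open Literature.MathematicalPhysics.QuantumFieldTheory.Balaban1983to89.Beta.LeadingCoefficient (kappaBal transverseValue)
open Literature.MathematicalPhysics.QuantumFieldTheory.Balaban1983to89.Beta.WindowIdentification (fullSum)

/-- **THE SCALAR WALL FOR THE REALISED TABLE.**  `oneLoopDrift_of_gradedWindow_fullSum` with its tail binders DISCHARGED from graded decay
(§13): besides the window data and `IdentityForm`, the hypotheses are now SIX SCALAR GRADED BOUNDS on the kernel family `G_n` — three on the
window against `gFree` (`h0/h1/h2`: `D₀/n², D₁/n³, D₂/n⁴`), three off the origin with decay (`d0/d1/d2`: `A_je^{−(δ/n)‖v‖}‖v‖^{−2−j}`) — and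
ONE full-sum comparison per scale ((W3b′)ₛₜ).  The constant: `R′_i = A_{a_i−2}`, `S′_i = 2^{b_i}A_{b_i−2}`, `U + 1`. [folklore] -/
theorem oneLoopDrift_of_scalarBounds {β : HBeta} (S : B12Beta.OneLoopSplit β) (hμν : μ ≠ ν) {N : ℝ} (hN : N ≠ 0)
    {Lc : ℕ} (hL : 2 ≤ Lc) {μC : ℕ → ℕ → ℝ} {Gf : ℕ → Pt → ℝ} {D A : ℕ → ℝ} (hD : ∀ j, 0 ≤ D j) (hA : ∀ j, 0 ≤ A j)
    {δ U cc : ℝ} {M : ℕ → ℕ} (hδ : 0 < δ)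
    (hc : 1 ≤ cc) (hM : ∀ L : ℕ, 2 ≤ L → 1 ≤ M L ∧ (L : ℝ) ≤ cc * M L) (hML : ∀ L : ℕ, 2 ≤ L → M L ≤ L)
    (h0 : ∀ n : ℕ, 2 ≤ n → ∀ v, |Gf n v - gFree v| ≤ D 0 / (n : ℝ) ^ 2)
    (h1 : ∀ n : ℕ, 2 ≤ n → ∀ v (ρ : Fin 4),
      |(Gf n (v + unitVec ρ) - gFree (v + unitVec ρ)) - (Gf n v - gFree v)| ≤ D 1 / (n : ℝ) ^ 3)
    (h2 : ∀ n : ℕ, 2 ≤ n → ∀ v,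
      |(Gf n (v + unitVec ν + unitVec μ) - gFree (v + unitVec ν + unitVec μ)) - (Gf n (v + unitVec ν) - gFree (v + unitVec ν)) -
          (Gf n (v + unitVec μ) - gFree (v + unitVec μ)) + (Gf n v - gFree v)| ≤ D 2 / (n : ℝ) ^ 4)
    (d0 : ∀ n : ℕ, 2 ≤ n → ∀ v : Pt, v ≠ 0 → |Gf n v| ≤ A 0 * Real.exp (-(δ / n) * supNorm v) / (supNorm v : ℝ) ^ 2)
    (d1 : ∀ n : ℕ, 2 ≤ n → ∀ v : Pt, v ≠ 0 → ∀ ρ : Fin 4,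
      |Gf n (v + unitVec ρ) - Gf n v| ≤ A 1 * Real.exp (-(δ / n) * supNorm v) / (supNorm v : ℝ) ^ 3)
    (d2 : ∀ n : ℕ, 2 ≤ n → ∀ v : Pt, v ≠ 0 →
      |Gf n (v + unitVec ν + unitVec μ) - Gf n (v + unitVec ν) - Gf n (v + unitVec μ) + Gf n v| ≤
        A 2 * Real.exp (-(δ / n) * supNorm v) / (supNorm v : ℝ) ^ 4)
    (hU : ∀ m : ℕ, 1 ≤ m → |composedCoeff μC m - fullSum (stK μ ν N (Gf (Lc ^ m)))| ≤ U)
    (hid : IdentityForm μC S.β0) :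
    OneLoopDrift (B12Normalization.stepBal N Lc)
      (constA (|kappaBal N| * 24 + |kappaBal N| * 110592) (bubbleConst Finset.univ (bfCoeff N) (bfP hμν) (bfQ hμν))
          ((80 * (∑ i ∈ (Finset.univ : Finset BfIdx), |bfCoeff N i| *
              (A ((bfP hμν i).a - 2) * (A ((bfQ hμν i).a - 2) * 2 ^ (bfQ hμν i).a))) * (1 + cc / δ) + (U + 1)) +
            80 * ∑ i ∈ (Finset.univ : Finset BfIdx), |bfCoeff N i| *
              ((((bfP hμν i).A + (bfP hμν i).B) * D ((bfQ hμν i).a - 2) + D ((bfP hμν i).a - 2) * ((bfQ hμν i).A + (bfQ hμν i).B) +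
                D ((bfP hμν i).a - 2) * D ((bfQ hμν i).a - 2))))
          cc (kappaBal N * transverseValue)) S.β0 :=
  oneLoopDrift_of_gradedWindow_fullSum S hμν hN hL hD (R' := fun i => A ((bfP hμν i).a - 2))
    (S' := fun i => A ((bfQ hμν i).a - 2) * 2 ^ (bfQ hμν i).a) (fun i _ => hA _) (fun i _ => mul_nonneg (hA _) (by positivity))
    hδ hc hM hML h0 h1 h2
    (hFtail_of_decay hμν d0 d1 d2 hL) (hGtail_of_decay hμν hA hδ (fun L hL2 => (hM L hL2).1) d0 d1 d2 hL) hU hid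

end DecayWall

/-! ## §14 (v1.6) THE END STATEMENT WITH SCALAR INPUTS: `EndpointExistence` from the scalar wall

`endpointExistence_of_realisedTable` (§9) with the leg families, window bounds and tails replaced by the NINE SCALAR STATEMENTS of
`oneLoopDrift_of_scalarBounds` (§13).  This is the form in which the an3 lane is meant to be cited by the (T) row: on the table side nothing
but scalar graded bounds on one kernel family `G_n : ℤ⁴ → ℝ`, one full-sum comparison per scale and `IdentityForm` is consumed; downstream,
verbatim binders of the tree theorems of rows an4 (`RemainderConst`, `r ≤ stepBal`), (C) (`BetaContH`), the printed-type upper bound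
(`BetaUpperH`) and the construction (`ForwardGenerated`).  HONEST FRAMING: conditional end statement; NOT the continuum limit, NOT Clay. -/

section EndToEndScalar

variable {μ ν : Fin 4}

open Literature.Probability.LatticeModels (annulus)
open FlowStep DagBinding
open Literature.MathematicalPhysics.QuantumFieldTheory.Balaban1983to89.Beta.LargeLWindow.WindowDecomposition (constA)
open Literature.MathematicalPhysics.QuantumFieldTheory.Balaban1983to89.Beta.Drift (OneLoopDrift)
open Literature.MathematicalPhysics.QuantumFieldTheory.Balaban1983to89.Beta.MarginalTelescoping (composedCoeff IdentityForm)
open Literature.MathematicalPhysics.QuantumFieldTheory.Balaban1983to89.Beta.LeadingCoefficient (kappaBal transverseValue)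
open Literature.MathematicalPhysics.QuantumFieldTheory.Balaban1983to89.Beta.RemainderChain (RemainderConst)
open Literature.MathematicalPhysics.QuantumFieldTheory.Balaban1983to89.Beta.DriftRemainder
  (endpointExistence_of_drift_remainderConst)
open Literature.MathematicalPhysics.QuantumFieldTheory.Balaban1983to89.Beta.WindowIdentification (fullSum)

/-- **`EndpointExistence` FROM SCALAR INPUTS** — window data; `h0/h1/h2` (graded window bounds of `G_n − gFree`); `d0/d1/d2` (graded decay of
`G_n` off the origin); (W3b′)ₛₜ; `IdentityForm`; then the downstream binders verbatim.  Composition of `oneLoopDrift_of_scalarBounds` with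
`DriftRemainder.endpointExistence_of_drift_remainderConst`; nothing of Bałaban's series is asserted. [folklore] -/
theorem endpointExistence_of_scalarBounds {β : HBeta} {Cn : B12.Construction} (hgen : ForwardGenerated Cn β)
    (S : B12Beta.OneLoopSplit β) (hμν : μ ≠ ν) {N : ℝ} (hN : N ≠ 0)
    {Lc : ℕ} (hL : 2 ≤ Lc) {μC : ℕ → ℕ → ℝ} {Gf : ℕ → Pt → ℝ} {D A : ℕ → ℝ} (hD : ∀ j, 0 ≤ D j) (hA : ∀ j, 0 ≤ A j)
    {δ U cc : ℝ} {M : ℕ → ℕ} (hδ : 0 < δ)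
    (hc : 1 ≤ cc) (hM : ∀ L : ℕ, 2 ≤ L → 1 ≤ M L ∧ (L : ℝ) ≤ cc * M L) (hML : ∀ L : ℕ, 2 ≤ L → M L ≤ L)
    (h0 : ∀ n : ℕ, 2 ≤ n → ∀ v, |Gf n v - gFree v| ≤ D 0 / (n : ℝ) ^ 2)
    (h1 : ∀ n : ℕ, 2 ≤ n → ∀ v (ρ : Fin 4),
      |(Gf n (v + unitVec ρ) - gFree (v + unitVec ρ)) - (Gf n v - gFree v)| ≤ D 1 / (n : ℝ) ^ 3)
    (h2 : ∀ n : ℕ, 2 ≤ n → ∀ v,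
      |(Gf n (v + unitVec ν + unitVec μ) - gFree (v + unitVec ν + unitVec μ)) - (Gf n (v + unitVec ν) - gFree (v + unitVec ν)) -
          (Gf n (v + unitVec μ) - gFree (v + unitVec μ)) + (Gf n v - gFree v)| ≤ D 2 / (n : ℝ) ^ 4)
    (d0 : ∀ n : ℕ, 2 ≤ n → ∀ v : Pt, v ≠ 0 → |Gf n v| ≤ A 0 * Real.exp (-(δ / n) * supNorm v) / (supNorm v : ℝ) ^ 2)
    (d1 : ∀ n : ℕ, 2 ≤ n → ∀ v : Pt, v ≠ 0 → ∀ ρ : Fin 4,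
      |Gf n (v + unitVec ρ) - Gf n v| ≤ A 1 * Real.exp (-(δ / n) * supNorm v) / (supNorm v : ℝ) ^ 3)
    (d2 : ∀ n : ℕ, 2 ≤ n → ∀ v : Pt, v ≠ 0 →
      |Gf n (v + unitVec ν + unitVec μ) - Gf n (v + unitVec ν) - Gf n (v + unitVec μ) + Gf n v| ≤
        A 2 * Real.exp (-(δ / n) * supNorm v) / (supNorm v : ℝ) ^ 4)
    (hU : ∀ m : ℕ, 1 ≤ m → |composedCoeff μC m - fullSum (stK μ ν N (Gf (Lc ^ m)))| ≤ U)
    (hid : IdentityForm μC S.β0)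
    {rr γ₀ β' : ℝ} (hγ₀ : 0 < γ₀) (hrem : RemainderConst S γ₀ rr) (hr : rr ≤ B12Normalization.stepBal N Lc)
    (hβ' : 0 ≤ β') (hcont : BetaContH γ₀ β) (hup : BetaUpperH β' γ₀ β) : EndpointExistence Cn :=
  endpointExistence_of_drift_remainderConst hgen S hγ₀
    (oneLoopDrift_of_scalarBounds S hμν hN hL hD hA hδ hc hM hML h0 h1 h2 d0 d1 d2 hU hid) hrem hr hβ' hcont hup

end EndToEndScalar

/-! ## §15 (v1.7, RULING (R13-3)) THE BASE-POINT-AVERAGED SCALAR WALL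

The lead's `ComposedRoad` §10 (`oneLoopDrift_of_composedLegInterfacePow_identity_avg`, RULING (R13-3)) reads the wall's leg data PER BASE
POINT `b ∈ Bset n` (constants free of `b`) and identifies `composedCoeff μC m` with a CONVEX COMBINATION of the single-base-point window sums.
This section plugs the realised table into that socket with SCALAR inputs: a kernel family `G_{n,b} : ℤ⁴ → ℝ` (scale `n`, base point `b`), the
six graded bounds of §10/§13 required for every `b ∈ Bset n` with `b`-free constants, and the full-sum comparison against the `wt`-convex
combination of the full lattice sums `fullSum (stK G_{n,b})`.  The per-`b` leg statements are obtained from the one-family theorems by freezing `b`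
(junk-extending the family off `Bset`: by `gFree` for the window bounds, by `0` for the tails); the window truncation is uniform in `b` because
the tail constant is, and convexity (`ComposedRoad.abs_convexComb_le`) does the rest.  SAME conclusion and constant as §13/§14. -/

section Avg

variable {μ ν : Fin 4} {κB : Type*}

open Literature.MathematicalPhysics.QuantumFieldTheory.Balaban1983to89.Beta.WindowIdentification (psum fullSum abs_fullSum_sub_psum_le)
open Literature.MathematicalPhysics.QuantumFieldTheory.Balaban1983to89.Beta.MarginalTelescoping (composedCoeff)

/-- **(W2′)₀ PER BASE POINT, first legs**: `hF_of_graded` for every `b ∈ Bset (Lc^m)`. [folklore] -/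
theorem hF_of_graded_avg (hμν : μ ≠ ν) {Lc : ℕ} (hL : 2 ≤ Lc) {M : ℕ → ℕ} (hML : ∀ n : ℕ, 2 ≤ n → M n ≤ n)
    {Bset : ℕ → Finset κB} {Gf : ℕ → κB → Pt → ℝ} {D : ℕ → ℝ} (hD : ∀ j, 0 ≤ D j)
    (h0 : ∀ n : ℕ, 2 ≤ n → ∀ b ∈ Bset n, ∀ v, |Gf n b v - gFree v| ≤ D 0 / (n : ℝ) ^ 2)
    (h1 : ∀ n : ℕ, 2 ≤ n → ∀ b ∈ Bset n, ∀ v (ρ : Fin 4),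
      |(Gf n b (v + unitVec ρ) - gFree (v + unitVec ρ)) - (Gf n b v - gFree v)| ≤ D 1 / (n : ℝ) ^ 3)
    (h2 : ∀ n : ℕ, 2 ≤ n → ∀ b ∈ Bset n, ∀ v,
      |(Gf n b (v + unitVec ν + unitVec μ) - gFree (v + unitVec ν + unitVec μ)) - (Gf n b (v + unitVec ν) - gFree (v + unitVec ν)) -
          (Gf n b (v + unitVec μ) - gFree (v + unitVec μ)) + (Gf n b v - gFree v)| ≤ D 2 / (n : ℝ) ^ 4) :
    ∀ m : ℕ, 1 ≤ m → ∀ b ∈ Bset (Lc ^ m), ∀ w ∈ annulus 4 0 (M (Lc ^ m)), ∀ i ∈ (Finset.univ : Finset BfIdx),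
      |stP μ ν (Gf (Lc ^ m) b) i w - (bfP hμν i).f (Lc ^ m) 0 w| ≤
        D ((bfP hμν i).a - 2) / ((supNorm w : ℝ) ^ ((bfP hμν i).a - 2) * ((Lc ^ m : ℕ) : ℝ) ^ 2) := by
  classical
  intro m hm b hb
  have key := hF_of_graded hμν hL hML (Gf := fun n v => if b ∈ Bset n then Gf n b v else gFree v) hD
    (fun n hn v => by
      by_cases hbn : b ∈ Bset n
      · simp only [hbn, if_true]; exact h0 n hn b hbn v
      · simp only [hbn, if_false, sub_self, abs_zero]; exact div_nonneg (hD 0) (by positivity))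
    (fun n hn v ρ => by
      by_cases hbn : b ∈ Bset n
      · simp only [hbn, if_true]; exact h1 n hn b hbn v ρ
      · simp only [hbn, if_false, sub_self, abs_zero]; exact div_nonneg (hD 1) (by positivity))
    (fun n hn v => by
      by_cases hbn : b ∈ Bset n
      · simp only [hbn, if_true]; exact h2 n hn b hbn v
      · simp only [hbn, if_false, sub_self, abs_zero, add_zero]; exact div_nonneg (hD 2) (by positivity))
    m hm
  simp only [hb, if_true] at key
  exact key

/-- **(W2′)₀ PER BASE POINT, second legs**: `hG_of_graded` for every `b ∈ Bset (Lc^m)`. [folklore] -/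
theorem hG_of_graded_avg (hμν : μ ≠ ν) {Lc : ℕ} (hL : 2 ≤ Lc) {M : ℕ → ℕ} (hML : ∀ n : ℕ, 2 ≤ n → M n ≤ n)
    {Bset : ℕ → Finset κB} {Gf : ℕ → κB → Pt → ℝ} {D : ℕ → ℝ} (hD : ∀ j, 0 ≤ D j)
    (h0 : ∀ n : ℕ, 2 ≤ n → ∀ b ∈ Bset n, ∀ v, |Gf n b v - gFree v| ≤ D 0 / (n : ℝ) ^ 2)
    (h1 : ∀ n : ℕ, 2 ≤ n → ∀ b ∈ Bset n, ∀ v (ρ : Fin 4),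
      |(Gf n b (v + unitVec ρ) - gFree (v + unitVec ρ)) - (Gf n b v - gFree v)| ≤ D 1 / (n : ℝ) ^ 3)
    (h2 : ∀ n : ℕ, 2 ≤ n → ∀ b ∈ Bset n, ∀ v,
      |(Gf n b (v + unitVec ν + unitVec μ) - gFree (v + unitVec ν + unitVec μ)) - (Gf n b (v + unitVec ν) - gFree (v + unitVec ν)) -
          (Gf n b (v + unitVec μ) - gFree (v + unitVec μ)) + (Gf n b v - gFree v)| ≤ D 2 / (n : ℝ) ^ 4) :
    ∀ m : ℕ, 1 ≤ m → ∀ b ∈ Bset (Lc ^ m), ∀ w ∈ annulus 4 0 (M (Lc ^ m)), ∀ i ∈ (Finset.univ : Finset BfIdx),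
      |stQ μ ν (Gf (Lc ^ m) b) i w - (bfQ hμν i).f (Lc ^ m) 0 w| ≤
        D ((bfQ hμν i).a - 2) / ((supNorm w : ℝ) ^ ((bfQ hμν i).a - 2) * ((Lc ^ m : ℕ) : ℝ) ^ 2) := by
  classical
  intro m hm b hb
  have key := hG_of_graded hμν hL hML (Gf := fun n v => if b ∈ Bset n then Gf n b v else gFree v) hD
    (fun n hn v => by
      by_cases hbn : b ∈ Bset n
      · simp only [hbn, if_true]; exact h0 n hn b hbn v
      · simp only [hbn, if_false, sub_self, abs_zero]; exact div_nonneg (hD 0) (by positivity))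
    (fun n hn v ρ => by
      by_cases hbn : b ∈ Bset n
      · simp only [hbn, if_true]; exact h1 n hn b hbn v ρ
      · simp only [hbn, if_false, sub_self, abs_zero]; exact div_nonneg (hD 1) (by positivity))
    (fun n hn v => by
      by_cases hbn : b ∈ Bset n
      · simp only [hbn, if_true]; exact h2 n hn b hbn v
      · simp only [hbn, if_false, sub_self, abs_zero, add_zero]; exact div_nonneg (hD 2) (by positivity))
    m hm
  simp only [hb, if_true] at key
  exact key

/-- **(W3a)₀ PER BASE POINT, first legs**: `hFtail_of_decay` for every `b ∈ Bset (Lc^m)`. [folklore] -/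
theorem hFtail_of_decay_avg (hμν : μ ≠ ν) {Lc : ℕ} {Bset : ℕ → Finset κB} {Gf : ℕ → κB → Pt → ℝ} {A : ℕ → ℝ} {δ : ℝ} {M : ℕ → ℕ}
    (hA : ∀ j, 0 ≤ A j)
    (d0 : ∀ n : ℕ, 2 ≤ n → ∀ b ∈ Bset n, ∀ v : Pt, v ≠ 0 → |Gf n b v| ≤ A 0 * Real.exp (-(δ / n) * supNorm v) / (supNorm v : ℝ) ^ 2)
    (d1 : ∀ n : ℕ, 2 ≤ n → ∀ b ∈ Bset n, ∀ v : Pt, v ≠ 0 → ∀ ρ : Fin 4,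
      |Gf n b (v + unitVec ρ) - Gf n b v| ≤ A 1 * Real.exp (-(δ / n) * supNorm v) / (supNorm v : ℝ) ^ 3)
    (d2 : ∀ n : ℕ, 2 ≤ n → ∀ b ∈ Bset n, ∀ v : Pt, v ≠ 0 →
      |Gf n b (v + unitVec ν + unitVec μ) - Gf n b (v + unitVec ν) - Gf n b (v + unitVec μ) + Gf n b v| ≤
        A 2 * Real.exp (-(δ / n) * supNorm v) / (supNorm v : ℝ) ^ 4)
    (hL : 2 ≤ Lc) :
    ∀ m : ℕ, 1 ≤ m → ∀ b ∈ Bset (Lc ^ m), ∀ r : ℕ, M (Lc ^ m) ≤ r → ∀ w ∈ annulus 4 r (r + 1), ∀ i ∈ (Finset.univ : Finset BfIdx),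
      |stP μ ν (Gf (Lc ^ m) b) i w| ≤ A ((bfP hμν i).a - 2) / ((r : ℝ) + 1) ^ (bfP hμν i).a *
        Real.exp (-(δ / ((Lc ^ m : ℕ) : ℝ)) * ((r : ℝ) + 1)) := by
  classical
  intro m hm b hb
  have hnn : ∀ (j k : ℕ) (n : ℕ) (v : Pt), 0 ≤ A j * Real.exp (-(δ / n) * supNorm v) / (supNorm v : ℝ) ^ k :=
    fun j k n v => div_nonneg (mul_nonneg (hA j) (Real.exp_nonneg _)) (by positivity)
  have key := hFtail_of_decay hμν (Gf := fun n v => if b ∈ Bset n then Gf n b v else 0) (A := A) (δ := δ) (M := M)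
    (fun n hn v hv => by
      by_cases hbn : b ∈ Bset n
      · simp only [hbn, if_true]; exact d0 n hn b hbn v hv
      · simp only [hbn, if_false, abs_zero]; exact hnn 0 2 n v)
    (fun n hn v hv ρ => by
      by_cases hbn : b ∈ Bset n
      · simp only [hbn, if_true]; exact d1 n hn b hbn v hv ρ
      · simp only [hbn, if_false, sub_self, abs_zero]; exact hnn 1 3 n v)
    (fun n hn v hv => by
      by_cases hbn : b ∈ Bset n
      · simp only [hbn, if_true]; exact d2 n hn b hbn v hv
      · simp only [hbn, if_false, sub_self, abs_zero, add_zero]; exact hnn 2 4 n v)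
    hL m hm
  simp only [hb, if_true] at key
  exact key

/-- **(W3a)₀ PER BASE POINT, second legs**: `hGtail_of_decay` for every `b ∈ Bset (Lc^m)`. [folklore] -/
theorem hGtail_of_decay_avg (hμν : μ ≠ ν) {Lc : ℕ} {Bset : ℕ → Finset κB} {Gf : ℕ → κB → Pt → ℝ} {A : ℕ → ℝ} {δ : ℝ} {M : ℕ → ℕ}
    (hA : ∀ j, 0 ≤ A j) (hδ : 0 < δ) (hM1 : ∀ L : ℕ, 2 ≤ L → 1 ≤ M L)
    (d0 : ∀ n : ℕ, 2 ≤ n → ∀ b ∈ Bset n, ∀ v : Pt, v ≠ 0 → |Gf n b v| ≤ A 0 * Real.exp (-(δ / n) * supNorm v) / (supNorm v : ℝ) ^ 2)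
    (d1 : ∀ n : ℕ, 2 ≤ n → ∀ b ∈ Bset n, ∀ v : Pt, v ≠ 0 → ∀ ρ : Fin 4,
      |Gf n b (v + unitVec ρ) - Gf n b v| ≤ A 1 * Real.exp (-(δ / n) * supNorm v) / (supNorm v : ℝ) ^ 3)
    (d2 : ∀ n : ℕ, 2 ≤ n → ∀ b ∈ Bset n, ∀ v : Pt, v ≠ 0 →
      |Gf n b (v + unitVec ν + unitVec μ) - Gf n b (v + unitVec ν) - Gf n b (v + unitVec μ) + Gf n b v| ≤
        A 2 * Real.exp (-(δ / n) * supNorm v) / (supNorm v : ℝ) ^ 4)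
    (hL : 2 ≤ Lc) :
    ∀ m : ℕ, 1 ≤ m → ∀ b ∈ Bset (Lc ^ m), ∀ r : ℕ, M (Lc ^ m) ≤ r → ∀ w ∈ annulus 4 r (r + 1), ∀ i ∈ (Finset.univ : Finset BfIdx),
      |stQ μ ν (Gf (Lc ^ m) b) i w| ≤ A ((bfQ hμν i).a - 2) * 2 ^ (bfQ hμν i).a / ((r : ℝ) + 1) ^ (bfQ hμν i).a := by
  classical
  intro m hm b hb
  have hnn : ∀ (j k : ℕ) (n : ℕ) (v : Pt), 0 ≤ A j * Real.exp (-(δ / n) * supNorm v) / (supNorm v : ℝ) ^ k :=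
    fun j k n v => div_nonneg (mul_nonneg (hA j) (Real.exp_nonneg _)) (by positivity)
  have key := hGtail_of_decay hμν (Gf := fun n v => if b ∈ Bset n then Gf n b v else 0) (A := A) (M := M) hA hδ hM1
    (fun n hn v hv => by
      by_cases hbn : b ∈ Bset n
      · simp only [hbn, if_true]; exact d0 n hn b hbn v hv
      · simp only [hbn, if_false, abs_zero]; exact hnn 0 2 n v)
    (fun n hn v hv ρ => by
      by_cases hbn : b ∈ Bset n
      · simp only [hbn, if_true]; exact d1 n hn b hbn v hv ρ
      · simp only [hbn, if_false, sub_self, abs_zero]; exact hnn 1 3 n v)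
    (fun n hn v hv => by
      by_cases hbn : b ∈ Bset n
      · simp only [hbn, if_true]; exact d2 n hn b hbn v hv
      · simp only [hbn, if_false, sub_self, abs_zero, add_zero]; exact hnn 2 4 n v)
    hL m hm
  simp only [hb, if_true] at key
  exact key

/-- **WINDOW TRUNCATION OF A BASE-POINT-AVERAGED FULL-SUM IDENTIFICATION** (`hident_of_fullSum_graded` for a convex combination): a
`b`-FREE shellwise exponential tail of every `K_{m,b}` beyond `M(Lc^m)` makes the window truncation uniform in `b`, so
`|composedCoeff μC m − Σ_b wt_b·fullSum K_{m,b}| ≤ U` gives a window radius `R₀ ≥ M(Lc^m)` with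
`|composedCoeff μC m − Σ_b wt_b·Σ_{0<‖w‖∞≤R₀} K_{m,b}(w)| ≤ U + ε`. [folklore] -/
theorem hident_of_fullSum_graded_avg {μC : ℕ → ℕ → ℝ} {K : ℕ → κB → Pt → ℝ} {Lc : ℕ} (hLc : 1 ≤ Lc) {M : ℕ → ℕ} {E δ U : ℝ}
    (hE : 0 ≤ E) (hδ : 0 < δ) {Bset : ℕ → Finset κB} {wt : ℕ → κB → ℝ}
    (hwt0 : ∀ m : ℕ, 1 ≤ m → ∀ b ∈ Bset (Lc ^ m), 0 ≤ wt (Lc ^ m) b) (hwt1 : ∀ m : ℕ, 1 ≤ m → ∑ b ∈ Bset (Lc ^ m), wt (Lc ^ m) b = 1)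
    (htail : ∀ m : ℕ, 1 ≤ m → ∀ b ∈ Bset (Lc ^ m), ∀ r : ℕ, M (Lc ^ m) ≤ r → ∀ w ∈ annulus 4 r (r + 1),
      |K m b w| ≤ E / ((r : ℝ) + 1) ^ 4 * Real.exp (-(δ / ((Lc ^ m : ℕ) : ℝ)) * ((r : ℝ) + 1)))
    (hU : ∀ m : ℕ, 1 ≤ m → |composedCoeff μC m - ∑ b ∈ Bset (Lc ^ m), wt (Lc ^ m) b * fullSum (K m b)| ≤ U) {ε : ℝ} (hε : 0 < ε) :
    ∀ m : ℕ, 1 ≤ m → ∃ R₀ : ℕ, M (Lc ^ m) ≤ R₀ ∧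
      |composedCoeff μC m - ∑ b ∈ Bset (Lc ^ m), wt (Lc ^ m) b * ∑ w ∈ annulus 4 0 R₀, K m b w| ≤ U + ε := by
  intro m hm
  have hn : (0 : ℝ) < ((Lc ^ m : ℕ) : ℝ) := by
    have : 0 < Lc ^ m := pow_pos (by omega) m
    exact_mod_cast this
  set T : ℝ := 80 * E * (1 + ((Lc ^ m : ℕ) : ℝ) / δ) with hT
  have hT0 : 0 ≤ T := by rw [hT]; positivity
  obtain ⟨N₀, hN₀⟩ := exists_nat_gt (T / ε)
  set R₀ : ℕ := max (M (Lc ^ m)) N₀ with hR₀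
  refine ⟨R₀, le_max_left _ _, ?_⟩
  have hNpos : (0 : ℝ) < (R₀ : ℝ) + 1 := by positivity
  have hN₀' : T / ε < (R₀ : ℝ) + 1 :=
    hN₀.trans_le (by exact_mod_cast (le_max_right (M (Lc ^ m)) N₀).trans (Nat.le_succ _))
  have hsmall : T / ((R₀ : ℝ) + 1) ≤ ε := by
    rw [div_le_iff₀ hNpos]
    have := (div_lt_iff₀ hε).1 hN₀'
    nlinarith
  -- the truncation error is `≤ ε` for EVERY base point (the tail constant is `b`-free)
  have hb : ∀ b ∈ Bset (Lc ^ m), |fullSum (K m b) - psum (K m b) R₀| ≤ ε := fun b hb =>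
    (abs_fullSum_sub_psum_le hE hδ hn (htail m hm b hb) (le_max_left _ _)).trans hsmall
  have hconv : |∑ b ∈ Bset (Lc ^ m), wt (Lc ^ m) b * (fullSum (K m b) - psum (K m b) R₀)| ≤ ε :=
    ComposedRoad.abs_convexComb_le (hwt0 m hm) (hwt1 m hm) hb
  have hsplit : composedCoeff μC m - ∑ b ∈ Bset (Lc ^ m), wt (Lc ^ m) b * ∑ w ∈ annulus 4 0 R₀, K m b w =
      (composedCoeff μC m - ∑ b ∈ Bset (Lc ^ m), wt (Lc ^ m) b * fullSum (K m b)) +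
        ∑ b ∈ Bset (Lc ^ m), wt (Lc ^ m) b * (fullSum (K m b) - psum (K m b) R₀) := by
    simp only [psum, mul_sub, Finset.sum_sub_distrib]
    ring
  rw [hsplit]
  exact (abs_add_le _ _).trans (add_le_add (hU m hm) hconv)

/-- **THE `hident` BINDER OF THE AVERAGED WALL FROM (W3b′)ₛₜ-avg**: per-base-point stencil-leg tails (`b`-free constants) and
`|composedCoeff μC m − Σ_b wt_b·fullSum (stK G_{Lc^m,b})| ≤ U` ⟹ the identification binder of
`ComposedRoad.oneLoopDrift_of_composedLegInterfacePow_identity_avg` with `U + ε`. [folklore] -/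
theorem hident_of_stencilFullSum_avg (hμν : μ ≠ ν) {N : ℝ} {Lc : ℕ} (hL : 2 ≤ Lc) {μC : ℕ → ℕ → ℝ}
    {Bset : ℕ → Finset κB} {wt : ℕ → κB → ℝ} {Gf : ℕ → κB → Pt → ℝ} {R' S' : BfIdx → ℝ} {δ U : ℝ} {M : ℕ → ℕ}
    (hwt0 : ∀ n : ℕ, 2 ≤ n → ∀ b ∈ Bset n, 0 ≤ wt n b) (hwt1 : ∀ n : ℕ, 2 ≤ n → ∑ b ∈ Bset n, wt n b = 1)
    (hR' : ∀ i ∈ (Finset.univ : Finset BfIdx), 0 ≤ R' i) (hS' : ∀ i ∈ (Finset.univ : Finset BfIdx), 0 ≤ S' i) (hδ : 0 < δ)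
    (hFtail : ∀ m : ℕ, 1 ≤ m → ∀ b ∈ Bset (Lc ^ m), ∀ r : ℕ, M (Lc ^ m) ≤ r → ∀ w ∈ annulus 4 r (r + 1),
      ∀ i ∈ (Finset.univ : Finset BfIdx),
      |stP μ ν (Gf (Lc ^ m) b) i w| ≤ R' i / ((r : ℝ) + 1) ^ (bfP hμν i).a * Real.exp (-(δ / ((Lc ^ m : ℕ) : ℝ)) * ((r : ℝ) + 1)))
    (hGtail : ∀ m : ℕ, 1 ≤ m → ∀ b ∈ Bset (Lc ^ m), ∀ r : ℕ, M (Lc ^ m) ≤ r → ∀ w ∈ annulus 4 r (r + 1),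
      ∀ i ∈ (Finset.univ : Finset BfIdx), |stQ μ ν (Gf (Lc ^ m) b) i w| ≤ S' i / ((r : ℝ) + 1) ^ (bfQ hμν i).a)
    (hU : ∀ m : ℕ, 1 ≤ m → |composedCoeff μC m - ∑ b ∈ Bset (Lc ^ m), wt (Lc ^ m) b * fullSum (stK μ ν N (Gf (Lc ^ m) b))| ≤ U)
    {ε : ℝ} (hε : 0 < ε) :
    ∀ m : ℕ, 1 ≤ m → ∃ R₀ : ℕ, M (Lc ^ m) ≤ R₀ ∧
      |composedCoeff μC m - ∑ b ∈ Bset (Lc ^ m), wt (Lc ^ m) b * ∑ w ∈ annulus 4 0 R₀, toReal w μ * toReal w ν *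
        ∑ i ∈ (Finset.univ : Finset BfIdx), bfCoeff N i * (stP μ ν (Gf (Lc ^ m) b) i w * stQ μ ν (Gf (Lc ^ m) b) i w)| ≤ U + ε := by
  have hE : 0 ≤ ∑ i ∈ (Finset.univ : Finset BfIdx), |bfCoeff N i| * (R' i * S' i) :=
    Finset.sum_nonneg fun i hi => mul_nonneg (abs_nonneg _) (mul_nonneg (hR' i hi) (hS' i hi))
  have hpow : ∀ m : ℕ, 1 ≤ m → 2 ≤ Lc ^ m := fun m hm => hL.trans (Nat.le_self_pow (by omega) Lc)
  have htail : ∀ m : ℕ, 1 ≤ m → ∀ b ∈ Bset (Lc ^ m), ∀ r : ℕ, M (Lc ^ m) ≤ r → ∀ w ∈ annulus 4 r (r + 1),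
      |stK μ ν N (Gf (Lc ^ m) b) w| ≤ (∑ i ∈ (Finset.univ : Finset BfIdx), |bfCoeff N i| * (R' i * S' i)) / ((r : ℝ) + 1) ^ 4 *
        Real.exp (-(δ / ((Lc ^ m : ℕ) : ℝ)) * ((r : ℝ) + 1)) :=
    fun m hm b hb r hr w hw =>
      abs_stK_le_of_legTails hμν (Real.exp_nonneg _) hR' hw (hFtail m hm b hb r hr w hw) (hGtail m hm b hb r hr w hw)
  exact hident_of_fullSum_graded_avg (K := fun m b => stK μ ν N (Gf (Lc ^ m) b)) (by omega) hE hδ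
    (fun m hm => hwt0 _ (hpow m hm)) (fun m hm => hwt1 _ (hpow m hm)) htail hU hε

end Avg

section AvgWall

variable {μ ν : Fin 4} {κB : Type*}

open Literature.Probability.LatticeModels (annulus)
open FlowStep DagBinding
open Literature.MathematicalPhysics.QuantumFieldTheory.Balaban1983to89.Beta.LargeLWindow.WindowDecomposition (constA)
open Literature.MathematicalPhysics.QuantumFieldTheory.Balaban1983to89.Beta.Drift (OneLoopDrift)
open Literature.MathematicalPhysics.QuantumFieldTheory.Balaban1983to89.Beta.MarginalTelescoping (composedCoeff IdentityForm)
open Literature.MathematicalPhysics.QuantumFieldTheory.Balaban1983to89.Beta.LeadingCoefficient (kappaBal transverseValue)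
open Literature.MathematicalPhysics.QuantumFieldTheory.Balaban1983to89.Beta.RemainderChain (RemainderConst)
open Literature.MathematicalPhysics.QuantumFieldTheory.Balaban1983to89.Beta.DriftRemainder
  (endpointExistence_of_drift_remainderConst)
open Literature.MathematicalPhysics.QuantumFieldTheory.Balaban1983to89.Beta.WindowIdentification (fullSum)
open Literature.MathematicalPhysics.QuantumFieldTheory.Balaban1983to89.Beta.ComposedRoad
  (oneLoopDrift_of_composedLegInterfacePow_identity_avg)

/-- **THE BASE-POINT-AVERAGED SCALAR WALL** (RULING (R13-3)): `ComposedRoad.oneLoopDrift_of_composedLegInterfacePow_identity_avg` with the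
realised table and SCALAR inputs — window data; convex weights `wt n` on finite base-point sets `Bset n`; a kernel family `G_{n,b}` with the six
graded bounds (`h0/h1/h2` against `gFree`, `d0/d1/d2` off the origin) for every `b ∈ Bset n`, constants free of `b`; ONE comparison per scale of
`composedCoeff μC m` with the `wt`-combination of the full lattice sums `fullSum (stK G_{Lc^m,b})` ((W3b′)ₛₜ-avg); `IdentityForm`.  SAME
conclusion and constant as `oneLoopDrift_of_scalarBounds`. [folklore] -/
theorem oneLoopDrift_of_scalarBounds_avg {β : HBeta} (S : B12Beta.OneLoopSplit β) (hμν : μ ≠ ν) {N : ℝ} (hN : N ≠ 0)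
    {Lc : ℕ} (hL : 2 ≤ Lc) {μC : ℕ → ℕ → ℝ} {Bset : ℕ → Finset κB} {wt : ℕ → κB → ℝ} {Gf : ℕ → κB → Pt → ℝ} {D A : ℕ → ℝ}
    (hD : ∀ j, 0 ≤ D j) (hA : ∀ j, 0 ≤ A j) {δ U cc : ℝ} {M : ℕ → ℕ} (hδ : 0 < δ)
    (hwt0 : ∀ n : ℕ, 2 ≤ n → ∀ b ∈ Bset n, 0 ≤ wt n b) (hwt1 : ∀ n : ℕ, 2 ≤ n → ∑ b ∈ Bset n, wt n b = 1)
    (hc : 1 ≤ cc) (hM : ∀ L : ℕ, 2 ≤ L → 1 ≤ M L ∧ (L : ℝ) ≤ cc * M L) (hML : ∀ L : ℕ, 2 ≤ L → M L ≤ L)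
    (h0 : ∀ n : ℕ, 2 ≤ n → ∀ b ∈ Bset n, ∀ v, |Gf n b v - gFree v| ≤ D 0 / (n : ℝ) ^ 2)
    (h1 : ∀ n : ℕ, 2 ≤ n → ∀ b ∈ Bset n, ∀ v (ρ : Fin 4),
      |(Gf n b (v + unitVec ρ) - gFree (v + unitVec ρ)) - (Gf n b v - gFree v)| ≤ D 1 / (n : ℝ) ^ 3)
    (h2 : ∀ n : ℕ, 2 ≤ n → ∀ b ∈ Bset n, ∀ v,
      |(Gf n b (v + unitVec ν + unitVec μ) - gFree (v + unitVec ν + unitVec μ)) - (Gf n b (v + unitVec ν) - gFree (v + unitVec ν)) -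
          (Gf n b (v + unitVec μ) - gFree (v + unitVec μ)) + (Gf n b v - gFree v)| ≤ D 2 / (n : ℝ) ^ 4)
    (d0 : ∀ n : ℕ, 2 ≤ n → ∀ b ∈ Bset n, ∀ v : Pt, v ≠ 0 → |Gf n b v| ≤ A 0 * Real.exp (-(δ / n) * supNorm v) / (supNorm v : ℝ) ^ 2)
    (d1 : ∀ n : ℕ, 2 ≤ n → ∀ b ∈ Bset n, ∀ v : Pt, v ≠ 0 → ∀ ρ : Fin 4,
      |Gf n b (v + unitVec ρ) - Gf n b v| ≤ A 1 * Real.exp (-(δ / n) * supNorm v) / (supNorm v : ℝ) ^ 3)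
    (d2 : ∀ n : ℕ, 2 ≤ n → ∀ b ∈ Bset n, ∀ v : Pt, v ≠ 0 →
      |Gf n b (v + unitVec ν + unitVec μ) - Gf n b (v + unitVec ν) - Gf n b (v + unitVec μ) + Gf n b v| ≤
        A 2 * Real.exp (-(δ / n) * supNorm v) / (supNorm v : ℝ) ^ 4)
    (hU : ∀ m : ℕ, 1 ≤ m → |composedCoeff μC m - ∑ b ∈ Bset (Lc ^ m), wt (Lc ^ m) b * fullSum (stK μ ν N (Gf (Lc ^ m) b))| ≤ U)
    (hid : IdentityForm μC S.β0) :
    OneLoopDrift (B12Normalization.stepBal N Lc)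
      (constA (|kappaBal N| * 24 + |kappaBal N| * 110592) (bubbleConst Finset.univ (bfCoeff N) (bfP hμν) (bfQ hμν))
          ((80 * (∑ i ∈ (Finset.univ : Finset BfIdx), |bfCoeff N i| *
              (A ((bfP hμν i).a - 2) * (A ((bfQ hμν i).a - 2) * 2 ^ (bfQ hμν i).a))) * (1 + cc / δ) + (U + 1)) +
            80 * ∑ i ∈ (Finset.univ : Finset BfIdx), |bfCoeff N i| *
              ((((bfP hμν i).A + (bfP hμν i).B) * D ((bfQ hμν i).a - 2) + D ((bfP hμν i).a - 2) * ((bfQ hμν i).A + (bfQ hμν i).B) +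
                D ((bfP hμν i).a - 2) * D ((bfQ hμν i).a - 2))))
          cc (kappaBal N * transverseValue)) S.β0 :=
  have hR' : ∀ i ∈ (Finset.univ : Finset BfIdx), 0 ≤ A ((bfP hμν i).a - 2) := fun i _ => hA _
  have hS' : ∀ i ∈ (Finset.univ : Finset BfIdx), 0 ≤ A ((bfQ hμν i).a - 2) * 2 ^ (bfQ hμν i).a :=
    fun i _ => mul_nonneg (hA _) (by positivity)
  oneLoopDrift_of_composedLegInterfacePow_identity_avg S (hdeg_bf hμν) hμν hN (hval_bf hμν N) hL
    (F' := fun b i n w => stP μ ν (Gf n b) i w) (G' := fun b i n w => stQ μ ν (Gf n b) i w) hwt0 hwt1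
    (fun _ _ => hD _) (fun _ _ => hD _) hR' hS' hδ hc hM hML
    (hF_of_graded_avg hμν hL hML hD h0 h1 h2) (hG_of_graded_avg hμν hL hML hD h0 h1 h2)
    (hFtail_of_decay_avg hμν hA d0 d1 d2 hL) (hGtail_of_decay_avg hμν hA hδ (fun L hL2 => (hM L hL2).1) d0 d1 d2 hL)
    (hident_of_stencilFullSum_avg hμν hL hwt0 hwt1 hR' hS' hδ (hFtail_of_decay_avg hμν hA d0 d1 d2 hL)
      (hGtail_of_decay_avg hμν hA hδ (fun L hL2 => (hM L hL2).1) d0 d1 d2 hL) hU one_pos) hid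

/-- **`EndpointExistence` FROM THE BASE-POINT-AVERAGED SCALAR INPUTS** (RULING (R13-3); `endpointExistence_of_scalarBounds` with the
averaged identification). [folklore] -/
theorem endpointExistence_of_scalarBounds_avg {β : HBeta} {Cn : B12.Construction} (hgen : ForwardGenerated Cn β)
    (S : B12Beta.OneLoopSplit β) (hμν : μ ≠ ν) {N : ℝ} (hN : N ≠ 0)
    {Lc : ℕ} (hL : 2 ≤ Lc) {μC : ℕ → ℕ → ℝ} {Bset : ℕ → Finset κB} {wt : ℕ → κB → ℝ} {Gf : ℕ → κB → Pt → ℝ} {D A : ℕ → ℝ}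
    (hD : ∀ j, 0 ≤ D j) (hA : ∀ j, 0 ≤ A j) {δ U cc : ℝ} {M : ℕ → ℕ} (hδ : 0 < δ)
    (hwt0 : ∀ n : ℕ, 2 ≤ n → ∀ b ∈ Bset n, 0 ≤ wt n b) (hwt1 : ∀ n : ℕ, 2 ≤ n → ∑ b ∈ Bset n, wt n b = 1)
    (hc : 1 ≤ cc) (hM : ∀ L : ℕ, 2 ≤ L → 1 ≤ M L ∧ (L : ℝ) ≤ cc * M L) (hML : ∀ L : ℕ, 2 ≤ L → M L ≤ L)
    (h0 : ∀ n : ℕ, 2 ≤ n → ∀ b ∈ Bset n, ∀ v, |Gf n b v - gFree v| ≤ D 0 / (n : ℝ) ^ 2)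
    (h1 : ∀ n : ℕ, 2 ≤ n → ∀ b ∈ Bset n, ∀ v (ρ : Fin 4),
      |(Gf n b (v + unitVec ρ) - gFree (v + unitVec ρ)) - (Gf n b v - gFree v)| ≤ D 1 / (n : ℝ) ^ 3)
    (h2 : ∀ n : ℕ, 2 ≤ n → ∀ b ∈ Bset n, ∀ v,
      |(Gf n b (v + unitVec ν + unitVec μ) - gFree (v + unitVec ν + unitVec μ)) - (Gf n b (v + unitVec ν) - gFree (v + unitVec ν)) -
          (Gf n b (v + unitVec μ) - gFree (v + unitVec μ)) + (Gf n b v - gFree v)| ≤ D 2 / (n : ℝ) ^ 4)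
    (d0 : ∀ n : ℕ, 2 ≤ n → ∀ b ∈ Bset n, ∀ v : Pt, v ≠ 0 → |Gf n b v| ≤ A 0 * Real.exp (-(δ / n) * supNorm v) / (supNorm v : ℝ) ^ 2)
    (d1 : ∀ n : ℕ, 2 ≤ n → ∀ b ∈ Bset n, ∀ v : Pt, v ≠ 0 → ∀ ρ : Fin 4,
      |Gf n b (v + unitVec ρ) - Gf n b v| ≤ A 1 * Real.exp (-(δ / n) * supNorm v) / (supNorm v : ℝ) ^ 3)
    (d2 : ∀ n : ℕ, 2 ≤ n → ∀ b ∈ Bset n, ∀ v : Pt, v ≠ 0 →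
      |Gf n b (v + unitVec ν + unitVec μ) - Gf n b (v + unitVec ν) - Gf n b (v + unitVec μ) + Gf n b v| ≤
        A 2 * Real.exp (-(δ / n) * supNorm v) / (supNorm v : ℝ) ^ 4)
    (hU : ∀ m : ℕ, 1 ≤ m → |composedCoeff μC m - ∑ b ∈ Bset (Lc ^ m), wt (Lc ^ m) b * fullSum (stK μ ν N (Gf (Lc ^ m) b))| ≤ U)
    (hid : IdentityForm μC S.β0)
    {rr γ₀ β' : ℝ} (hγ₀ : 0 < γ₀) (hrem : RemainderConst S γ₀ rr) (hr : rr ≤ B12Normalization.stepBal N Lc)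
    (hβ' : 0 ≤ β') (hcont : BetaContH γ₀ β) (hup : BetaUpperH β' γ₀ β) : EndpointExistence Cn :=
  endpointExistence_of_drift_remainderConst hgen S hγ₀
    (oneLoopDrift_of_scalarBounds_avg S hμν hN hL hD hA hδ hwt0 hwt1 hc hM hML h0 h1 h2 d0 d1 d2 hU hid) hrem hr hβ' hcont hup

end AvgWall

/-! ## Examples -/

section Examples

/-- The square table at `c = 1`: `hval κ = c₄²`, three times the unit ghost table's `c₄²/3`. [folklore] -/
example {μ ν : Fin 4} (hμν : μ ≠ ν) (x : E4) (hx : x ≠ 0) :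
    x μ * x ν * contBubble Finset.univ (sqCoeff 1) (sqP hμν) (sqQ hμν) x = leadingIntegrand (c4 ^ 2) μ ν x := by
  simpa using hval_sq hμν 1 x hx

/-- The realised table at `N = 2`: `hval κ = kappaBal 2` (B12's group). [folklore] -/
example {μ ν : Fin 4} (hμν : μ ≠ ν) (x : E4) (hx : x ≠ 0) :
    x μ * x ν * contBubble Finset.univ (bfCoeff 2) (bfP hμν) (bfQ hμν) x = leadingIntegrand (kappaBal 2) μ ν x := hval_bf hμν 2 x hx

/-- The realised table re-based at the FAR corner `v + e_μ + e_ν` (shift `α = e_μ + e_ν`, `r = 1`) has the same `hval`. [folklore] -/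
example {μ ν : Fin 4} (hμν : μ ≠ ν) (N : ℝ) (x : E4) (hx : x ≠ 0) :
    x μ * x ν * contBubble Finset.univ (bfCoeff N) (bfPsh hμν (supNorm_unitVec_add_le hμν) le_rfl)
        (bfQsh hμν (supNorm_unitVec_add_le hμν) le_rfl) x = leadingIntegrand (kappaBal N) μ ν x :=
  hval_bfSh hμν _ le_rfl N x hx

/-- degree bookkeeping of the third product: `3 + 3`. [folklore] -/
example {μ ν : Fin 4} (hμν : μ ≠ ν) : (sqP hμν 2).a + (sqQ hμν 2).a = 6 := hdeg_sq hμν 2 (Finset.mem_univ _)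

end Examples

end Literature.MathematicalPhysics.QuantumFieldTheory.Balaban1983to89.Beta.SquareTable
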